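import Summits.QuantumFields.YangMills.Theorems.BalabanUVNodesN06Thm312313AtPinsStateSUCLE
import Literature.MathematicalPhysics.QuantumFieldTheory.Balaban1983to89.B9BlockKeyTransferXSK
import Literature.MathematicalPhysics.QuantumFieldTheory.Balaban1983to89.B9BlockKeyTransferXBK
import Literature.MathematicalPhysics.QuantumFieldTheory.Balaban1983to89.Node00.OpsYBlockPinOfRecordB
import Literature.MathematicalPhysics.QuantumFieldTheory.Balaban1983to89.B9GeoNbrCountBlocksY
import Literature.MathematicalPhysics.QuantumFieldTheory.Balaban1983to89.B9Local342MonoConst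
import Literature.MathematicalPhysics.QuantumFieldTheory.Balaban1983to89.Node00.OpsYC2OfRecord
import Literature.MathematicalPhysics.QuantumFieldTheory.Balaban1983to89.B9C2FormMajTorusLettersAtMemberY
import Summits.QuantumFields.YangMills.Theorems.BalabanUVNodesN06Rgd2LegAtPinsPhysPU
import Literature.MathematicalPhysics.QuantumFieldTheory.Balaban1983to89.B9SectBStepUClosedSUOfSections
import Literature.MathematicalPhysics.QuantumFieldTheory.Balaban1983to89.Node00.OpsYOps312OfRecord
import Literature.MathematicalPhysics.QuantumFieldTheory.Balaban1983to89.Node00.OpsYBondMapOfRecord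
import Summits.QuantumFields.YangMills.Theorems.BalabanUVNodesN06G0QstarLettersLegAtPinsPU
import Literature.MathematicalPhysics.QuantumFieldTheory.Balaban1983to89.B9LeafXCodedKnitU
import Summits.QuantumFields.YangMills.Theorems.BalabanUVNodesN06Level13D2Rgdd13LayerAtPinsPUW
import Summits.QuantumFields.YangMills.Theorems.BalabanUVNodesN06G0CoreFromThm310AtPinsGUSPC
import Literature.MathematicalPhysics.QuantumFieldTheory.Balaban1983to89.B9Eq3132FromStateR
import Literature.MathematicalPhysics.QuantumFieldTheory.Balaban1983to89.B9RWSumsDefinitePinsPairMDir4Rows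
import Summits.QuantumFields.YangMills.Theorems.BalabanUVNodesN06G0LayerFromThm310AtPinsGUSP
import Summits.QuantumFields.YangMills.Theorems.BalabanUVNodesN06G0QstarL2LettersLegAtPinsPU
import Summits.QuantumFields.YangMills.Theorems.BalabanUVNodesN06RgdILegAtPinsPhysR
import Summits.QuantumFields.YangMills.Theorems.BalabanUVNodesN06RgdDsLegAtPinsPhysR
import Summits.QuantumFields.YangMills.Theorems.BalabanUVNodesN06DivLegAtPinsPhysR
import Summits.QuantumFields.YangMills.Theorems.BalabanUVNodesN06HHLegAtPinsPhysRU
import Summits.QuantumFields.YangMills.Theorems.BalabanUVNodesN06WGpLegAtPinsPhysPU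
import Summits.QuantumFields.YangMills.Theorems.BalabanUVNodesN06RgdH43LegAtPinsPhysPU
import Literature.MathematicalPhysics.QuantumFieldTheory.Balaban1983to89.B9PlaquetteBinderOfReg335Y
import Summits.QuantumFields.YangMills.Theorems.BalabanUVNodesN06CutL2LettersAtPinsPhysR
import Summits.QuantumFields.YangMills.Theorems.BalabanUVNodesN06DirKinematicsAtPinsR
import Summits.QuantumFields.YangMills.Theorems.BalabanUVNodesN06DirKinematics3AtPinsSN
import Summits.QuantumFields.YangMills.Theorems.BalabanUVNodesN06Proj349AtPinsPhysRC
import Literature.MathematicalPhysics.QuantumFieldTheory.Balaban1983to89.B9Ineq349SiteThresholdRateNamed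
import Literature.MathematicalPhysics.QuantumFieldTheory.Balaban1983to89.B9Thm31GpMajFromPinsPairMR
import Summits.QuantumFields.YangMills.Theorems.BalabanUVNodesN06CurrentMajAtPinsIdPhys
import Literature.MathematicalPhysics.QuantumFieldTheory.Balaban1983to89.B9Ineq349SiteFacesAtLettersR
import Literature.MathematicalPhysics.QuantumFieldTheory.Balaban1983to89.B9Thm314Thm315LayerR
import Summits.QuantumFields.YangMills.Theorems.BalabanUVNodesN06ProbeZeroAtPinsPhysR
import Summits.QuantumFields.YangMills.Theorems.BalabanUVNodesN06MixedLegAtPinsPhysR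
import Summits.QuantumFields.YangMills.Theorems.BalabanUVNodesN06MixedFactorAtPinsPhysR
import Summits.QuantumFields.YangMills.Theorems.BalabanUVNodesN06SplitMajorantsAtPinsPhysR
import Summits.QuantumFields.YangMills.Theorems.BalabanUVNodesN06HgVacuousRC
import Literature.MathematicalPhysics.QuantumFieldTheory.Balaban1983to89.B9Thm39FacesAtLettersRC
import Literature.MathematicalPhysics.QuantumFieldTheory.Balaban1983to89.B9Thm315SectEStarRepAtLettersR
import Summits.QuantumFields.YangMills.Theorems.BalabanUVNodesN06WalkLettersAtRecordR
import Summits.QuantumFields.YangMills.Theorems.BalabanUVNodesN06Row17FromRow19LettersDir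
import Summits.QuantumFields.YangMills.Theorems.BalabanUVNodesN06Proj349AtPinsPhys
import Summits.QuantumFields.YangMills.Theorems.BalabanUVNodesN06SectBOfFrameV7
import Summits.QuantumFields.YangMills.Theorems.BalabanUVNodesN06SectDUnitsAtPinsPhys
import Literature.MathematicalPhysics.QuantumFieldTheory.Balaban1983to89.B9CoReadingCoordsHolderAdmReadings
import Literature.MathematicalPhysics.QuantumFieldTheory.Balaban1983to89.B9CoReadingCoordsHolderSAdmReadings
import Literature.MathematicalPhysics.QuantumFieldTheory.Balaban1983to89.B9CoReadingCoordsHolderSNearReadings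
import Literature.MathematicalPhysics.QuantumFieldTheory.Balaban1983to89.B9H43GpFromPinsSN
import Literature.MathematicalPhysics.QuantumFieldTheory.Balaban1983to89.B9H44GFromPinsSN
import Literature.MathematicalPhysics.QuantumFieldTheory.Balaban1983to89.B9H44mFromPinsKA
import Summits.QuantumFields.YangMills.Theorems.BalabanUVNodesN06DirKinematics3AtPins
import Summits.QuantumFields.YangMills.Theorems.BalabanUVNodesN06Ids3152AtPinsPhys
import Literature.MathematicalPhysics.QuantumFieldTheory.Balaban1983to89.Node00.OpsYExpsOfRecordV3
import Literature.MathematicalPhysics.QuantumFieldTheory.Balaban1983to89.B9WalkLettersOpsO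
import Literature.MathematicalPhysics.QuantumFieldTheory.Balaban1983to89.B9Local342AtOpsWalkYO
import Summits.QuantumFields.YangMills.Theorems.BalabanUVNodesN06WalkLettersAtRecordRO
import Summits.QuantumFields.YangMills.Theorems.BalabanUVNodesN06DirKinematics3AtPinsSNO
import Literature.MathematicalPhysics.QuantumFieldTheory.Balaban1983to89.B9RWSums346MixedFactorOfLegsY
import Summits.QuantumFields.YangMills.Theorems.BalabanUVNodesN06WalkLettersAtRecordROPar
import Literature.MathematicalPhysics.QuantumFieldTheory.Balaban1983to89.B9Cor35ComparisonsEH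
import Literature.MathematicalPhysics.QuantumFieldTheory.Balaban1983to89.B9CoReadingCoordsL2Pair
import Summits.QuantumFields.YangMills.Theorems.BalabanUVNodesN06CoReadingsOfPins
import Summits.QuantumFields.YangMills.Theorems.BalabanUVNodesN06Level13D2Rgdd13LayerAtPinsPUWPar
import Summits.QuantumFields.YangMills.Theorems.BalabanUVNodesN06StepL2AtPinsPhysRParG
import Summits.QuantumFields.YangMills.Theorems.BalabanUVNodesN06RgdDsLegAtPinsPhysRPar
import Summits.QuantumFields.YangMills.Theorems.BalabanUVNodesN06SectDIdentitiesAtPinsPhysQ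
import Summits.QuantumFields.YangMills.Theorems.BalabanUVNodesN06SectDUnitsAtPinsPhysQ
import Summits.QuantumFields.YangMills.Theorems.BalabanUVNodesN06Proj349AtPinsPhysRCPar
import Summits.QuantumFields.YangMills.Theorems.BalabanUVNodesN06SplitMajorantsAtPinsPhysRPar
import Summits.QuantumFields.YangMills.Theorems.BalabanUVNodesN06WELegAtPinsPhysPUBPar
import Summits.QuantumFields.YangMills.Theorems.BalabanUVNodesN06WGpLegAtPinsPhysPUPar
import Summits.QuantumFields.YangMills.Theorems.BalabanUVNodesN06RgdH43LegAtPinsPhysPUPar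
import Summits.QuantumFields.YangMills.Theorems.BalabanUVNodesN06Rgd2LegAtPinsPhysPUPar
import Summits.QuantumFields.YangMills.Theorems.BalabanUVNodesN06RgdILegAtPinsPhysRPar
import Summits.QuantumFields.YangMills.Theorems.BalabanUVNodesN06CutL2LettersAtPinsPhysRPar
import Summits.QuantumFields.YangMills.Theorems.BalabanUVNodesN06CutL2LettersAtPinsPhysRParB
import Summits.QuantumFields.YangMills.Theorems.BalabanUVNodesN06HHLegAtPinsPhysRUPar
import Summits.QuantumFields.YangMills.Theorems.BalabanUVNodesN06G0QstarL2LettersLegAtPinsPUPar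
import Summits.QuantumFields.YangMills.Theorems.BalabanUVNodesN06G0QstarLettersLegAtPinsPUPar
import Summits.QuantumFields.YangMills.Theorems.BalabanUVNodesN06Thm312313AtPinsStateSUCLEPar
import Literature.MathematicalPhysics.QuantumFieldTheory.Balaban1983to89.Node00.OpsYSectDCoordsQ
import Literature.MathematicalPhysics.QuantumFieldTheory.Balaban1983to89.Node00.OpsYOps312OfRecordPar
import Literature.MathematicalPhysics.QuantumFieldTheory.Balaban1983to89.Node00.OpsYRecordV10
import Literature.MathematicalPhysics.QuantumFieldTheory.Balaban1983to89.B9LeafXCodedKnitUParH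
import Literature.MathematicalPhysics.QuantumFieldTheory.Balaban1983to89.Node00.CarriersYUParH
import Literature.MathematicalPhysics.QuantumFieldTheory.Balaban1983to89.Node00.OpsYExpsOfRecordV3Par
import Literature.MathematicalPhysics.QuantumFieldTheory.Balaban1983to89.B9Thm39FacesAtLettersRCPar
import Literature.MathematicalPhysics.QuantumFieldTheory.Balaban1983to89.B9Thm311ReadingAtLettersQ
import Literature.MathematicalPhysics.QuantumFieldTheory.Balaban1983to89.Node00.OpsYRecordV11SH

/-!
# BalabanUVNodes ∕ N06 ([B9], `Dag.B9_main`) — CASCADE-K PIECE «KD» (director-ym №383): THE SECT.-D NETWORK OF THE STAGE-11 CERTIFICATE AT THE KNIT LETTERS — Theorems 3.12 ∕ 3.13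
# at the object `opsYSectESt … (opsYS349NuOfLettersH … 𝔏 (parSymY) 𝔈) 𝔏 𝔢 𝔴` DERIVED from the four walk products of the skeleton «KA» (rows 13∕18∕19 at the E-letters), the
# displayed tables and numerics of edition 125 «WA», and the DISPLAYED KNIT LAWS (node00-def-Y ruling (α)); every leg is the landed `_par ∕ _parG ∕ _of_laws ∕ Q` twin of WA's leg

T. Bałaban, *Propagators for lattice gauge theories in a background field*, Commun. Math. Phys. **99** (1985) 389–434 [`Balaban1985BackgroundPropagators`], Thm 3.12 pp. 421–423,
Thm 3.13 pp. 423–426, (3.115) p. 418, (3.122)–(3.153) pp. 420–426, (3.35)–(3.41) pp. 396–397; *Propagators … II*, Commun. Math. Phys. **96** (1984) 223–250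
[`Balaban1984PropagatorsII`], (2.51)–(2.61) pp. 232–234; *Averaging operations …*, Commun. Math. Phys. **98** (1985) 17–51 [`Balaban1985Averaging`], Prop. 2 p. 26.

WHAT THIS FILE IS (kernel bookkeeping over LANDED modules; one theorem, 0 `def`, 0 `sorry`).  ★★★ `t312_t313_opsYSectESt_knit_KD`: for any letter record `𝔏` with the five
displayed pins (`parS = parKnitY`, `parB = parBY`, `G′ = GpY parKnitY`, `G = G[Qknit]`, `C = C(parKnitY, G′)`), the Sect.-D operator record `𝔬12 = ops312YOfRecordPar … 𝔯 … 𝔏 (Qknit)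
(Qknit†) (parKnitY)` (node00-def-Y `pins312Par_of_eq`) and the exps record `𝔈 = expsYOfRecordV3Par …`, GIVEN the four walk products `t37' c38' t310' hsum'` (Thm 3.7 ∕ Cor 3.8 ∕
Thm 3.10 ∕ the RW-sum inequalities at the E-letters of the object — DERIVED in «KA» ✓p779333 from the (3.42)–(3.47) tables), edition 125's network numerics and tables, and the
DISPLAYED knit laws (`hsymDK hsymT hsymRT hUQG1K hidsK hqsK hqsL2K hqL2K hqK hC1TK h46K hD2P` — each the (3.35)-keyed species node00-def-Y ruled, with named knit inhabitants:
def-Y `lettersYOfRecordV11K_symmDG₁GG_of_regQY ∕ RY_GpPhysY_parKnitY_isSymmTr ∕ …_isUnit_QGQOfQY_G₁_SU_of_regQY ∕ …_ids3152_SU_of_regQY`, dag-n06-l `hqK_knit_of_laws ∕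
hqsK_knit_of_laws ∕ hC1T_knit_of_laws ∕ blockBd_DvGcoSDvs_memberY_knit`; the (3.137) letter `hD2P` of Δ⁽²⁾ at the knit pair is WANTED — today's `d2sup_prechain_v2_of_pins` reads
row 26 for `QG̃Q⋆` at the straight pair), the object satisfies `Thm312Printed … ∧ Thm313Printed …` — the two rows «KA» displays as `t312K t313K`.  The body is edition 125's
Sect.-D network (✓p776410, L266–L441) RE-KEYED: the ten Sect.-D identities through `…SectDIdentitiesAtPinsPhysQ.identitiesDef_of_pins_physQ` (W6 recipe) and
`…SectDUnitsAtPinsPhysQ`; the U8 state layer through `…Level13D2Rgdd13LayerAtPinsPUWPar`; the block-L² step through `…StepL2AtPinsPhysRParG`; the legs through their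
`_par ∕ _of_laws` twins (dag-n06-d g24–g26, dag-n06-l g33–g37); rows 20–21 through dag-n06-l's `t312_t313_of_pins_stateSUCLE_par` at `(𝔒, 𝔏, Qknit, Qknit†, parKnitY, Δ⁽²⁾)`
with the seven `𝔒`-pins `rfl`; (3.132) displayed (`s3132K`, as in «KA»).  «KC» = «KA» ∘ «KD» (named-argument composition; the walk products are KA's `obtain`).
HONEST FRAMING.  Kernel bookkeeping; every [B9] estimate is a DISPLAYED hypothesis of printed species or a landed pin fact; COUNT-NEUTRAL; NOT a discharge of N06; K1⁹ NOT
closed; one finite 𝕋⁴ programme at fixed `ε` — NOT continuum ∕ OS ∕ mass gap ∕ Clay.  Seat `pub-ymgap-dag-n06-d` (g26), 2026-08-30.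
-/
noncomputable section
namespace Summit.QuantumFields.YangMills.BalabanUVNodes.N06AtOpsYSectEStKnitSectDKD
open Literature.MathematicalPhysics.QuantumFieldTheory.Balaban1983to89 open T4Continuum (T4Family) open Node00 open B9PinMembersKLevelV1 (MemberY geo9Y bg9Y) open B9PinGeometryKLevelV1 (dOmegaY OmKY inΛY unitDistY c35Y) open B7Prop2SpecialUnitary (specialUnitaryUnits specialUnitaryUnits_le_unitaryUnits) open B9Ineq347GAAtLetters (hGA_opsYOfLetters) open B9Ineq344LocalPairHolds (hGp_opsYOfLetters_holds) open B9Cor35ComparisonsGAAtLetters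
 (hGA_e_opsYOfLetters hGA_h1_opsYOfLetters hGA_e4_opsYOfLetters hGA_h2_opsYOfLetters hGA_l2_opsYOfLetters) open B9CoReadingCoordsHolderAdm (holderProbesKA bond_h1ReadsNbr_of_pinsA) open B9CoReadingCoordsHolderAdmReadings (bond_coReadsHHolderNbr_of_pinsA bond_inputReadsFam_of_pinsA) open B9CoReadingCoordsHolderSNear (holderProbesSN site_h1ReadsNbr_of_pinsSN) open B9CoReadingCoordsHolderSNearReadings (site_inputReadsFam_of_pinsSN) open N06DirKinematicsAtPinsR (h36HA_of_dir_pinsR h36_of_dirSq_pinsR h36A_of_dirSq_pinsR) open N06DirKinematics3AtPinsSNO (h36H_of_dir_pins₃SN_of_transpose) open Node00.OpsYSectDCoords (TpicoK T2coK RcoK) open Node00.OpsYOps312OfRecordPar (S0coKq QcoKHq QscoKHq CcoKq C1coKq) open B9CoReadingCoordsH (blkHK HcoK) open Node00.OpsYQLetter (qKnitOfRecord qsKnitOfRecord regQY) open B9B8AveragingJunction (parKnitY) open B9B8KnitLetterGpDecay (symm0_parKnitY) open B9PinGeometryKLevelV1 (c35Y_eq) open B9C2FormBoxRegimeY (Kpl)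 open B6KLevelCensusIndexV1 (kGeo) open N06WalkLettersAtRecordROPar (laws_parKnitY_of_reg335P identities₂_opsWalkYO_of_reg335R_laws) open B9Thm311ReadingCoords (PosDefTr) open B9LeafXCodedKnitUParH (b9LeafX_carriersYUParH) open Node00 (carriersYUParH Y9OfRecordUPbParH kernelFamilyS kernelFamilyB cqY GAQY GpY parBY CY opsYSectESt deltaAQY siteKernelOfOp) open B9SectBCodedReadingsUParH (SectBStepUPar) open B9SectBKerFrameCodedYR (CinvY) open B9SectBCodedClassGY (C37GY) open Node00 (opsYS349NuOfLettersH parSymY_one) open Node00.OpsYExpsOfRecordV3Par (expsYOfRecordV3Par) open B9Thm39FacesAtLettersRCPar (t39_hksum_oneCube_opsYOfLetters_FRC_par) open B9Thm39OneCubeReadingAtLettersY (oneCubeOps39) open B9Thm39ReadingAtLetters (L39) open B9Ineq349SiteFromConv348 (blk39F) open B9Thm311ReadingAtLettersQ (t311_of_pins_opsYOfLettersRQ inputs311YQ_of_laws) open B9BackgroundsKLevelV1R (kernelFamilyRY hKernelRY siteKernelR) open B9Thm315SectEStarRepAtLettersR (t315_opsYSectESt_sectEStYOfRecordV7_of_3185_onR)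 open Node00.OpsYExpsOfRecordV3 (expsYOfRecordV3) open B9WalkLettersOpsO (opsWalkYO dirOpsWalkYO dirLettersWalkYO rdWalkYO agreeWalkYO staticOK_opsWalkYO) open N06WalkLettersAtRecordRO (localityDir_opsWalkYO_of_agree identities₂_opsWalkYO_of_reg335R) open B9Local342AtOpsWalkYO (local342_opsWalkYO_of_blocks) open B9Thm37CubeCoverCommutators (cutMulY hTY) open Node00 (SiteY SiteOpY deltaPrimeAY) open B9WalkLettersOps (nearDomY) open B9Thm37KLetterDir (FactorsL2Mixed37Dir) open B9H43GpFromPinsSN (h43Gp_of_thm37PrintedSN) open B9HpDGWFromPinsSN (hpDGW_of_thm37PrintedSN_unif) open B9H44GFromPinsSN (h44G_hp45W_of_thm37PrintedSN) open B9H44mFromPinsKA (h44m_h45X_h45Y_of_local3107 thm33G0DirT_of_local3107 inputConst44_pins_nonneg inputConst45_pins_nonneg const37_pins_nonneg) open B9SmoothHolderClassPI (bHZPIfam bHZKPIfam) open B9RWSums347DefiniteFaces (exp261) open B9RWSums344Input (inputConst44 inputConst45) open B9RWSums343Holder (holderConst) open B9Thm37Whole (const37)  open N06CurrentMajAtPinsIdPhys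 (hBJ_of_pins_P) open B9WalkLettersOps (opsWalkY dirOpsWalkY dirLettersWalkY kappaWalkY thetaWalkY KcWalkY rdWalkY) open B9WalkLettersOpsFacts (staticOK_opsWalkY bounded_kappaWalkY) open N06WalkLettersAtRecordR (localityDir_opsWalkY_of_agree identities₂_opsWalkY_of_reg335R)  open N06DgLegAtPinsPhysPU (hκ13_of_pinsP dgDH_dgDHd_of_pinsP_geo9Y) open B9SmoothHolderClassP (bHZPG bHZKP bHZKPG) open N06WELegAtPinsPhysPUB (hκX_of_pinsP hWE_of_pinsP_geo9Y_budget) open N06WGpLegAtPinsPhysPU (hwGp_of_pinsP_geo9Y) open N06RgdH43LegAtPinsPhysPU (hrgdH_of_pinsP43_geo9Y) open B9SmoothHolderClassPProducers (CTel) open B9Ineq349SiteThresholdRateNamed (thrM349 cg349 cg349_pos fineEntryS_le_named) open B9Thm39ReadingAtLetters (basis39 κ39) open B9MultiscaleSmoothPartitionYNear (rNear) open B9Thm313WholeDvHolderAtPinsGraded (thetaL CJG) open B9PlaquetteBinderOfReg335Y (plaqV_binder_of_regYR_budget_SU budget_nonneg) open B9SectDSup (weightNorm) open B9MultiscaleSmoothPartitionYLip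 (CLip) open B9GradViaDivLettersTransported (taxiS taxiB) open B9OpsRTransport (ops312RY) open B9Ineq349SiteFacesAtLettersR (s349_site_of_t37_display348_of_R) open B9Thm314Thm315LayerR (thm314_pair_layerOfLettersR) open B9Eq335ClassBridgePV1 (regY335_of_regYP335 regY336_of_regYP336) open B9BackgroundsKLevelV1P (bg9YP)  open N06MixedFactorAtPinsPhysR (h36H_of_mixedFactorR) open B9RWSums346MixedFactorOfLegsY (factorsL2Mixed37Dir_of_legs MLeg BLeg) open N06SplitMajorantsAtPinsPhysR (split_majorants_of_letter_schemasR) open N06Thm312313AtPinsStateSUCLE (t312_t313_of_pins_stateSUCLE) open B9Thm313WholeLeafCompletePairMBCZcUSXCL (letters313L2Pc_of_fields) open N06Rgd2LegAtPinsPhysPU (hrgd2_of_pinsP_geo9Y) open B9SectBStepUClosedSUOfSections (sectBStepU_C37GY_su_extraYPb_closed) open Node00.OpsYExpsOfRecordV2 (expsYOfRecordV2) open Node00.OpsYOps312OfRecord (ops312YOfRecord) open Node00.OpsYBondMapOfRecord (bIYOfRecord) open N06G0QstarLettersLegAtPinsPU (g0qstar_letters_of_pins)  open B9Thm39FacesAtLettersRC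 (t39_hksum_oneCube_opsYOfLetters_FRC) open B9Thm311Thm315FacesAtLettersR (t311_of_pins_opsYOfLettersR) open B9Thm315SectEStarRepAtLettersR (DecayMidOnStY t315_opsYNuStOfRecordV4PE_sectEStYOfRecordV7_of_3185_onR) open B9BackgroundsKLevelV1R (RegFamY MemOfFam mem_of_reg335R bg9YR regYP335 regYP336 regYP335_one kernelFamilyR hKernelR rwExpansionR fineKernelR) open B9LeafXClassAntitone (ClassIncl residualGpAtOne_R residualGAGlobAtOne_R rwSumsYieldIneqs_R rwKernelSumYields_R thm37Printed_antitone cor38Printed_antitone thm39Printed_antitone thm310Printed_antitone thm311Printed_antitone thm312Printed_antitone thm313Printed_antitone thm314Printed_antitone thm315FullPrinted_antitone stmt349Printed_antitone stmt3132Printed_antitone thm314LocalPrinted_antitone) open B9PinGeometryKLevelV1B (c35B ten_L3_le_c35B ten_L4_le_c35B c35Y_le_ten) open DagBinding (B9LeafX) open N06Ids3152AtPinsPhys (ids3124_ids3152_of_hZ_pins) open Node00.OpsYNablaBridge (cf_mul_etaS_of_hcfk)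
open B9Cor35ComparisonsGpCAtLetters (hGp_e_opsYOfLetters hGp_h1_opsYOfLetters hC_opsYOfLetters) open B9Cor35ComparisonsEH (hE4_of_hGA_e4 hH2_of_hGA_h2) open B9GeoLemma21KLevelV1 (geo9Y_len_pos) open B9Thm39WholeBlk (Conv348Blk) open B9Thm39OneCubeReadingAtLettersY (oneCubeOps39YF) open B9RowSum261DefiniteFaces (rowConst261) open B9Thm312Whole (GeoOK FormSmall cNorm PosDefEnd) open B11SectG (BlockNorm HasMaj) open B9GeoNormsKLevelV1 (geo9K_dist_nonneg geo9K_supNorm_nonneg) open B9GeoLemma21KLevelV1 (geo9Y_dist_triangle geo9Y_dist_comm) open B9GeoNormsKLevelModelSignsV1 (modelSignsOn_geo9K) open B9Thm34Ext (toB6) open B9CoRealizesRelAtLetters (RelB maj342_relB_left maj342_relB_right dist_eq_of_relB len_eq_of_relB relB_refl) open B9SectCDiffDict (maj342) open B6Ineq2142KLevelV1 (β) open B9CarrierBlockMultiplicity (card_sameCarrier_le_kIdx) open B9Thm311ReadingCoords (PosDefTr) open B9PinGeometryKLevelV1 (kLab) open B9Thm314GpFlatTorusGeometry (tdistK OmegaC)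 open B9Thm314WholePinGeometry (locDataY) open B9Thm314WholePair (locData₂) open B9Thm314WholePairWalks (pairWalkSets) open B9Thm314WholeSummation (WalkSetsSpec WalkWeightsSummable) open B9SectCWalkTermsAllNorms (Thm310AllNormsPrinted) open B9Thm314WholeExpansionReads (ExpansionReads) open B9Thm314WholeCancellationLayer (pairOp) open B9Thm37Whole (Ops Sizes StaticOK Local342)
open B9Cor38Whole (WalkReading) open B9C2FormMajTorusLettersAtMemberY (c2FormMaj_c2YOfRecord_of_hβ1) open B7Prop2Explicit (C0 c2') open B7Prop3Flat (c3) open B7Prop5GeneralLevels (C3Gen thetaGen) open B6RandomWalk (HasMajorant) open Node00.OpsYLocalInverse (GsqY) open B9BlockKeyTransferXBK (local342G_of_blocks_idxPins) open B6GlobalChartV1 (blkV1) open B9GeoNbrCountBlocksY (nbrM₀BY nbrCountBY hnbrBY_real_of_le) open B9Local342MonoConst (local342_mono_const local342G_mono_const) open B9SectBAllBlocksGeometryY (geoBY) open Node00.OpsYBlockPinOfRecord (blkOfSK dist_beta_blkSK_sIK_bIYOfRecord_le_one len_blkSK_sIK_bIYOfRecord_eq) open B6Geom246MultiLevelBox (blkOf)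 open B9Eq352DivFormLetters (conj) open B9Eq352GradLetters (diffLetter) open B9Thm310Whole (Ops310 WalkReading310 Sizes310 StaticOK310 Locality310 Local342G) open B9Thm310WholeDir (DirLetters310 Identities310₂) open B9RWSumsDefinitePins (PinPrims) open B9RWSumsDefinitePinsPair (PairPrims) open B9RWSumsDefinitePinsPairM (MixedPrims E310YPairM) open B9RWSumsDefinitePinsPairMDir (E37YPairMDir) open B9RWSumsDefinitePinsPairMDir4Rows (rows131819_definite_geo9Y_pairM_dir₄) open B9Thm37WholeDir (DirLetters37 Identities₂) open B9Cor38WholeDir (LocalityDir) open B9Thm37KLetterDir (HolderV37Dir FactorsInputPair37Dir) open B9RWSums344InputFam (InputReadsFam sliceProbe) open B9RWSums344InputPair (InputLegsPair37 InputLegsPair310 FactorsInputPair310) open B9RWSums346MixedPair (L2MixedLegs310 FactorsL2Mixed310 L2MixedLegs37) open B9CoReadingCoordsTranspose (TrIdx trBasis isTransposePair_GcoK_trBasis isTransposePair_DcoK_GcoK_trBasis isTransposePair_GcoS_trBasis isTransposePair_DcoS_GcoS_trBasis) open B9Thm311SymmAtRecordV4 (symm0_parSymY symmG_parSymY) open B9Thm311AdjointPairs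 (GpY_isSymmTr) open B9RWSums346SecondDiff (familyOp DirOps310 L2SecondLegs310) open B9RWSums346SecondDiffGp (DirOps37 L2SecondLegs37) open B9Thm37Glue (IsTransposePair) open B9RWSumsReadsNbr (H1ReadsNbr) open B9RWSums346Two (L2TwoLegs310 FactorsL2_310) open B9RWSums343Holder (HolderProbes HolderLegs310 FactorsHolder310) open B9RWSums343HolderGp (HolderLegs37) open B9Thm39ReadingCoords (cR39) open B9CoReadingCoords (XBK evBK blkBK GcoK DcoK DscoK LcoK coordOpK cdBₗ cdsBₗ) open B9CoReadingCoordsS (XSK evSK blkSK sIK sIK_faithful off_bound_evSK GcoS DcoS DscoS LcoS) open B9CoReadingCoordsL2S (sIK_dist_le_one site_l2ReadsNbr012_of_pins site_l2ReadsNbr345_of_pins) open B9CoReadingCoordsL2Pair (bond_l2ReadsNbr345_of_pins) open B9Ineq349SiteComposite (cdSL cdsSL) open B9Thm312WholeHHolderNbr (CoReadsHHolderNbr) open B9Thm311ReadingCoords (IsSymmTr) open N06CoReadingsOfPins (bond_coReadings3_of_pins bond_coReadingsLap_of_pins site_coReadings4_of_pins bond_l2ReadsNbr3_of_pins) open B9GeoNbrCountKLevelV1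 (nbrM₀Y nbrCountY hnbr_two_of_le) open B9CoReadingCoordsH (XHK) open B6Ineq2142KLevelV1 (lvl) open B9Thm314WholePinGeometry (locDataY_laws) open B9PinGeometryKLevelV1 (dOmegaY_nonneg) open scoped Matrix.Norms.L2Operator
open N06Proj349AtPinsPhysRC (proj349Maj_of_t37_display348_rateR_ge cP349_nonneg) open B9Eq346GradGpDivAtPinsL2Closed (M46 a46 B46 δ46 M46_pos a46_pos B46_pos blockBd_DvGcoSDvs_memberY_at) open B9PerturbationL2Delta2 (D2coK constL2Pi constL2Pi_nonneg) open B9PerturbationL2Letters (constL2 constL2_nonneg) open N06SectDUnitsAtPinsPhys (isUnit_deltaPiAY_of_formSmall_phys isUnit_deltaOneY_of_formSmall_phys posDefEnd_S0coK_of_posDefTr_phys posDefTr_deltaOneY_of_formSmall_pins_phys identitiesDef_of_pins_phys isUnit_deltaAY_phys_of_posDefTr) open B9Thm313WholeLettersCut (Letters313HZc Letters313L2Pc) open B9Thm313WholeRgdFrom3152 (Ids3152) open B9SectDSup (weightNorm) open B9Thm313WholeLeftZ (Letters313DZ) open B9Thm313WholeDirZ (Letters313DMZ) open B9Thm313WholeHolderZ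 (Letters313HZ) open B9LettersHZAtOne (plateau_pos) open B9Thm312WholeClasses (cNormR) open B9CoReadingCoordsHolder (PK) open B9CoReadingCoordsInput (bHK) open B9CoReadingCoordsInputS (bHS) open N06G0QstarL2LettersLegAtPinsPU (g0qstar_l2_letters_of_pins)  open N06RgdILegAtPinsPhysR (rgdI_of_pinsR) open N06RgdDsLegAtPinsPhysR (rgdDs_rgdDd_of_pinsR) open N06DivLegAtPinsPhysR (hdivDs_of_pinsR) open N06HHLegAtPinsPhysRU (hLHH_of_pinsRU) open N06CutL2LettersAtPinsPhysR (vDRDG_vGDRD_of_pinsR) open N06MixedLegAtPinsPhys (hcntM_of_walkCnt) open N06Row17FromRow19LettersDir (row17_of_row19_letters₂) open B9WalkLettersCoordsS (SblkY hWalkY gsqcoS walkCntM₀Y walkCntY nearBlkCntY cubeDomY) open B6Cover236MultiLevelBlocks (cubes)  open B9Thm39ReadingCoords (coordBound39 basisBound39) open B9Thm31GpMajFromPinsPairMR (thm31GpMaj_of_t37_pairMR) open B9PerturbationMajorantLetters (const3131) open B9RowSum261DefiniteFaces (rowConst261) open B9Thm312WholeIdentitiesSplit (Ids3124 identities_of_def_3124)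 open Node00.OpsYSectDCoords (DvcoKH DvscoKH GcoK_GAY_mul_S0coK cR39_trBasis_pos) open B9Thm311ReadingCoords (isUnit_of_posDefTr) open N06Level13D2Rgdd13LayerAtPinsPUW (level13_d2_rgdd13_layer_of_pinsP_geo9Y) open N06G0CoreFromThm310GUSPC (g0_core_of_thm310_coreDir₃USP) open N06StepL2AtPinsPhysR (blockBd_tpi_of_letter_schemasR) open B9Delta2FormMajorant (C2FormMaj) open B9GradLetterTransportedInputClassesPI (bHZPIfam_κ exists_l1_control_bHZPIfam) open B9MultiscaleSmoothPartitionYNear (rNear) open B9RWSumsDefinitePins (PinPrims.rate_pos) open B9Eq3132FromStateR (s3132Nu_opsYSectE_of_stepS_R_of_refinesY) open B9StateAprioriL1 (exists_l1_control_bHK exists_l1_control_bHS) open B9MultiscaleSmoothPartitionYLip (CLip_nonneg) open B9Thm312WholeClasses (rwt rwt_nonneg)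
open B9LeafXCodedKnitU (b9LeafX_carriersYU) open B9SectBCodedClassR (regC335 regC336 bg9YC extraYPb classIncl_regC335Pb_regYPb335 classIncl_regC336Pb_regYPb336 classIncl_regYPb335_regC335Pb) open Node00 (Y9OfRecordUPb carriersYU CfgY BlkY IBondY deltaAY) open B9Eq360DeltaPrimeAY (AfldY) open B9PinMembersKLevelV1 (mstar_le_M) open B9LettersZSchemasMono (kernel_mono letters313DMZ_mono)
variable {N : ℕ}
section Pointed
variable [NeZero N] [Nonempty (Fin N)] {F : T4Family}
set_option maxHeartbeats 2400000 in set_option synthInstance.maxSize 2048 in set_option maxRecDepth 8192 in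
/-- ★★★ **THE SECT.-D NETWORK «KD» AT THE KNIT LETTERS**: Theorems 3.12 ∕ 3.13 at `opsYSectESt … (opsYS349NuOfLettersH … 𝔏 parSymY 𝔈) 𝔏 𝔢 𝔴` from the four walk
products of «KA», edition 125's displayed tables ∕ numerics and the displayed knit laws (module docstring); conclusion = «KA»'s `t312K ∧ t313K`.
[cite: Balaban1985BackgroundPropagators, Thm 3.12 pp.421–423, Thm 3.13 pp.423–426, (3.122)–(3.153) pp.420–426, (3.35)–(3.36) p.396, (3.115) p.418; Balaban1984PropagatorsII, (2.51)–(2.61) pp.232–234; Balaban1985Averaging, Prop. 2 p.26] -/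
theorem t312_t313_opsYSectESt_knit_KD
    (θ : Stage11Params F N) (Mstar : ℕ) (𝔯 : ResY N θ.toStage3Params Mstar) (𝔏 : LettersY N θ.toStage3Params Mstar)
    -- [CASCADE-K K3∕KD] THE FIVE LETTER PINS (node00-def-Y's knit record `lettersYOfRecordV11K` closes them by `rfl`): `parS = parKnitY` (averaging), `parB = parBY`, `G′ = GpY parKnitY`, `G = G[Qknit]`, `C = (Q′G′²Q′*)⁻¹(parKnitY, G′)`
    (h𝔏P : ∀ x : MemberY θ.d₆ θ.ℓ₆ θ.hd' θ.hL' θ.b₀ θ.b₁ Mstar, (𝔏 x).parS = parKnitY x.toKIdx) (h𝔏B : ∀ x : MemberY θ.d₆ θ.ℓ₆ θ.hd' θ.hL' θ.b₀ θ.b₁ Mstar, (𝔏 x).parB = parBY x.toKIdx) (h𝔏Gp : ∀ x : MemberY θ.d₆ θ.ℓ₆ θ.hd' θ.hL' θ.b₀ θ.b₁ Mstar, (𝔏 x).Gp = GpY x.toKIdx (parKnitY x.toKIdx)) (h𝔏GA : ∀ x : MemberY θ.d₆ θ.ℓ₆ θ.hd' θ.hL' θ.b₀ θ.b₁ Mstar,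 (𝔏 x).GA = GAQY x.toKIdx (qKnitOfRecord N θ.toStage3Params x.toKIdx) (qsKnitOfRecord N θ.toStage3Params x.toKIdx) (parKnitY x.toKIdx) (GpY x.toKIdx (parKnitY x.toKIdx)))
    -- [CASCADE-K «KD»] THE FIVE SECT.-D COMPOSITE LETTER PINS at the knit pair ∕ transporter ∕ residual (node00-def-Y `lettersYOfRecordV11K_sectDE`, `rfl` at the record): `G_D ∕ G₁ ∕ 𝔊 ∕ H ∕ H₁` (3.122)∕(3.128)∕(3.153)∕(3.126)∕(3.129)
    (h𝔏GD : ∀ x : MemberY θ.d₆ θ.ℓ₆ θ.hd' θ.hL' θ.b₀ θ.b₁ Mstar, (𝔏 x).GD = GDQY x.toKIdx (qKnitOfRecord N θ.toStage3Params x.toKIdx) (qsKnitOfRecord N θ.toStage3Params x.toKIdx) (parKnitY x.toKIdx) (GpPhysY x.toKIdx (parKnitY x.toKIdx))) (h𝔏G1 : ∀ x : MemberY θ.d₆ θ.ℓ₆ θ.hd' θ.hL' θ.b₀ θ.b₁ Mstar, (𝔏 x).G₁ = G1QY x.toKIdx (qKnitOfRecord N θ.toStage3Params x.toKIdx) (qsKnitOfRecord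 N θ.toStage3Params x.toKIdx) (parKnitY x.toKIdx) (GpPhysY x.toKIdx (parKnitY x.toKIdx)) ((𝔯 x).Δ2)) (h𝔏GG : ∀ x : MemberY θ.d₆ θ.ℓ₆ θ.hd' θ.hL' θ.b₀ θ.b₁ Mstar, (𝔏 x).GG = GGQY x.toKIdx (qKnitOfRecord N θ.toStage3Params x.toKIdx) (qsKnitOfRecord N θ.toStage3Params x.toKIdx) (parKnitY x.toKIdx) (GpPhysY x.toKIdx (parKnitY x.toKIdx)) ((𝔯 x).Δ2)) (h𝔏H : ∀ x : MemberY θ.d₆ θ.ℓ₆ θ.hd' θ.hL' θ.b₀ θ.b₁ Mstar, (𝔏 x).H = HDQY x.toKIdx (qKnitOfRecord N θ.toStage3Params x.toKIdx) (qsKnitOfRecord N θ.toStage3Params x.toKIdx) (parKnitY x.toKIdx) (GpPhysY x.toKIdx (parKnitY x.toKIdx))) (h𝔏H1 : ∀ x : MemberY θ.d₆ θ.ℓ₆ θ.hd' θ.hL' θ.b₀ θ.b₁ Mstar, (𝔏 x).H₁ = H1QY x.toKIdx (qKnitOfRecord N θ.toStage3Params x.toKIdx) (qsKnitOfRecord N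 θ.toStage3Params x.toKIdx) (parKnitY x.toKIdx) (GpPhysY x.toKIdx (parKnitY x.toKIdx)) ((𝔯 x).Δ2)) (h𝔏QGQ : ∀ x : MemberY θ.d₆ θ.ℓ₆ θ.hd' θ.hL' θ.b₀ θ.b₁ Mstar, (𝔏 x).QGQinv = QGQinvQY x.toKIdx (qKnitOfRecord N θ.toStage3Params x.toKIdx) (qsKnitOfRecord N θ.toStage3Params x.toKIdx) (parKnitY x.toKIdx) (GpPhysY x.toKIdx (parKnitY x.toKIdx))) (h𝔏QG1Q : ∀ x : MemberY θ.d₆ θ.ℓ₆ θ.hd' θ.hL' θ.b₀ θ.b₁ Mstar, (𝔏 x).QG1Qinv = QG1QinvQY x.toKIdx (qKnitOfRecord N θ.toStage3Params x.toKIdx) (qsKnitOfRecord N θ.toStage3Params x.toKIdx) (parKnitY x.toKIdx) (GpPhysY x.toKIdx (parKnitY x.toKIdx)) ((𝔯 x).Δ2)) (𝔢₀ : SectEY N θ.toStage3Params Mstar) (𝔴 : RWEY N θ.toStage3Params Mstar) (𝔈 : ExpsY N θ.toStage3Params Mstar) (𝔈₀ : ExpsY N θ.toStage3Params Mstar) {R₁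 R₂ : RegFamY θ.d₆ θ.ℓ₆ θ.hd' θ.hL' θ.b₀ θ.b₁ Mstar (Matrix (Fin N) (Fin N) ℂ)} (c : ℝ) (hcB : c35B θ.ℓ₆ ≤ c) (hc : 0 < c) (hGR : MemOfFam (specialUnitaryUnits (Fin N)) R₁) (hRP1 : ∀ (x : MemberY θ.d₆ θ.ℓ₆ θ.hd' θ.hL' θ.b₀ θ.b₁ Mstar) (α₀ : ℝ) (U : (bg9YR (Matrix (Fin N) (Fin N) ℂ) (specialUnitaryUnits (Fin N)) R₁ R₂ x).Cfg), (bg9YR (Matrix (Fin N) (Fin N) ℂ) (specialUnitaryUnits (Fin N)) R₁ R₂ x).Reg335 c α₀ U → 0 ≤ α₀ ∧ (bg9YP (Matrix (Fin N) (Fin N) ℂ) (specialUnitaryUnits (Fin N)) x).Reg335 c35Y α₀ U) (hRP2 : ∀ (x : MemberY θ.d₆ θ.ℓ₆ θ.hd' θ.hL' θ.b₀ θ.b₁ Mstar) (α₀ : ℝ) (U : (bg9YR (Matrix (Fin N) (Fin N) ℂ) (specialUnitaryUnits (Fin N)) R₁ R₂ x).Cfg), (bg9YR (Matrix (Fin N)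 (Fin N) ℂ) (specialUnitaryUnits (Fin N)) R₁ R₂ x).Reg336 c α₀ U → 0 ≤ α₀ ∧ (bg9YP (Matrix (Fin N) (Fin N) ℂ) (specialUnitaryUnits (Fin N)) x).Reg336 c35Y α₀ U) [∀ x : MemberY θ.d₆ θ.ℓ₆ θ.hd' θ.hL' θ.b₀ θ.b₁ Mstar, Fintype (geo9Y x).Site] [∀ x : MemberY θ.d₆ θ.ℓ₆ θ.hd' θ.hL' θ.b₀ θ.b₁ Mstar, DecidableEq (geo9Y x).Site] [∀ x : MemberY θ.d₆ θ.ℓ₆ θ.hd' θ.hL' θ.b₀ θ.b₁ Mstar, Fintype (geoBY x).Site] [∀ x : MemberY θ.d₆ θ.ℓ₆ θ.hd' θ.hL' θ.b₀ θ.b₁ Mstar, DecidableRel (RelB x.toKIdx)] (bI : ∀ x : MemberY θ.d₆ θ.ℓ₆ θ.hd' θ.hL' θ.b₀ θ.b₁ Mstar, FBondY x.toKIdx → IBondY x.toKIdx) (hbI : bI = bIYOfRecord θ.toStage3Params Mstar) (α' r39 δ39 B39 a39 M39 : ℝ) (hr39 : 0 < r39) (hrδ39 : r39 ≤ δ39)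 (hB39 : 0 < B39) (ha39 : 0 < a39) (h348 : ∀ x : MemberY θ.d₆ θ.ℓ₆ θ.hd' θ.hL' θ.b₀ θ.b₁ Mstar, M39 ≤ (geo9Y x).M → ∀ α₀ : ℝ, 0 < α₀ → c * (geo9Y x).M * α₀ ≤ a39 → ∀ U : (bg9YR (Matrix (Fin N) (Fin N) ℂ) (specialUnitaryUnits (Fin N)) R₁ R₂ x).Cfg, (bg9YR (Matrix (Fin N) (Fin N) ℂ) (specialUnitaryUnits (Fin N)) R₁ R₂ x).Reg335 c α₀ U → Conv348Blk (oneCubeOps39YF θ.toStage3Params Mstar (𝔏) bI x) B39 δ39 U) {ιA AA : MemberY θ.d₆ θ.ℓ₆ θ.hd' θ.hL' θ.b₀ θ.b₁ Mstar → Type} [∀ x, Fintype (ιA x)] [∀ x, Fintype (AA x)] (p q : PinPrims) (hp : p.OK)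
    (hq : q.OK)
    -- [CASCADE-K K3] THE KNIT-LETTER NUMERICS (x-free): window `α₀K`, plaquette threshold `aK`; they DERIVE the knit legs' unitarity + `Δ′_a(U; parKnitY) > 0` (`laws_parKnitY_of_reg335P`) and `G_a`'s symmetry
    (α₀K aK : ℝ) (hαK : 0 < α₀K) (hαK3 : C0 (θ.d₆ + 1) * α₀K ≤ 1 / 3) (hαK2 : 2 * α₀K ≤ c2' (θ.d₆ + 1) (θ.ℓ₆ + 1)) (hKplK : ∀ (i : B6KLevelCensusIndexV1.KIdx θ.d₆ θ.ℓ₆ θ.hd' θ.hL' θ.b₀ θ.b₁) (a : ℝ), 0 ≤ a → a ≤ aK → Kpl i a * (kGeo i).L ^ 4 < α₀K) (hpaK : p.a₁ / c ≤ aK) (hqaK : q.a₁ / c ≤ aK)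
    -- [CASCADE-K «KD»] the constants of the knit (3.46) line of `D G′(U; parKnitY) D⋆` (dag-n06-l `blockBd_DvGcoSDvs_memberY_knit`: threshold, regime, constant, rate)
    (M46K a46K B46K δ46K : ℝ) (hM46K : 0 < M46K) (ha46K : 0 < a46K) (hB46K : 0 < B46K) (hα3 : 3 * p.α ≤ (1 - p.αF) * (1 - 2 * p.α)) (p3 q3 : PairPrims) (hp3 : p3.OK) (hq3 : q3.OK) (pM qM : MixedPrims) (hpM : pM.OK) (hqM : qM.OK) (H : MemberY θ.d₆ θ.ℓ₆ θ.hd' θ.hL' θ.b₀ θ.b₁ Mstar → Prop) (hM₀ : nbrM₀Y θ.d₆ θ.ℓ₆ θ.hd' θ.hL' θ.b₀ θ.b₁ 2 ≤ Mstar) (𝔭 : ∀ x : MemberY θ.d₆ θ.ℓ₆ θ.hd' θ.hL' θ.b₀ θ.b₁ Mstar, HolderProbes (geo9Y x) (bg9YR (Matrix (Fin N) (Fin N) ℂ) (specialUnitaryUnits (Fin N)) R₁ R₂ x) (XSK (TrIdx N) x.toKIdx) (XSK (TrIdx N) x.toKIdx) (PK (SiteY x.toKIdx) (Fin (θ.d₆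 + 1)) (TrIdx N)) (PK (SiteY x.toKIdx) (Fin (θ.d₆ + 1)) (TrIdx N))) (h𝔭 : ∀ x : MemberY θ.d₆ θ.ℓ₆ θ.hd' θ.hL' θ.b₀ θ.b₁ Mstar, 𝔭 x = holderProbesSN x.toKIdx (trBasis N) (bg9YR (Matrix (Fin N) (Fin N) ℂ) (specialUnitaryUnits (Fin N)) R₁ R₂ x) (fun U => U) (parSymY x.toKIdx) (bI x)) (bHX : ∀ x : MemberY θ.d₆ θ.ℓ₆ θ.hd' θ.hL' θ.b₀ θ.b₁ Mstar, ℝ → BlockNorm (toB6 (geo9Y x) 1 (H x)) ((XSK (TrIdx N) x.toKIdx) → ℝ)) (SH S3 SI : ∀ x : MemberY θ.d₆ θ.ℓ₆ θ.hd' θ.hL' θ.b₀ θ.b₁ Mstar, ↥(cubes x.toKIdx.D.toDomains) → Finset (geo9Y x).Site) (Bc : ℝ) (hBc : 0 ≤ Bc) (hM₀N : nbrM₀BY θ.d₆ θ.ℓ₆ θ.hd' θ.hL' θ.b₀ θ.b₁ 1 ≤ Mstar) (hB₀ge : (nbrCountBY θ.d₆ θ.ℓ₆ θ.hd' θ.hL'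 θ.b₀ θ.b₁ 1 : ℝ) * Real.exp (2 * p.δ₀) * (cR39 (trBasis N) * Bc) ≤ p.B₀)
    -- [rows 18, ed. 115∕123∕125] (3.42) block tables `h36b` at the GENERIC CUBE LETTER `O` (laws `hnear hOagr hOsym hOloc hOlocT`); (3.46) per-cube legs `hMixO hOneO` + sandwiched member `hmixO` displayed
    (O : ∀ x : MemberY θ.d₆ θ.ℓ₆ θ.hd' θ.hL' θ.b₀ θ.b₁ Mstar, ↥(cubes x.toKIdx.D.toDomains) → SiteOpY (Matrix (Fin N) (Fin N) ℂ) x.toKIdx) (near : ∀ x : MemberY θ.d₆ θ.ℓ₆ θ.hd' θ.hL' θ.b₀ θ.b₁ Mstar, ↥(cubes x.toKIdx.D.toDomains) → Finset (SiteY x.toKIdx)) (hOsym : ∀ (x : MemberY θ.d₆ θ.ℓ₆ θ.hd' θ.hL' θ.b₀ θ.b₁ Mstar) (α₀ : ℝ) (U : (bg9YR (Matrix (Fin N) (Fin N) ℂ) (specialUnitaryUnits (Fin N)) R₁ R₂ x).Cfg), (bg9YR (Matrix (Fin N) (Fin N) ℂ) (specialUnitaryUnits (Fin N)) R₁ R₂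 x).Reg335 c α₀ U → ∀ c' : ↥(cubes x.toKIdx.D.toDomains), IsSymmTr (fun _ => (1 : ℝ)) (O x c' U)) (hOloc : ∀ x, p.M₁ ≤ (geo9Y x).M → ∀ α₀ : ℝ, 0 < α₀ → c * (geo9Y x).M * α₀ ≤ p.a₁ → ∀ U : (bg9YR (Matrix (Fin N) (Fin N) ℂ) (specialUnitaryUnits (Fin N)) R₁ R₂ x).Cfg, (bg9YR (Matrix (Fin N) (Fin N) ℂ) (specialUnitaryUnits (Fin N)) R₁ R₂ x).Reg335 c α₀ U → ∀ c' : ↥(cubes x.toKIdx.D.toDomains), cutMulY (hTY x.toKIdx c') * deltaPrimeAY x.toKIdx (parKnitY x.toKIdx) U * O x c' U * cutMulY (hTY x.toKIdx c') = cutMulY (hTY x.toKIdx c') * cutMulY (hTY x.toKIdx c')) (hOlocT : ∀ x, p.M₁ ≤ (geo9Y x).M → ∀ α₀ : ℝ, 0 < α₀ → c * (geo9Y x).M * α₀ ≤ p.a₁ → ∀ U : (bg9YR (Matrix (Fin N) (Fin N) ℂ) (specialUnitaryUnits (Fin N)) R₁ R₂ x).Cfg, (bg9YR (Matrix (Fin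 N) (Fin N) ℂ) (specialUnitaryUnits (Fin N)) R₁ R₂ x).Reg335 c α₀ U → ∀ c' : ↥(cubes x.toKIdx.D.toDomains), cutMulY (hTY x.toKIdx c') * O x c' U * deltaPrimeAY x.toKIdx (parKnitY x.toKIdx) U * cutMulY (hTY x.toKIdx c') = cutMulY (hTY x.toKIdx c') * cutMulY (hTY x.toKIdx c')) (δM : ℝ) (hδM : 0 < δM) (hM1L : MLeg θ.d₆ θ.ℓ₆ θ.hd' θ.hL' θ.b₀ θ.b₁ Mstar hδM ≤ p.M₁) (hδ1L : p.δ₀ ≤ δM / 2) (hθ1L : p.θ₀ * Real.exp ((3 / 4 + p.δ₀) * p.ρ) * (BLeg θ.d₆ θ.ℓ₆ θ.hd' θ.hL' θ.b₀ θ.b₁ Mstar hδM * pM.BM) ≤ pM.θM) (hMixO : ∀ x, p.M₁ ≤ (geo9Y x).M → ∀ α₀ : ℝ, 0 < α₀ → c * (geo9Y x).M * α₀ ≤ p.a₁ → ∀ U : (bg9YR (Matrix (Fin N) (Fin N) ℂ) (specialUnitaryUnits (Fin N)) R₁ R₂ x).Cfg, (bg9YR (Matrix (Fin N) (Fin N)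 ℂ) (specialUnitaryUnits (Fin N)) R₁ R₂ x).Reg335 c α₀ U → ∀ (q' : ↥(cubes x.toKIdx.D.toDomains)) (ν μ : Fin (θ.d₆ + 1)), B9SectDL2Decay.BlockBd (g := toB6 (geo9Y x) 1 (H x)) (opsWalkYO x (trBasis N) (bg9YR (Matrix (Fin N) (Fin N) ℂ) (specialUnitaryUnits (Fin N)) R₁ R₂ x) (fun U => U) (parKnitY x.toKIdx) (bI x) (O x)).blk (opsWalkYO x (trBasis N) (bg9YR (Matrix (Fin N) (Fin N) ℂ) (specialUnitaryUnits (Fin N)) R₁ R₂ x) (fun U => U) (parKnitY x.toKIdx) (bI x) (O x)).blk ((dirOpsWalkYO x (trBasis N) (bg9YR (Matrix (Fin N) (Fin N) ℂ) (specialUnitaryUnits (Fin N)) R₁ R₂ x) (fun U => U) (parKnitY x.toKIdx) (bI x) (O x)).Dd U ν ∘ₗ (((opsWalkYO x (trBasis N) (bg9YR (Matrix (Fin N) (Fin N) ℂ) (specialUnitaryUnits (Fin N)) R₁ R₂ x) (fun U => U) (parKnitY x.toKIdx) (bI x) (O x)).Gsq U q' * B9Thm37Sum.mulOp ((opsWalkYO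 x (trBasis N) (bg9YR (Matrix (Fin N) (Fin N) ℂ) (specialUnitaryUnits (Fin N)) R₁ R₂ x) (fun U => U) (parKnitY x.toKIdx) (bI x) (O x)).h q')) ∘ₗ (dirOpsWalkYO x (trBasis N) (bg9YR (Matrix (Fin N) (Fin N) ℂ) (specialUnitaryUnits (Fin N)) R₁ R₂ x) (fun U => U) (parKnitY x.toKIdx) (bI x) (O x)).Dsd U μ)) (fun (y y' : (geo9Y x).Site) => pM.BM * Real.exp (-(δM * (geo9Y x).dist y y'))))
    (hOneO : ∀ x, p.M₁ ≤ (geo9Y x).M → ∀ α₀ : ℝ, 0 < α₀ → c * (geo9Y x).M * α₀ ≤ p.a₁ → ∀ U : (bg9YR (Matrix (Fin N) (Fin N) ℂ) (specialUnitaryUnits (Fin N)) R₁ R₂ x).Cfg, (bg9YR (Matrix (Fin N) (Fin N) ℂ) (specialUnitaryUnits (Fin N)) R₁ R₂ x).Reg335 c α₀ U → ∀ (q' : ↥(cubes x.toKIdx.D.toDomains)) (μ : Fin (θ.d₆ + 1)), B9SectDL2Decay.BlockBd (g := toB6 (geo9Y x) 1 (H x)) (opsWalkYO x (trBasis N) (bg9YR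 (Matrix (Fin N) (Fin N) ℂ) (specialUnitaryUnits (Fin N)) R₁ R₂ x) (fun U => U) (parKnitY x.toKIdx) (bI x) (O x)).blk (opsWalkYO x (trBasis N) (bg9YR (Matrix (Fin N) (Fin N) ℂ) (specialUnitaryUnits (Fin N)) R₁ R₂ x) (fun U => U) (parKnitY x.toKIdx) (bI x) (O x)).blk (((opsWalkYO x (trBasis N) (bg9YR (Matrix (Fin N) (Fin N) ℂ) (specialUnitaryUnits (Fin N)) R₁ R₂ x) (fun U => U) (parKnitY x.toKIdx) (bI x) (O x)).Gsq U q' * B9Thm37Sum.mulOp ((opsWalkYO x (trBasis N) (bg9YR (Matrix (Fin N) (Fin N) ℂ) (specialUnitaryUnits (Fin N)) R₁ R₂ x) (fun U => U) (parKnitY x.toKIdx) (bI x) (O x)).h q')) ∘ₗ (dirOpsWalkYO x (trBasis N) (bg9YR (Matrix (Fin N) (Fin N) ℂ) (specialUnitaryUnits (Fin N)) R₁ R₂ x) (fun U => U) (parKnitY x.toKIdx) (bI x) (O x)).Dsd U μ) (fun (y y' : (geo9Y x).Site) => pM.BM * (geo9Y x).len y ^ (1 : ℝ) * Real.exp (-(δM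 * (geo9Y x).dist y y')))) (hmixO : ∀ x, p.M₁ ≤ (geo9Y x).M → ∀ α₀ : ℝ, 0 < α₀ → c * (geo9Y x).M * α₀ ≤ p.a₁ → ∀ U : (bg9YR (Matrix (Fin N) (Fin N) ℂ) (specialUnitaryUnits (Fin N)) R₁ R₂ x).Cfg, (bg9YR (Matrix (Fin N) (Fin N) ℂ) (specialUnitaryUnits (Fin N)) R₁ R₂ x).Reg335 c α₀ U → L2MixedLegs37 (opsWalkYO x (trBasis N) (bg9YR (Matrix (Fin N) (Fin N) ℂ) (specialUnitaryUnits (Fin N)) R₁ R₂ x) (fun U => U) (parKnitY x.toKIdx) (bI x) (O x)) (dirOpsWalkYO x (trBasis N) (bg9YR (Matrix (Fin N) (Fin N) ℂ) (specialUnitaryUnits (Fin N)) R₁ R₂ x) (fun U => U) (parKnitY x.toKIdx) (bI x) (O x)) 1 (H x) (SblkY x (bI x)) pM.BM p.δ₀ U) (h36b : ∀ x, p.M₁ ≤ (geo9Y x).M → ∀ α₀ : ℝ, 0 < α₀ → c * (geo9Y x).M * α₀ ≤ p.a₁ → ∀ U : (bg9YR (Matrix (Fin N) (Fin N) ℂ)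 (specialUnitaryUnits (Fin N)) R₁ R₂ x).Cfg, (bg9YR (Matrix (Fin N) (Fin N) ℂ) (specialUnitaryUnits (Fin N)) R₁ R₂ x).Reg335 c α₀ U → (∀ c', HasMajorant (g := toB6 (geoBY x) 1 (H x)) (fun p' : SiteY x.toKIdx × TrIdx N => blkOf x.toKIdx.D.toDomains p'.1) (conj (trBasis N) ((etaS x.toKIdx ^ 2) • (O x c' U).restrictScalars ℝ)) (fun s s' => Bc * (geoBY x).len s ^ 2 * Real.exp (-(p.δ₀ * (geoBY x).dist s s')))) ∧ (∀ c' (μ : Fin (θ.d₆ + 1)), HasMajorant (g := toB6 (geoBY x) 1 (H x)) (fun p' : SiteY x.toKIdx × TrIdx N => blkOf x.toKIdx.D.toDomains p'.1) (conj (trBasis N) (diffLetter (shiftY x.toKIdx) (UboxY x.toKIdx U) (((etaS x.toKIdx : ℂ))⁻¹) (Sum.inl μ)) * conj (trBasis N) ((etaS x.toKIdx ^ 2) • (O x c' U).restrictScalars ℝ)) (fun s s' => Bc * (geoBY x).len s * Real.exp (-(p.δ₀ * (geoBY x).dist s s')))) ∧ (∀ c' (μ : Fin (θ.d₆ + 1)),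 HasMajorant (g := toB6 (geoBY x) 1 (H x)) (fun p' : SiteY x.toKIdx × TrIdx N => blkOf x.toKIdx.D.toDomains p'.1) (conj (trBasis N) ((etaS x.toKIdx ^ 2) • (O x c' U).restrictScalars ℝ) * conj (trBasis N) (diffLetter (shiftY x.toKIdx) (UboxY x.toKIdx U) (((etaS x.toKIdx : ℂ))⁻¹) (Sum.inr μ))) (fun s s' => Bc * (geoBY x).len s * Real.exp (-(p.δ₀ * (geoBY x).dist s s')))) ∧ (∀ c', HasMajorant (g := toB6 (geoBY x) 1 (H x)) (fun p' : SiteY x.toKIdx × TrIdx N => blkOf x.toKIdx.D.toDomains p'.1) (conj (trBasis N) (((etaS x.toKIdx ^ 2)⁻¹) • (lapSL x.toKIdx U).restrictScalars ℝ) * conj (trBasis N) ((etaS x.toKIdx ^ 2) • (O x c' U).restrictScalars ℝ)) (fun s s' => Bc * 1 * Real.exp (-(p.δ₀ * (geoBY x).dist s s')))))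
    (h36H : ∀ x, p.M₁ ≤ (geo9Y x).M → ∀ α₀ : ℝ, 0 < α₀ → c * (geo9Y x).M * α₀ ≤ p.a₁ → ∀ U : (bg9YR (Matrix (Fin N) (Fin N) ℂ) (specialUnitaryUnits (Fin N)) R₁ R₂ x).Cfg, (bg9YR (Matrix (Fin N) (Fin N) ℂ) (specialUnitaryUnits (Fin N)) R₁ R₂ x).Reg335 c α₀ U → HolderLegs37 (opsWalkYO x (trBasis N) (bg9YR (Matrix (Fin N) (Fin N) ℂ) (specialUnitaryUnits (Fin N)) R₁ R₂ x) (fun U => U) (parKnitY x.toKIdx) (bI x) (O x)) (𝔭 x) 1 (H x) (SH x) p.Bl p.δ₀ U ∧ HolderV37Dir (opsWalkYO x (trBasis N) (bg9YR (Matrix (Fin N) (Fin N) ℂ) (specialUnitaryUnits (Fin N)) R₁ R₂ x) (fun U => U) (parKnitY x.toKIdx) (bI x) (O x)) (dirOpsWalkYO x (trBasis N) (bg9YR (Matrix (Fin N) (Fin N) ℂ) (specialUnitaryUnits (Fin N)) R₁ R₂ x) (fun U => U) (parKnitY x.toKIdx) (bI x) (O x)) (dirLettersWalkYO x (trBasis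 N) (bg9YR (Matrix (Fin N) (Fin N) ℂ) (specialUnitaryUnits (Fin N)) R₁ R₂ x) (fun U => U) (parKnitY x.toKIdx) (bI x) (O x)) (𝔭 x) 1 (H x) p.Bt p.δ₀ U ∧ (L2SecondLegs37 (opsWalkYO x (trBasis N) (bg9YR (Matrix (Fin N) (Fin N) ℂ) (specialUnitaryUnits (Fin N)) R₁ R₂ x) (fun U => U) (parKnitY x.toKIdx) (bI x) (O x)) (dirOpsWalkYO x (trBasis N) (bg9YR (Matrix (Fin N) (Fin N) ℂ) (specialUnitaryUnits (Fin N)) R₁ R₂ x) (fun U => U) (parKnitY x.toKIdx) (bI x) (O x)) 1 (H x) (S3 x) p3.B3 p.δ₀ U ∧ (∀ q' μ, IsTransposePair ((dirLettersWalkYO x (trBasis N) (bg9YR (Matrix (Fin N) (Fin N) ℂ) (specialUnitaryUnits (Fin N)) R₁ R₂ x) (fun U => U) (parKnitY x.toKIdx) (bI x) (O x)).Pt U q' μ) ((dirLettersWalkYO x (trBasis N) (bg9YR (Matrix (Fin N) (Fin N) ℂ) (specialUnitaryUnits (Fin N)) R₁ R₂ x) (fun U => U) (parKnitY x.toKIdx)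 (bI x) (O x)).P U q' μ)) ∧ (∀ q', IsTransposePair ((opsWalkYO x (trBasis N) (bg9YR (Matrix (Fin N) (Fin N) ℂ) (specialUnitaryUnits (Fin N)) R₁ R₂ x) (fun U => U) (parKnitY x.toKIdx) (bI x) (O x)).Ct U q') ((opsWalkYO x (trBasis N) (bg9YR (Matrix (Fin N) (Fin N) ℂ) (specialUnitaryUnits (Fin N)) R₁ R₂ x) (fun U => U) (parKnitY x.toKIdx) (bI x) (O x)).Cop U q'))) ∧ (InputLegsPair37 (opsWalkYO x (trBasis N) (bg9YR (Matrix (Fin N) (Fin N) ℂ) (specialUnitaryUnits (Fin N)) R₁ R₂ x) (fun U => U) (parKnitY x.toKIdx) (bI x) (O x)) (dirOpsWalkYO x (trBasis N) (bg9YR (Matrix (Fin N) (Fin N) ℂ) (specialUnitaryUnits (Fin N)) R₁ R₂ x) (fun U => U) (parKnitY x.toKIdx) (bI x) (O x)) (𝔭 x) 1 (H x) (bHX x) (SI x) p.BI p.BI2 p.δ₀ U ∧ FactorsInputPair37Dir (opsWalkYO x (trBasis N) (bg9YR (Matrix (Fin N) (Fin N) ℂ) (specialUnitaryUnits (Fin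 N)) R₁ R₂ x) (fun U => U) (parKnitY x.toKIdx) (bI x) (O x)) (dirOpsWalkYO x (trBasis N) (bg9YR (Matrix (Fin N) (Fin N) ℂ) (specialUnitaryUnits (Fin N)) R₁ R₂ x) (fun U => U) (parKnitY x.toKIdx) (bI x) (O x)) (dirLettersWalkYO x (trBasis N) (bg9YR (Matrix (Fin N) (Fin N) ℂ) (specialUnitaryUnits (Fin N)) R₁ R₂ x) (fun U => U) (parKnitY x.toKIdx) (bI x) (O x)) 1 (H x) (bHX x) p.θI p.δ₀ U)) (bHXT : ∀ x : MemberY θ.d₆ θ.ℓ₆ θ.hd' θ.hL' θ.b₀ θ.b₁ Mstar, (bg9YR (Matrix (Fin N) (Fin N) ℂ) (specialUnitaryUnits (Fin N)) R₁ R₂ x).Cfg → ℝ → BlockNorm (toB6 (geo9Y x) 1 (H x)) ((XSK (TrIdx N) x.toKIdx) → ℝ)) (hbHXT : ∀ (x : MemberY θ.d₆ θ.ℓ₆ θ.hd' θ.hL' θ.b₀ θ.b₁ Mstar) (U : (bg9YR (Matrix (Fin N) (Fin N) ℂ) (specialUnitaryUnits (Fin N)) R₁ R₂ x).Cfg), bHXT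 x U = fun ε => letI : Fintype (B9GeoNormsKLevelV1.geo9K x.toKIdx).Site := (inferInstance : Fintype (geo9Y x).Site); bHZPIfam (κ := TrIdx N) x.toKIdx (trBasis N) (taxiS x.toKIdx (bg9YR (Matrix (Fin N) (Fin N) ℂ) (specialUnitaryUnits (Fin N)) R₁ R₂ x) (fun U => U) U) (R := (1 : ℝ)) (H := H x) ε)
    (hopI : ∀ x, p.M₁ ≤ (geo9Y x).M → ∀ α₀ : ℝ, 0 < α₀ → c * (geo9Y x).M * α₀ ≤ p.a₁ → ∀ U : (bg9YR (Matrix (Fin N) (Fin N) ℂ) (specialUnitaryUnits (Fin N)) R₁ R₂ x).Cfg, (bg9YR (Matrix (Fin N) (Fin N) ℂ) (specialUnitaryUnits (Fin N)) R₁ R₂ x).Reg335 c α₀ U → InputLegsPair37 (opsWalkYO x (trBasis N) (bg9YR (Matrix (Fin N) (Fin N) ℂ) (specialUnitaryUnits (Fin N)) R₁ R₂ x) (fun U => U) (parKnitY x.toKIdx) (bI x) (O x)) (dirOpsWalkYO x (trBasis N) (bg9YR (Matrix (Fin N) (Fin N) ℂ) (specialUnitaryUnits (Fin N)) R₁ R₂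 x) (fun U => U) (parKnitY x.toKIdx) (bI x) (O x)) (𝔭 x) 1 (H x) (bHXT x U) (SI x) p.BI p.BI2 p.δ₀ U ∧ FactorsInputPair37Dir (opsWalkYO x (trBasis N) (bg9YR (Matrix (Fin N) (Fin N) ℂ) (specialUnitaryUnits (Fin N)) R₁ R₂ x) (fun U => U) (parKnitY x.toKIdx) (bI x) (O x)) (dirOpsWalkYO x (trBasis N) (bg9YR (Matrix (Fin N) (Fin N) ℂ) (specialUnitaryUnits (Fin N)) R₁ R₂ x) (fun U => U) (parKnitY x.toKIdx) (bI x) (O x)) (dirLettersWalkYO x (trBasis N) (bg9YR (Matrix (Fin N) (Fin N) ℂ) (specialUnitaryUnits (Fin N)) R₁ R₂ x) (fun U => U) (parKnitY x.toKIdx) (bI x) (O x)) 1 (H x) (bHXT x U) p.θI p.δ₀ U) (hcntH : ∀ x (a : (geo9Y x).Site), (∑ c, if a ∈ SH x c then (1 : ℝ) else 0) ≤ p.NH) (hcnt3 : ∀ x (a : (geo9Y x).Site), (∑ c, if a ∈ S3 x c then (1 : ℝ) else 0) ≤ p3.N3) (hcntI : ∀ x (a : (geo9Y x).Site), (∑ c,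 if a ∈ SI x c then (1 : ℝ) else 0) ≤ p.NI) (hMw : ∀ x : MemberY θ.d₆ θ.ℓ₆ θ.hd' θ.hL' θ.b₀ θ.b₁ Mstar, walkCntM₀Y θ.d₆ θ.ℓ₆ θ.hd' θ.hL' θ.b₀ θ.b₁ Mstar ≤ (geo9Y x).M) (hM3 : nbrM₀Y θ.d₆ θ.ℓ₆ θ.hd' θ.hL' θ.b₀ θ.b₁ 3 ≤ Mstar) (hρ3 : 3 ≤ p.ρ) (hNc : walkCntY θ.d₆ θ.ℓ₆ θ.hd' θ.hL' θ.b₀ θ.b₁ Mstar ≤ p.Nc) (hN' : walkCntY θ.d₆ θ.ℓ₆ θ.hd' θ.hL' θ.b₀ θ.b₁ Mstar ≤ p.N') (hCℓ : (((θ.ℓ₆ + 1 : ℕ) : ℝ)) ^ 2 ≤ p.Cℓ) (hKc : KcWalkY θ.d₆ θ.ℓ₆ θ.hd' θ.hL' θ.b₀ θ.b₁ (trBasis N) ≤ p.Kc) (hθ₀ : thetaWalkY θ.d₆ θ.ℓ₆ θ.hd' θ.hL' θ.b₀ θ.b₁ (trBasis N) p.Cℓ ≤ p.θ₀) (𝔬A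 : ∀ x : MemberY θ.d₆ θ.ℓ₆ θ.hd' θ.hL' θ.b₀ θ.b₁ Mstar, Ops310 (geo9Y x) (bg9YR (Matrix (Fin N) (Fin N) ℂ) (specialUnitaryUnits (Fin N)) R₁ R₂ x) (XBK (TrIdx N) x.toKIdx) (XBK (TrIdx N) x.toKIdx) (ιA x) (AA x)) (rdA : ∀ x : MemberY θ.d₆ θ.ℓ₆ θ.hd' θ.hL' θ.b₀ θ.b₁ Mstar, WalkReading310 (geo9Y x) (bg9YR (Matrix (Fin N) (Fin N) ℂ) (specialUnitaryUnits (Fin N)) R₁ R₂ x) (XBK (TrIdx N) x.toKIdx) (ιA x) (AA x)) (𝔭A : ∀ x : MemberY θ.d₆ θ.ℓ₆ θ.hd' θ.hL' θ.b₀ θ.b₁ Mstar, HolderProbes (geo9Y x) (bg9YR (Matrix (Fin N) (Fin N) ℂ) (specialUnitaryUnits (Fin N)) R₁ R₂ x) (XBK (TrIdx N) x.toKIdx) (XBK (TrIdx N) x.toKIdx) (PK (FBondY x.toKIdx) (Fin (θ.d₆ + 1)) (TrIdx N)) (PK (FBondY x.toKIdx) (Fin (θ.d₆ + 1)) (TrIdx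 N))) (h𝔭A : ∀ x : MemberY θ.d₆ θ.ℓ₆ θ.hd' θ.hL' θ.b₀ θ.b₁ Mstar, 𝔭A x = holderProbesKA x.toKIdx (trBasis N) (bg9YR (Matrix (Fin N) (Fin N) ℂ) (specialUnitaryUnits (Fin N)) R₁ R₂ x) (fun U => U) (𝔏 x).parB (bI x)) (𝔡A : ∀ x : MemberY θ.d₆ θ.ℓ₆ θ.hd' θ.hL' θ.b₀ θ.b₁ Mstar, DirOps310 (𝔬A x) (Fin (θ.d₆ + 1))) (𝔩A : ∀ x : MemberY θ.d₆ θ.ℓ₆ θ.hd' θ.hL' θ.b₀ θ.b₁ Mstar, DirLetters310 (𝔬A x) (Fin (θ.d₆ + 1))) (bHXA : ∀ x : MemberY θ.d₆ θ.ℓ₆ θ.hd' θ.hL' θ.b₀ θ.b₁ Mstar, ℝ → BlockNorm (toB6 (geo9Y x) 1 (H x)) ((XBK (TrIdx N) x.toKIdx) → ℝ)) (κA : MemberY θ.d₆ θ.ℓ₆ θ.hd' θ.hL' θ.b₀ θ.b₁ Mstar → Sizes310) (SHA S3A SIA SMA S2A : ∀ x : MemberY θ.d₆ θ.ℓ₆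 θ.hd' θ.hL' θ.b₀ θ.b₁ Mstar, ιA x → Finset (geo9Y x).Site) (hbHXA : ∀ x : MemberY θ.d₆ θ.ℓ₆ θ.hd' θ.hL' θ.b₀ θ.b₁ Mstar, bHXA x = fun ε => letI : Fintype (B9GeoNormsKLevelV1.geo9K x.toKIdx).Site := (inferInstance : Fintype (geo9Y x).Site); bHK x.toKIdx (bI x) ε) (hstA : ∀ x, StaticOK310 (𝔬A x) q.ρ q.Nc q.N' q.NF q.Cℓ (κA x)) (hκA : ∀ x, (κA x).Bounded q.Kc)
    (h36A' : ∀ x, q.M₁ ≤ (geo9Y x).M → ∀ α₀ : ℝ, 0 < α₀ → c * (geo9Y x).M * α₀ ≤ q.a₁ → ∀ U : (bg9YR (Matrix (Fin N) (Fin N) ℂ) (specialUnitaryUnits (Fin N)) R₁ R₂ x).Cfg, (bg9YR (Matrix (Fin N) (Fin N) ℂ) (specialUnitaryUnits (Fin N)) R₁ R₂ x).Reg335 c α₀ U → B9Thm310Whole.Factors389 (𝔬A x) 1 (H x) q.θ₀ q.δ₀ U ∧ Identities310₂ (𝔬A x) (𝔡A x) (𝔩A x) 1 (H x) U) (h36HA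 : ∀ x, q.M₁ ≤ (geo9Y x).M → ∀ α₀ : ℝ, 0 < α₀ → c * (geo9Y x).M * α₀ ≤ q.a₁ → ∀ U : (bg9YR (Matrix (Fin N) (Fin N) ℂ) (specialUnitaryUnits (Fin N)) R₁ R₂ x).Cfg, (bg9YR (Matrix (Fin N) (Fin N) ℂ) (specialUnitaryUnits (Fin N)) R₁ R₂ x).Reg335 c α₀ U → HolderLegs310 (𝔬A x) (𝔭A x) 1 (H x) (SHA x) q.Bl q.δ₀ U ∧ FactorsHolder310 (𝔬A x) (𝔭A x) 1 (H x) q.Bt q.δ₀ U ∧ (L2SecondLegs310 (𝔬A x) (𝔡A x) 1 (H x) (S3A x) q3.B3 q.δ₀ U ∧ ∀ a, IsTransposePair ((𝔬A x).Rt U a) ((𝔬A x).Rf U a)) ∧ (InputLegsPair310 (𝔬A x) (𝔡A x) (𝔭A x) 1 (H x) (bHXA x) (SIA x) q.BI q.BI2 q.δ₀ U ∧ FactorsInputPair310 (𝔬A x) (𝔡A x) 1 (H x) (bHXA x) q.θI q.δ₀ U) ∧ (L2MixedLegs310 (𝔬A x) (𝔡A x) 1 (H x) (SMA x) qM.BM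 q.δ₀ U ∧ FactorsL2Mixed310 (𝔬A x) (𝔡A x) 1 (H x) qM.θM q.δ₀ U)) (bHXTA : ∀ x : MemberY θ.d₆ θ.ℓ₆ θ.hd' θ.hL' θ.b₀ θ.b₁ Mstar, (bg9YR (Matrix (Fin N) (Fin N) ℂ) (specialUnitaryUnits (Fin N)) R₁ R₂ x).Cfg → ℝ → BlockNorm (toB6 (geo9Y x) 1 (H x)) ((XBK (TrIdx N) x.toKIdx) → ℝ)) (hbHXTA : ∀ (x : MemberY θ.d₆ θ.ℓ₆ θ.hd' θ.hL' θ.b₀ θ.b₁ Mstar) (U : (bg9YR (Matrix (Fin N) (Fin N) ℂ) (specialUnitaryUnits (Fin N)) R₁ R₂ x).Cfg), bHXTA x U = fun ε => letI : Fintype (B9GeoNormsKLevelV1.geo9K x.toKIdx).Site := (inferInstance : Fintype (geo9Y x).Site); bHZKPIfam (κ := TrIdx N) x.toKIdx (trBasis N) (taxiB x.toKIdx (bg9YR (Matrix (Fin N) (Fin N) ℂ) (specialUnitaryUnits (Fin N)) R₁ R₂ x) (fun U => U) U) (R := (1 : ℝ)) (H := H x) ε) (hopIA : ∀ x, q.M₁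 ≤ (geo9Y x).M → ∀ α₀ : ℝ, 0 < α₀ → c * (geo9Y x).M * α₀ ≤ q.a₁ → ∀ U : (bg9YR (Matrix (Fin N) (Fin N) ℂ) (specialUnitaryUnits (Fin N)) R₁ R₂ x).Cfg, (bg9YR (Matrix (Fin N) (Fin N) ℂ) (specialUnitaryUnits (Fin N)) R₁ R₂ x).Reg335 c α₀ U → InputLegsPair310 (𝔬A x) (𝔡A x) (𝔭A x) 1 (H x) (bHXTA x U) (SIA x) q.BI q.BI2 q.δ₀ U ∧ FactorsInputPair310 (𝔬A x) (𝔡A x) 1 (H x) (bHXTA x U) q.θI q.δ₀ U) (h36A2 : ∀ x, q.M₁ ≤ (geo9Y x).M → ∀ α₀ : ℝ, 0 < α₀ → c * (geo9Y x).M * α₀ ≤ q.a₁ → ∀ U : (bg9YR (Matrix (Fin N) (Fin N) ℂ) (specialUnitaryUnits (Fin N)) R₁ R₂ x).Cfg, (bg9YR (Matrix (Fin N) (Fin N) ℂ) (specialUnitaryUnits (Fin N)) R₁ R₂ x).Reg335 c α₀ U → L2TwoLegs310 (𝔬A x) 1 (H x) (S2A x) q.B2 q.δ₀ U ∧ FactorsL2_310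 (𝔬A x) 1 (H x) q.θ2 q.δ₀ U) (hcntHA : ∀ x (a : (geo9Y x).Site), (∑ c, if a ∈ SHA x c then (1 : ℝ) else 0) ≤ q.NH) (hcnt3A : ∀ x (a : (geo9Y x).Site), (∑ c, if a ∈ S3A x c then (1 : ℝ) else 0) ≤ q3.N3) (hcntIA : ∀ x (a : (geo9Y x).Site), (∑ c, if a ∈ SIA x c then (1 : ℝ) else 0) ≤ q.NI) (hcntMA : ∀ x (a : (geo9Y x).Site), (∑ c, if a ∈ SMA x c then (1 : ℝ) else 0) ≤ qM.NM) (hcnt2A : ∀ x (a : (geo9Y x).Site), (∑ c, if a ∈ S2A x c then (1 : ℝ) else 0) ≤ q.N2) (hblkA : ∀ x : MemberY θ.d₆ θ.ℓ₆ θ.hd' θ.hL' θ.b₀ θ.b₁ Mstar, (𝔬A x).blk = blkBK x.toKIdx (bI x)) (hblkYA : ∀ x : MemberY θ.d₆ θ.ℓ₆ θ.hd' θ.hL' θ.b₀ θ.b₁ Mstar, (𝔬A x).blkY = blkBK x.toKIdx (bI x)) (hGcoA : ∀ (x : MemberY θ.d₆ θ.ℓ₆ θ.hd' θ.hL' θ.b₀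 θ.b₁ Mstar) (U : (bg9YR (Matrix (Fin N) (Fin N) ℂ) (specialUnitaryUnits (Fin N)) R₁ R₂ x).Cfg), (𝔬A x).G U = GcoK x.toKIdx (trBasis N) (bg9YR (Matrix (Fin N) (Fin N) ℂ) (specialUnitaryUnits (Fin N)) R₁ R₂ x) (fun U => U) (𝔏 x).GA U) (hDcoA : ∀ (x : MemberY θ.d₆ θ.ℓ₆ θ.hd' θ.hL' θ.b₀ θ.b₁ Mstar) (U : (bg9YR (Matrix (Fin N) (Fin N) ℂ) (specialUnitaryUnits (Fin N)) R₁ R₂ x).Cfg), (𝔬A x).D U = DcoK x.toKIdx (trBasis N) (bg9YR (Matrix (Fin N) (Fin N) ℂ) (specialUnitaryUnits (Fin N)) R₁ R₂ x) (fun U => U) U)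
    (hDscoA : ∀ (x : MemberY θ.d₆ θ.ℓ₆ θ.hd' θ.hL' θ.b₀ θ.b₁ Mstar) (U : (bg9YR (Matrix (Fin N) (Fin N) ℂ) (specialUnitaryUnits (Fin N)) R₁ R₂ x).Cfg), (𝔬A x).Dstar U = DscoK x.toKIdx (trBasis N) (bg9YR (Matrix (Fin N) (Fin N) ℂ) (specialUnitaryUnits (Fin N)) R₁ R₂ x) (fun U => U) U) (hLcoA : ∀ (x : MemberY θ.d₆ θ.ℓ₆ θ.hd' θ.hL' θ.b₀ θ.b₁ Mstar) (U : (bg9YR (Matrix (Fin N) (Fin N) ℂ) (specialUnitaryUnits (Fin N)) R₁ R₂ x).Cfg), (𝔬A x).Lap U = LcoK x.toKIdx (trBasis N) (bg9YR (Matrix (Fin N) (Fin N) ℂ) (specialUnitaryUnits (Fin N)) R₁ R₂ x) (fun U => U) U) (h𝔡Ad : ∀ (x : MemberY θ.d₆ θ.ℓ₆ θ.hd' θ.hL' θ.b₀ θ.b₁ Mstar) (U : (bg9YR (Matrix (Fin N) (Fin N) ℂ) (specialUnitaryUnits (Fin N)) R₁ R₂ x).Cfg), (𝔡A x).Dd U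 = fun μ => coordOpK (trBasis N) (fun _ : Fin (θ.d₆ + 1) => cdBₗ x.toKIdx U μ)) (h𝔡As : ∀ (x : MemberY θ.d₆ θ.ℓ₆ θ.hd' θ.hL' θ.b₀ θ.b₁ Mstar) (U : (bg9YR (Matrix (Fin N) (Fin N) ℂ) (specialUnitaryUnits (Fin N)) R₁ R₂ x).Cfg), (𝔡A x).Dsd U = fun μ => coordOpK (trBasis N) (fun _ : Fin (θ.d₆ + 1) => cdsBₗ x.toKIdx U μ))
    -- [rows 19, ed. 119] the bond cube letters `G_□(U) := OcA x □ U`, their (3.42) block tables `h36Ab` (`Local342G` DERIVED)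
    (OcA : ∀ x : MemberY θ.d₆ θ.ℓ₆ θ.hd' θ.hL' θ.b₀ θ.b₁ Mstar, ιA x → BondOpY (Matrix (Fin N) (Fin N) ℂ) x.toKIdx) (hGsqOA : ∀ (x : MemberY θ.d₆ θ.ℓ₆ θ.hd' θ.hL' θ.b₀ θ.b₁ Mstar) (U : (bg9YR (Matrix (Fin N) (Fin N) ℂ) (specialUnitaryUnits (Fin N)) R₁ R₂ x).Cfg) (j : ιA x), (𝔬A x).Gsq U j = GcoK x.toKIdx (trBasis N) (bg9YR (Matrix (Fin N) (Fin N) ℂ) (specialUnitaryUnits (Fin N)) R₁ R₂ x) (fun U => U) (OcA x j) U) (BcA : ℝ) (hBcA : 0 ≤ BcA) (hB₀geA : (nbrCountBY θ.d₆ θ.ℓ₆ θ.hd' θ.hL' θ.b₀ θ.b₁ 1 : ℝ) * Real.exp (2 * q.δ₀) * (cR39 (trBasis N) * BcA) ≤ q.B₀) (h36Ab : ∀ x, q.M₁ ≤ (geo9Y x).M → ∀ α₀ : ℝ, 0 < α₀ → c * (geo9Y x).M * α₀ ≤ q.a₁ → ∀ U : (bg9YR (Matrix (Fin N) (Fin N)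 ℂ) (specialUnitaryUnits (Fin N)) R₁ R₂ x).Cfg, (bg9YR (Matrix (Fin N) (Fin N) ℂ) (specialUnitaryUnits (Fin N)) R₁ R₂ x).Reg335 c α₀ U → (∀ j, HasMajorant (g := toB6 (geoBY x) 1 (H x)) (fun p' : FBondY x.toKIdx × TrIdx N => blkV1 x.toKIdx.hN x.toKIdx.D p'.1) (conj (trBasis N) ((OcA x j U).restrictScalars ℝ)) (fun s s' => BcA * (geoBY x).len s ^ 2 * Real.exp (-(q.δ₀ * (geoBY x).dist s s')))) ∧ (∀ j (ν : Fin (θ.d₆ + 1)), HasMajorant (g := toB6 (geoBY x) 1 (H x)) (fun p' : FBondY x.toKIdx × TrIdx N => blkV1 x.toKIdx.hN x.toKIdx.D p'.1) (conj (trBasis N) (B9CoReadingCoords.cdBₗ x.toKIdx U ν) * conj (trBasis N) ((OcA x j U).restrictScalars ℝ)) (fun s s' => BcA * (geoBY x).len s * Real.exp (-(q.δ₀ * (geoBY x).dist s s')))) ∧ (∀ j (ν : Fin (θ.d₆ + 1)), HasMajorant (g := toB6 (geoBY x) 1 (H x)) (fun p' : FBondY x.toKIdx × TrIdx N => blkV1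 x.toKIdx.hN x.toKIdx.D p'.1) (conj (trBasis N) ((OcA x j U).restrictScalars ℝ) * conj (trBasis N) (B9CoReadingCoords.cdsBₗ x.toKIdx U ν)) (fun s s' => BcA * (geoBY x).len s * Real.exp (-(q.δ₀ * (geoBY x).dist s s')))) ∧ (∀ j, HasMajorant (g := toB6 (geoBY x) 1 (H x)) (fun p' : FBondY x.toKIdx × TrIdx N => blkV1 x.toKIdx.hN x.toKIdx.D p'.1) (conj (trBasis N) (B9CoReadingCoords.lapBₗ x.toKIdx U) * conj (trBasis N) ((OcA x j U).restrictScalars ℝ)) (fun s s' => BcA * 1 * Real.exp (-(q.δ₀ * (geoBY x).dist s s'))))) (𝔬12 : ∀ x : MemberY θ.d₆ θ.ℓ₆ θ.hd' θ.hL' θ.b₀ θ.b₁ Mstar, B9Thm312Whole.Ops (geo9Y x) (bg9YR (Matrix (Fin N) (Fin N) ℂ) (specialUnitaryUnits (Fin N)) R₁ R₂ x) (XBK (TrIdx N) x.toKIdx) (XBK (TrIdx N) x.toKIdx) (XHK (TrIdx N) x.toKIdx) (XSK (TrIdx N) x.toKIdx)) (hblk12 : ∀ x : MemberY θ.d₆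 θ.ℓ₆ θ.hd' θ.hL' θ.b₀ θ.b₁ Mstar, (𝔬12 x).blk = blkBK x.toKIdx (bI x))
    -- [CASCADE-K «KD»] THE SECT.-D OPERATOR RECORD's 22 PINS AT THE KNIT PAIR, DISPLAYED (node00-def-Y `OpsYOps312OfRecordPar.pins312Par_of_eq`'s conjuncts VERBATIM at `(Qknit, Qknit†, parKnitY)`; closed by that lemma at `𝔬12 := ops312YOfRecordPar … ∕ ops312YOfRecordK …` — the equation `𝔬12 = ops312YOfRecordK …` itself is not displayed: its elaboration exceeds the heartbeat budget in this file's context)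
    (hblkW12 : ∀ x : MemberY θ.d₆ θ.ℓ₆ θ.hd' θ.hL' θ.b₀ θ.b₁ Mstar, (𝔬12 x).blkW = blkSK x.toKIdx (sIK x.toKIdx (bI x))) (hblkY12 : ∀ x : MemberY θ.d₆ θ.ℓ₆ θ.hd' θ.hL' θ.b₀ θ.b₁ Mstar, (𝔬12 x).blkY = blkBK x.toKIdx (bI x)) (hG0co12 : ∀ (x : MemberY θ.d₆ θ.ℓ₆ θ.hd' θ.hL' θ.b₀ θ.b₁ Mstar) (U : (bg9YR (Matrix (Fin N) (Fin N) ℂ) (specialUnitaryUnits (Fin N)) R₁ R₂ x).Cfg), (𝔬12 x).G0 U = GcoK x.toKIdx (trBasis N) (bg9YR (Matrix (Fin N) (Fin N) ℂ) (specialUnitaryUnits (Fin N)) R₁ R₂ x) (fun U => U) (𝔏 x).GA U) (hGco12 : ∀ (x : MemberY θ.d₆ θ.ℓ₆ θ.hd' θ.hL' θ.b₀ θ.b₁ Mstar) (U : (bg9YR (Matrix (Fin N) (Fin N) ℂ) (specialUnitaryUnits (Fin N)) R₁ R₂ x).Cfg), (𝔬12 x).G U = GcoK x.toKIdx (trBasis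 N) (bg9YR (Matrix (Fin N) (Fin N) ℂ) (specialUnitaryUnits (Fin N)) R₁ R₂ x) (fun U => U) (𝔏 x).GD U) (hG1co12 : ∀ (x : MemberY θ.d₆ θ.ℓ₆ θ.hd' θ.hL' θ.b₀ θ.b₁ Mstar) (U : (bg9YR (Matrix (Fin N) (Fin N) ℂ) (specialUnitaryUnits (Fin N)) R₁ R₂ x).Cfg), (𝔬12 x).G1 U = GcoK x.toKIdx (trBasis N) (bg9YR (Matrix (Fin N) (Fin N) ℂ) (specialUnitaryUnits (Fin N)) R₁ R₂ x) (fun U => U) (𝔏 x).G₁ U) (hGGco12 : ∀ (x : MemberY θ.d₆ θ.ℓ₆ θ.hd' θ.hL' θ.b₀ θ.b₁ Mstar) (U : (bg9YR (Matrix (Fin N) (Fin N) ℂ) (specialUnitaryUnits (Fin N)) R₁ R₂ x).Cfg), (𝔬12 x).GG U = GcoK x.toKIdx (trBasis N) (bg9YR (Matrix (Fin N) (Fin N) ℂ) (specialUnitaryUnits (Fin N)) R₁ R₂ x) (fun U => U) (𝔏 x).GG U) (hDco12 : ∀ (x : MemberY θ.d₆ θ.ℓ₆ θ.hd' θ.hL'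 θ.b₀ θ.b₁ Mstar) (U : (bg9YR (Matrix (Fin N) (Fin N) ℂ) (specialUnitaryUnits (Fin N)) R₁ R₂ x).Cfg), (𝔬12 x).D U = DcoK x.toKIdx (trBasis N) (bg9YR (Matrix (Fin N) (Fin N) ℂ) (specialUnitaryUnits (Fin N)) R₁ R₂ x) (fun U => U) U) (hDsco12 : ∀ (x : MemberY θ.d₆ θ.ℓ₆ θ.hd' θ.hL' θ.b₀ θ.b₁ Mstar) (U : (bg9YR (Matrix (Fin N) (Fin N) ℂ) (specialUnitaryUnits (Fin N)) R₁ R₂ x).Cfg), (𝔬12 x).Dstar U = DscoK x.toKIdx (trBasis N) (bg9YR (Matrix (Fin N) (Fin N) ℂ) (specialUnitaryUnits (Fin N)) R₁ R₂ x) (fun U => U) U) (hblkZ12 : ∀ x : MemberY θ.d₆ θ.ℓ₆ θ.hd' θ.hL' θ.b₀ θ.b₁ Mstar, (𝔬12 x).blkZ = blkHK x.toKIdx) (hHm12 : ∀ (x : MemberY θ.d₆ θ.ℓ₆ θ.hd' θ.hL' θ.b₀ θ.b₁ Mstar) (U : (bg9YR (Matrix (Fin N) (Fin N) ℂ) (specialUnitaryUnits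 (Fin N)) R₁ R₂ x).Cfg), (𝔬12 x).Hm U = HcoK x.toKIdx (trBasis N) (bg9YR (Matrix (Fin N) (Fin N) ℂ) (specialUnitaryUnits (Fin N)) R₁ R₂ x) (fun U => U) (𝔏 x).H U) (hH1m12 : ∀ (x : MemberY θ.d₆ θ.ℓ₆ θ.hd' θ.hL' θ.b₀ θ.b₁ Mstar) (U : (bg9YR (Matrix (Fin N) (Fin N) ℂ) (specialUnitaryUnits (Fin N)) R₁ R₂ x).Cfg), (𝔬12 x).H1m U = HcoK x.toKIdx (trBasis N) (bg9YR (Matrix (Fin N) (Fin N) ℂ) (specialUnitaryUnits (Fin N)) R₁ R₂ x) (fun U => U) (𝔏 x).H₁ U) (hS0co12 : ∀ (x : MemberY θ.d₆ θ.ℓ₆ θ.hd' θ.hL' θ.b₀ θ.b₁ Mstar) (U : (bg9YR (Matrix (Fin N) (Fin N) ℂ) (specialUnitaryUnits (Fin N)) R₁ R₂ x).Cfg), (𝔬12 x).S0 U = S0coKq x.toKIdx (trBasis N) (bg9YR (Matrix (Fin N) (Fin N) ℂ) (specialUnitaryUnits (Fin N)) R₁ R₂ x) (fun U => U) (qKnitOfRecord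 N θ.toStage3Params x.toKIdx) (qsKnitOfRecord N θ.toStage3Params x.toKIdx) (parKnitY x.toKIdx) (GpPhysY x.toKIdx (parKnitY x.toKIdx)) U) (hTpico12 : ∀ (x : MemberY θ.d₆ θ.ℓ₆ θ.hd' θ.hL' θ.b₀ θ.b₁ Mstar) (U : (bg9YR (Matrix (Fin N) (Fin N) ℂ) (specialUnitaryUnits (Fin N)) R₁ R₂ x).Cfg), (𝔬12 x).Tpi U = TpicoK x.toKIdx (trBasis N) (bg9YR (Matrix (Fin N) (Fin N) ℂ) (specialUnitaryUnits (Fin N)) R₁ R₂ x) (fun U => U) (parKnitY x.toKIdx) (GpPhysY x.toKIdx (parKnitY x.toKIdx)) U) (hT2co12 : ∀ (x : MemberY θ.d₆ θ.ℓ₆ θ.hd' θ.hL' θ.b₀ θ.b₁ Mstar) (U : (bg9YR (Matrix (Fin N) (Fin N) ℂ) (specialUnitaryUnits (Fin N)) R₁ R₂ x).Cfg), (𝔬12 x).T2 U = T2coK x.toKIdx (trBasis N) (bg9YR (Matrix (Fin N) (Fin N) ℂ) (specialUnitaryUnits (Fin N)) R₁ R₂ x) (fun U => U) (parKnitY x.toKIdx)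 (GpPhysY x.toKIdx (parKnitY x.toKIdx)) (𝔯 x).Δ2 U)
    (hQco12 : ∀ (x : MemberY θ.d₆ θ.ℓ₆ θ.hd' θ.hL' θ.b₀ θ.b₁ Mstar) (U : (bg9YR (Matrix (Fin N) (Fin N) ℂ) (specialUnitaryUnits (Fin N)) R₁ R₂ x).Cfg), (𝔬12 x).Q U = QcoKHq x.toKIdx (trBasis N) (bg9YR (Matrix (Fin N) (Fin N) ℂ) (specialUnitaryUnits (Fin N)) R₁ R₂ x) (fun U => U) (qKnitOfRecord N θ.toStage3Params x.toKIdx) U) (hQsco12 : ∀ (x : MemberY θ.d₆ θ.ℓ₆ θ.hd' θ.hL' θ.b₀ θ.b₁ Mstar) (U : (bg9YR (Matrix (Fin N) (Fin N) ℂ) (specialUnitaryUnits (Fin N)) R₁ R₂ x).Cfg), (𝔬12 x).Qstar U = QscoKHq x.toKIdx (trBasis N) (bg9YR (Matrix (Fin N) (Fin N) ℂ) (specialUnitaryUnits (Fin N)) R₁ R₂ x) (fun U => U) (qsKnitOfRecord N θ.toStage3Params x.toKIdx) U) (hCco12 : ∀ (x : MemberY θ.d₆ θ.ℓ₆ θ.hd'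 θ.hL' θ.b₀ θ.b₁ Mstar) (U : (bg9YR (Matrix (Fin N) (Fin N) ℂ) (specialUnitaryUnits (Fin N)) R₁ R₂ x).Cfg), (𝔬12 x).C U = CcoKq x.toKIdx (trBasis N) (bg9YR (Matrix (Fin N) (Fin N) ℂ) (specialUnitaryUnits (Fin N)) R₁ R₂ x) (fun U => U) (qKnitOfRecord N θ.toStage3Params x.toKIdx) (qsKnitOfRecord N θ.toStage3Params x.toKIdx) (parKnitY x.toKIdx) (GpPhysY x.toKIdx (parKnitY x.toKIdx)) U) (hC1co12 : ∀ (x : MemberY θ.d₆ θ.ℓ₆ θ.hd' θ.hL' θ.b₀ θ.b₁ Mstar) (U : (bg9YR (Matrix (Fin N) (Fin N) ℂ) (specialUnitaryUnits (Fin N)) R₁ R₂ x).Cfg), (𝔬12 x).C1 U = C1coKq x.toKIdx (trBasis N) (bg9YR (Matrix (Fin N) (Fin N) ℂ) (specialUnitaryUnits (Fin N)) R₁ R₂ x) (fun U => U) (qKnitOfRecord N θ.toStage3Params x.toKIdx) (qsKnitOfRecord N θ.toStage3Params x.toKIdx) (parKnitY x.toKIdx) (GpPhysY x.toKIdx (parKnitY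 x.toKIdx)) (𝔯 x).Δ2 U) (hDvco12 : ∀ (x : MemberY θ.d₆ θ.ℓ₆ θ.hd' θ.hL' θ.b₀ θ.b₁ Mstar) (U : (bg9YR (Matrix (Fin N) (Fin N) ℂ) (specialUnitaryUnits (Fin N)) R₁ R₂ x).Cfg), (𝔬12 x).Dv U = DvcoKH x.toKIdx (trBasis N) (bg9YR (Matrix (Fin N) (Fin N) ℂ) (specialUnitaryUnits (Fin N)) R₁ R₂ x) (fun U => U) U) (hDvsco12 : ∀ (x : MemberY θ.d₆ θ.ℓ₆ θ.hd' θ.hL' θ.b₀ θ.b₁ Mstar) (U : (bg9YR (Matrix (Fin N) (Fin N) ℂ) (specialUnitaryUnits (Fin N)) R₁ R₂ x).Cfg), (𝔬12 x).Dvstar U = DvscoKH x.toKIdx (trBasis N) (bg9YR (Matrix (Fin N) (Fin N) ℂ) (specialUnitaryUnits (Fin N)) R₁ R₂ x) (fun U => U) U) (hRco12 : ∀ (x : MemberY θ.d₆ θ.ℓ₆ θ.hd' θ.hL' θ.b₀ θ.b₁ Mstar) (U : (bg9YR (Matrix (Fin N) (Fin N) ℂ) (specialUnitaryUnits (Fin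 N)) R₁ R₂ x).Cfg), (𝔬12 x).R U = RcoK x.toKIdx (trBasis N) (bg9YR (Matrix (Fin N) (Fin N) ℂ) (specialUnitaryUnits (Fin N)) R₁ R₂ x) (fun U => U) (parKnitY x.toKIdx) (GpPhysY x.toKIdx (parKnitY x.toKIdx)) U) (h𝔈 : 𝔈 = expsYOfRecordV3Par N θ.toStage3Params Mstar 𝔏 𝔈₀ R₁ R₂ bI (fun x : MemberY θ.d₆ θ.ℓ₆ θ.hd' θ.hL' θ.b₀ θ.b₁ Mstar => parKnitY x.toKIdx) (fun x : MemberY θ.d₆ θ.ℓ₆ θ.hd' θ.hL' θ.b₀ θ.b₁ Mstar => parSymY x.toKIdx) (fun x : MemberY θ.d₆ θ.ℓ₆ θ.hd' θ.hL' θ.b₀ θ.b₁ Mstar => qKnitOfRecord N θ.toStage3Params x.toKIdx) (fun x : MemberY θ.d₆ θ.ℓ₆ θ.hd' θ.hL' θ.b₀ θ.b₁ Mstar => qsKnitOfRecord N θ.toStage3Params x.toKIdx) α' r39 B39 p q p3 q3 pM qM H O near 𝔬A rdA 𝔬12) (bH13 : ∀ x : MemberY θ.d₆ θ.ℓ₆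 θ.hd' θ.hL' θ.b₀ θ.b₁ Mstar, (bg9YR (Matrix (Fin N) (Fin N) ℂ) (specialUnitaryUnits (Fin N)) R₁ R₂ x).Cfg → BlockNorm (toB6 (geo9Y x) 1 (H x)) (XSK (TrIdx N) x.toKIdx → ℝ)) (δ12₀ δK12 σ12 ρ12 a12 M12 B12₃ δ12₃ ρ13 α12 : ℝ) (ρf12 : ℝ) (hρf12 : 0 < ρf12) (hρf1 : ρf12 + σ12 ≤ (1 - α12) * ρ12) (hρf2 : ρf12 + 2 * σ12 + α12 * ρ12 ≤ ρ12) (hB12₃ : 0 ≤ B12₃) (hσ12 : 0 < σ12) (hρ12 : 0 < ρ12) (hρS12 : ρ12 ≤ δ12₀) (hρδ12 : ρ12 + 2 * σ12 ≤ δK12) (hρ₃12 : ρ12 + σ12 ≤ δ12₃) (ha12 : 0 < a12) (hM12 : 0 < M12) (hα12 : 0 < α12) (hα12' : α12 ≤ 1 / 2) (hδ₃₀ : δ12₃ < δ12₀) (hδ12₀ : δ12₀ ≤ (1 - 3 * q.αF) * ((1 - 2 * q.α) * q.δ₀)) (t12 δT12 ρS σS : ℝ) (ht12 : 0 ≤ t12)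 (hσS : 0 < σS) (hρST : ρS ≤ δT12) (hρS₀ : ρS + σS ≤ δ12₀) (hδKS : δK12 + q.αF * ((1 - 2 * q.α) * q.δ₀) ≤ ρS) (hσSK : σS ≤ δK12)
    (bXH : ∀ x : MemberY θ.d₆ θ.ℓ₆ θ.hd' θ.hL' θ.b₀ θ.b₁ Mstar, (bg9YR (Matrix (Fin N) (Fin N) ℂ) (specialUnitaryUnits (Fin N)) R₁ R₂ x).Cfg → BlockNorm (toB6 (geo9Y x) 1 (H x)) (XBK (TrIdx N) x.toKIdx → ℝ)) (w13 wX : ℝ → ℝ) (hw13₀ : ∀ s, 0 ≤ w13 s) (hw13₁ : ∀ s, w13 s ≤ 1) (hwX₀ : ∀ s, 0 ≤ wX s) (hwX₁ : ∀ s, wX s ≤ 1) (hbH13 : ∀ (x : MemberY θ.d₆ θ.ℓ₆ θ.hd' θ.hL' θ.b₀ θ.b₁ Mstar) (U : (bg9YR (Matrix (Fin N) (Fin N) ℂ) (specialUnitaryUnits (Fin N)) R₁ R₂ x).Cfg), bH13 x U = letI : Fintype (B9GeoNormsKLevelV1.geo9K x.toKIdx).Site := (inferInstance : Fintype (geo9Y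 x).Site); bHZPG (κ := TrIdx N) x.toKIdx (trBasis N) (taxiS x.toKIdx (bg9YR (Matrix (Fin N) (Fin N) ℂ) (specialUnitaryUnits (Fin N)) R₁ R₂ x) (fun U => U) U) (R := (1 : ℝ)) (H := H x) w13 hw13₀ hw13₁) (hbXH : ∀ (x : MemberY θ.d₆ θ.ℓ₆ θ.hd' θ.hL' θ.b₀ θ.b₁ Mstar) (U : (bg9YR (Matrix (Fin N) (Fin N) ℂ) (specialUnitaryUnits (Fin N)) R₁ R₂ x).Cfg), bXH x U = letI : Fintype (B9GeoNormsKLevelV1.geo9K x.toKIdx).Site := (inferInstance : Fintype (geo9Y x).Site); bHZKPG (κ := TrIdx N) x.toKIdx (trBasis N) (taxiB x.toKIdx (bg9YR (Matrix (Fin N) (Fin N) ℂ) (specialUnitaryUnits (Fin N)) R₁ R₂ x) (fun U => U) U) (R := (1 : ℝ)) (H := H x) wX hwX₀ hwX₁) (hρ13 : 0 < ρ13) (hρ13ρ : ρ13 + 5 * σ12 ≤ ρ12) (hσρ13 : 3 * σ12 < (1 - α12) * ρ13) (B13₄ : ℝ) (Bx13 : ℝ → ℝ) (hB13₄ : 0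 ≤ B13₄) (hBx13 : ∀ β, 0 ≤ β → β < 1 → 0 ≤ Bx13 β) (tJ δB rT : ℝ) (ha1J : 10 * ((θ.ℓ₆ + 1 : ℕ) : ℝ) ^ 7 * a12 ≤ 1) (htJ : 2 * ((θ.d₆ : ℝ) + 1) * (((θ.ℓ₆ + 1 : ℕ) : ℝ)) ^ 3 * (N : ℝ) * (10 ^ 4 * ((θ.d₆ : ℝ) + 1) * (10 * ((θ.ℓ₆ + 1 : ℕ) : ℝ) ^ 7)) * Real.exp (3 * δB) ≤ tJ) (hrTP : rT ≤ min ((1 - 2 * p.α) * p.δ₀) δ39 / 8) (hrTB : rT ≤ δB) (hδT12 : 0 ≤ δT12) (hδTr : δT12 + 3 * σS + 3 * (q.αF * ((1 - 2 * q.α) * q.δ₀)) ≤ rT) (ϑF : ℝ) (hϑF : 2 * (10 * (((θ.ℓ₆ + 1 : ℕ) : ℝ)) * a12) * (1 + 10 * (((θ.ℓ₆ + 1 : ℕ) : ℝ)) * a12) * Real.exp (4 * (10 * (((θ.ℓ₆ + 1 : ℕ) : ℝ)) * a12)) * (((θ.ℓ₆ + 1 : ℕ) : ℝ)) ≤ ϑF)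 (sch : ℝ → ℝ) (hsch0 : ∀ β', 0 ≤ β' → β' < 1 → 0 < sch β') (hsch1 : ∀ β', 0 ≤ β' → β' < 1 → sch β' < 1) (hschβ : ∀ β', 0 ≤ β' → β' < 1 → β' < sch β') (hwsch : ∀ β', 0 ≤ β' → β' < 1 → 0 < w13 (sch β')) (δ45 : ℝ) (hδ45 : δ12₃ < δ45) (BZ : ℝ → ℝ) (hBZ : ∀ β', 0 ≤ β' → β' < 1 → 0 ≤ BZ β') (hBZge : ∀ β', 0 ≤ β' → β' < 1 → (((θ.ℓ₆ + 1 : ℕ) : ℝ)) * inputConst45 (exp261 (@geo9Y θ.d₆ θ.ℓ₆ θ.hd' θ.hL' θ.b₀ θ.b₁ Mstar) q.δ₀ q.α) q.δ₀ q.α q.NI q.NF (((θ.ℓ₆ + 1 : ℕ) : ℝ)) (holderConst (exp261 (@geo9Y θ.d₆ θ.ℓ₆ θ.hd' θ.hL' θ.b₀ θ.b₁ Mstar) q.δ₀ q.α) q.δ₀ q.α q.NH q.NF (const37 (exp261 (@geo9Y θ.d₆ θ.ℓ₆ θ.hd' θ.hL' θ.b₀ θ.b₁ Mstar) q.δ₀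 q.α) q.δ₀ q.α q.ρ q.B₀ q.Nc q.N' q.Cℓ q.Kc) (q.Bl β') (q.Bt β')) (q.BI2 (sch β' - β') β') (q.θI (sch β')) ≤ BZ β') (hδ45le : δ45 ≤ ((1 - q.αF) * ((1 - 2 * q.α) * q.δ₀) - q.α * q.δ₀)) (δ₂ : ℝ) (hrT4 : rT ≤ δ46K) (hrT2 : rT ≤ δ₂) (hδ₃T : δ12₃ ≤ (1 - 2 * q.αF) * rT - σS) (hδ12₃F : δ12₃ ≤ (1 - 2 * p.αF) * ((1 - 2 * p.α) * p.δ₀)) (δ45Y : ℝ) (hδ45Y : δ12₃ < δ45Y) (BiY : ℝ → ℝ) (hBiY : ∀ β', 0 ≤ β' → β' < 1 → 0 ≤ BiY β') (αW σW δFW : ℝ) (hαW0 : 0 < αW) (hαW1 : αW < 1) (hσW : 0 < σW) (hδFW : 0 < δFW) (hδFP : δFW ≤ min ((1 - 2 * p.α) * p.δ₀) δ39 / 8) (hbudW : 0 ≤ δFW - αW * δFW - 2 * σW) (hδ3W : δ12₃ ≤ δFW - αW * δFW - 2 * σW) (hwschX : ∀ β', 0 ≤ β' → β' < 1 → 0 <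 wX (sch β')) (δ45W : ℝ) (hδ45W : δFW - αW * δFW - 2 * σW ≤ δ45W) (B45W : ℝ → ℝ) (hB45W : ∀ β', 0 ≤ β' → β' < 1 → 0 ≤ B45W β') (δhW : ℝ) (hδhW : δFW - αW * δFW - σW ≤ δhW) (BhW : ℝ → ℝ) (hBhW : ∀ β', 0 ≤ β' → β' < 1 → 0 ≤ BhW β')
    (hB45Wge : ∀ β', 0 ≤ β' → β' < 1 → let Cσ : ℝ := ((((θ.ℓ₆ + 1 : ℕ) : ℝ)) * ((((θ.ℓ₆ + 1 : ℕ) : ℝ)) ^ 3 * (2 + 2 * coordBound39 (trBasis N) * basisBound39 (trBasis N) * (((θ.ℓ₆ + 1 : ℕ) : ℝ)) ^ 2)) * Real.exp ((1 - p.αF) * ((1 - 2 * p.α) * p.δ₀) * (2 * (rNear θ.d₆ θ.ℓ₆ + 1) + (((θ.d₆ : ℝ) + 1) * (((θ.ℓ₆ : ℝ) + 1) + 1) + 2)))); let X44 : ℝ := ((((θ.ℓ₆ + 1 : ℕ) : ℝ)) * ((1 + CLip θ.d₆ θ.ℓ₆) * inputConst44 (exp261 (@geo9Y θ.d₆ θ.ℓ₆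 θ.hd' θ.hL' θ.b₀ θ.b₁ Mstar) p.δ₀ p.α) p.δ₀ p.α p.NI p.N' (p.C (exp261 (@geo9Y θ.d₆ θ.ℓ₆ θ.hd' θ.hL' θ.b₀ θ.b₁ Mstar) p.δ₀ p.α)) (((θ.ℓ₆ + 1 : ℕ) : ℝ)) (p.BI (sch β')) (p.θI (sch β')) * Cσ * B6.c1 (exp261 (@geo9Y θ.d₆ θ.ℓ₆ θ.hd' θ.hL' θ.b₀ θ.b₁ Mstar) p.δ₀ p.α) p.δ₀ p.α)); (((θ.d₆ + 1 : ℕ) : ℝ)) * ((((((θ.ℓ₆ + 1 : ℕ) : ℝ)) * ((1 + CLip θ.d₆ θ.ℓ₆) * inputConst45 (exp261 (@geo9Y θ.d₆ θ.ℓ₆ θ.hd' θ.hL' θ.b₀ θ.b₁ Mstar) p.δ₀ p.α) p.δ₀ p.α p.NI p.N' (((θ.ℓ₆ + 1 : ℕ) : ℝ)) (holderConst (exp261 (@geo9Y θ.d₆ θ.ℓ₆ θ.hd' θ.hL' θ.b₀ θ.b₁ Mstar) p.δ₀ p.α) p.δ₀ p.α p.NH p.N' (p.C (exp261 (@geo9Y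 θ.d₆ θ.ℓ₆ θ.hd' θ.hL' θ.b₀ θ.b₁ Mstar) p.δ₀ p.α)) (p.Bl β') (p.Bt β')) (p.BI2 (sch β' - β') β') (p.θI (sch β')) * Cσ * B6.c1 (exp261 (@geo9Y θ.d₆ θ.ℓ₆ θ.hd' θ.hL' θ.b₀ θ.b₁ Mstar) p.δ₀ p.α) p.δ₀ p.α)) + 2 * coordBound39 (trBasis N) * basisBound39 (trBasis N) * ((θ.ℓ₆ : ℝ) + 1) * Real.exp (((1 - p.αF) * ((1 - 2 * p.α) * p.δ₀) - 3 * (p.α * p.δ₀)) * (((θ.d₆ : ℝ) + 1) * (((θ.ℓ₆ : ℝ) + 1) + 1) + 2)) * ((((θ.d₆ + 1 : ℕ) : ℝ)) ^ 2 * (2 * (10 * (((θ.ℓ₆ + 1 : ℕ) : ℝ)) * (p.a₁ / c)) * (1 + 10 * (((θ.ℓ₆ + 1 : ℕ) : ℝ)) * (p.a₁ / c)) * Real.exp (4 * (10 * (((θ.ℓ₆ + 1 : ℕ) : ℝ)) * (p.a₁ / c)))) * (((θ.ℓ₆ + 1 : ℕ) : ℝ)) ^ 6) * X44 + coordBound39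 (trBasis N) * basisBound39 (trBasis N) * X44 + X44) + X44 + coordBound39 (trBasis N) * basisBound39 (trBasis N) * X44) ≤ B45W β') (hδ45Wle : δ45W ≤ ((1 - p.αF) * ((1 - 2 * p.α) * p.δ₀) - 3 * (p.α * p.δ₀))) (hBhWge : ∀ β', 0 ≤ β' → β' < 1 → ((B9RWSums343Holder.holderConst (B9RWSums347DefiniteFaces.exp261 (@geo9Y θ.d₆ θ.ℓ₆ θ.hd' θ.hL' θ.b₀ θ.b₁ Mstar) p.δ₀ p.α) p.δ₀ p.α p.NH p.N' (p.C (B9RWSums347DefiniteFaces.exp261 (@geo9Y θ.d₆ θ.ℓ₆ θ.hd' θ.hL' θ.b₀ θ.b₁ Mstar) p.δ₀ p.α)) (p.Bl β') (p.Bt β') + 2 * B9Thm39ReadingCoords.coordBound39 (trBasis N) * B9Thm39ReadingCoords.basisBound39 (trBasis N) * ((θ.ℓ₆ : ℝ) + 1) * Real.exp (((1 - 2 * p.α) * p.δ₀) * (((θ.d₆ : ℝ) + 1) * (((θ.ℓ₆ : ℝ) + 1) + 1) + 2)) * ((((θ.d₆ + 1 : ℕ) : ℝ)) ^ 2 * (2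 * (10 * ((θ.ℓ₆ + 1 : ℕ) : ℝ) * (p.a₁ / c)) * (1 + 10 * ((θ.ℓ₆ + 1 : ℕ) : ℝ) * (p.a₁ / c)) * Real.exp (4 * (10 * ((θ.ℓ₆ + 1 : ℕ) : ℝ) * (p.a₁ / c)))) * ((θ.ℓ₆ + 1 : ℕ) : ℝ) ^ 6) * (p.C (B9RWSums347DefiniteFaces.exp261 (@geo9Y θ.d₆ θ.ℓ₆ θ.hd' θ.hL' θ.b₀ θ.b₁ Mstar) p.δ₀ p.α)) + B9Thm39ReadingCoords.coordBound39 (trBasis N) * B9Thm39ReadingCoords.basisBound39 (trBasis N) * (p.C (B9RWSums347DefiniteFaces.exp261 (@geo9Y θ.d₆ θ.ℓ₆ θ.hd' θ.hL' θ.b₀ θ.b₁ Mstar) p.δ₀ p.α)) + (p.C (B9RWSums347DefiniteFaces.exp261 (@geo9Y θ.d₆ θ.ℓ₆ θ.hd' θ.hL' θ.b₀ θ.b₁ Mstar) p.δ₀ p.α))) + (p.C (B9RWSums347DefiniteFaces.exp261 (@geo9Y θ.d₆ θ.ℓ₆ θ.hd' θ.hL' θ.b₀ θ.b₁ Mstar)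 p.δ₀ p.α)) + B9Thm39ReadingCoords.coordBound39 (trBasis N) * B9Thm39ReadingCoords.basisBound39 (trBasis N) * (p.C (B9RWSums347DefiniteFaces.exp261 (@geo9Y θ.d₆ θ.ℓ₆ θ.hd' θ.hL' θ.b₀ θ.b₁ Mstar) p.δ₀ p.α))) ≤ BhW β') (hδhWle : δhW ≤ ((1 - 2 * p.α) * p.δ₀)) (CP : ℝ)
    (hCPge : ((θ.d₆ + 1 : ℕ) : ℝ) * (coordBound39 (trBasis N) * basisBound39 (trBasis N) * nearBlkCntY θ.d₆ θ.ℓ₆ θ.hd' θ.hL' θ.b₀ θ.b₁ Mstar * ((max 1 (N : ℝ) * ((nbrCountY θ.d₆ θ.ℓ₆ θ.hd' θ.hL' θ.b₀ θ.b₁ 2 : ℝ) * p.C (B9RWSums347DefiniteFaces.exp261 (@geo9Y θ.d₆ θ.ℓ₆ θ.hd' θ.hL' θ.b₀ θ.b₁ Mstar) p.δ₀ p.α) * Real.exp (2 * ((1 - 2 * p.α) * p.δ₀)))) * (cR39 (basis39 (Matrix (Fin N) (Fin N) ℂ)) * Fintype.card (κ39 (Matrix (Fin N) (Fin N) ℂ))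 * B39 * Real.exp (2 * δ39)) * (max 1 (N : ℝ) * ((nbrCountY θ.d₆ θ.ℓ₆ θ.hd' θ.hL' θ.b₀ θ.b₁ 2 : ℝ) * p.C (B9RWSums347DefiniteFaces.exp261 (@geo9Y θ.d₆ θ.ℓ₆ θ.hd' θ.hL' θ.b₀ θ.b₁ Mstar) p.δ₀ p.α) * Real.exp (2 * ((1 - 2 * p.α) * p.δ₀)))) * cg349 θ.d₆ θ.ℓ₆ θ.hd' θ.hL' θ.b₀ θ.b₁ ((1 - 2 * p.α) * p.δ₀) δ39) * Real.exp (2 * (min ((1 - 2 * p.α) * p.δ₀) δ39 / 8))) ≤ CP) (hBxW : ∀ β', 0 ≤ β' → β' < 1 → (cR39 (trBasis N))⁻¹ * ((wX (sch β'))⁻¹ * B45W β' + BhW β' * (CP * (((θ.ℓ₆ + 1 : ℕ) : ℝ))) * ((wX (sch β'))⁻¹ * ((((θ.ℓ₆ + 1 : ℕ) : ℝ)) * Real.exp ((δFW - αW * δFW - σW) * (rNear θ.d₆ θ.ℓ₆ + 1)))) * rowConst261 (@geo9Y θ.d₆ θ.ℓ₆ θ.hd' θ.hL' θ.b₀ θ.b₁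 Mstar) σW * rowConst261 (@geo9Y θ.d₆ θ.ℓ₆ θ.hd' θ.hL' θ.b₀ θ.b₁ Mstar) σW) ≤ Bx13 β') (hBiYge : ∀ β', 0 ≤ β' → β' < 1 → (((θ.ℓ₆ + 1 : ℕ) : ℝ)) * inputConst45 (exp261 (@geo9Y θ.d₆ θ.ℓ₆ θ.hd' θ.hL' θ.b₀ θ.b₁ Mstar) q.δ₀ q.α) q.δ₀ q.α q.NI q.NF (((θ.ℓ₆ + 1 : ℕ) : ℝ)) (holderConst (exp261 (@geo9Y θ.d₆ θ.ℓ₆ θ.hd' θ.hL' θ.b₀ θ.b₁ Mstar) q.δ₀ q.α) q.δ₀ q.α q.NH q.NF (const37 (exp261 (@geo9Y θ.d₆ θ.ℓ₆ θ.hd' θ.hL' θ.b₀ θ.b₁ Mstar) q.δ₀ q.α) q.δ₀ q.α q.ρ q.B₀ q.Nc q.N' q.Cℓ q.Kc) (q.Bl β') (q.Bt β')) (q.BI2 (sch β' - β') β') (q.θI (sch β')) ≤ BiY β') (hδ45Yle : δ45Y ≤ ((1 - q.αF) * ((1 - 2 * q.α) * q.δ₀) - q.α * q.δ₀))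
    -- (editions 97∕99∕101) Thm 3.13's block-L² pair record of rows 20–21 is ASSEMBLED from the legs `g0qstar_l2_letters_of_pins` (n06-l), `dv_letters_of_pins`, `rgdI_of_pinsR`, `rgdDs_rgdDd_of_pinsR` (n06-c); its `C₁` line is derived INSIDE dag-n06-l's face v1.6 `…StateSUCL` — no field displayed
    -- rows 20–21's `Letters313DZ ∕ DMZ` records SPLIT (edition 53): the four non-Hölder fields displayed, the Hölder entries `dgDH ∕ dgDHd` DERIVED (`N06DgLegAtPinsPhysPU`, ed. 61) from the (3.44) members `h44m` below
    (s44 : ℝ) (hs440 : 0 < s44) (hs441 : s44 < 1) (hws44 : 0 < w13 s44) (δ44 : ℝ) (hδ44 : δ12₃ < δ44) (Bi44 : ℝ) (hBi44 : 0 ≤ Bi44) (hB12₃d : ((θ.d₆ : ℝ) + 1) * ((1 + CLip θ.d₆ θ.ℓ₆) * Bi44 * (CJG θ.d₆ θ.ℓ₆ (trBasis N) s44 (thetaL θ.d₆ θ.ℓ₆ ϑF) (w13 s44) (δ12₃ + 1 + 1 / 2 * (δ44 - δ12₃)) * (((θ.ℓ₆ + 1 : ℕ) : ℝ))) * rowConst261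 (@geo9Y θ.d₆ θ.ℓ₆ θ.hd' θ.hL' θ.b₀ θ.b₁ Mstar) 1) ≤ B12₃) (hB12₃p : ((θ.d₆ : ℝ) + 1) * (1 * (((θ.d₆ : ℝ) + 1) * ((1 + CLip θ.d₆ θ.ℓ₆) * Bi44 * (CJG θ.d₆ θ.ℓ₆ (trBasis N) s44 (thetaL θ.d₆ θ.ℓ₆ ϑF) (w13 s44) (δ12₃ + 1 + 1 / 2 * (δ44 - δ12₃)) * (((θ.ℓ₆ + 1 : ℕ) : ℝ))) * rowConst261 (@geo9Y θ.d₆ θ.ℓ₆ θ.hd' θ.hL' θ.b₀ θ.b₁ Mstar) 1)) * rowConst261 (@geo9Y θ.d₆ θ.ℓ₆ θ.hd' θ.hL' θ.b₀ θ.b₁ Mstar) 1) ≤ B12₃) (hBi44ge : (((θ.ℓ₆ + 1 : ℕ) : ℝ)) * inputConst44 (exp261 (@geo9Y θ.d₆ θ.ℓ₆ θ.hd' θ.hL' θ.b₀ θ.b₁ Mstar) q.δ₀ q.α) q.δ₀ q.α q.NI q.NF (const37 (exp261 (@geo9Y θ.d₆ θ.ℓ₆ θ.hd' θ.hL' θ.b₀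 θ.b₁ Mstar) q.δ₀ q.α) q.δ₀ q.α q.ρ q.B₀ q.Nc q.N' q.Cℓ q.Kc) (((θ.ℓ₆ + 1 : ℕ) : ℝ)) (q.BI s44) (q.θI s44) ≤ Bi44) (hδ44le : δ44 ≤ ((1 - q.αF) * ((1 - 2 * q.α) * q.δ₀) - q.α * q.δ₀)) (hwX44 : 0 < wX s44) (B44G δ44G : ℝ) (hB44G : 0 ≤ B44G) (hδ44G : δFW - αW * δFW - 2 * σW ≤ δ44G) (hB44Gge : let Cσ : ℝ := ((((θ.ℓ₆ + 1 : ℕ) : ℝ)) * ((((θ.ℓ₆ + 1 : ℕ) : ℝ)) ^ 3 * (2 + 2 * coordBound39 (trBasis N) * basisBound39 (trBasis N) * (((θ.ℓ₆ + 1 : ℕ) : ℝ)) ^ 2)) * Real.exp ((1 - p.αF) * ((1 - 2 * p.α) * p.δ₀) * (2 * (rNear θ.d₆ θ.ℓ₆ + 1) + (((θ.d₆ : ℝ) + 1) * (((θ.ℓ₆ : ℝ) + 1) + 1) + 2)))); (((θ.ℓ₆ + 1 : ℕ) : ℝ)) * ((((θ.d₆ + 1 : ℕ) : ℝ)) * ((1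 + CLip θ.d₆ θ.ℓ₆) * inputConst44 (exp261 (@geo9Y θ.d₆ θ.ℓ₆ θ.hd' θ.hL' θ.b₀ θ.b₁ Mstar) p.δ₀ p.α) p.δ₀ p.α p.NI p.N' (p.C (exp261 (@geo9Y θ.d₆ θ.ℓ₆ θ.hd' θ.hL' θ.b₀ θ.b₁ Mstar) p.δ₀ p.α)) (((θ.ℓ₆ + 1 : ℕ) : ℝ)) (p.BI s44) (p.θI s44) * Cσ * B6.c1 (exp261 (@geo9Y θ.d₆ θ.ℓ₆ θ.hd' θ.hL' θ.b₀ θ.b₁ Mstar) p.δ₀ p.α) p.δ₀ p.α)) ≤ B44G) (hδ44Gle : δ44G ≤ ((1 - p.αF) * ((1 - 2 * p.α) * p.δ₀) - 3 * (p.α * p.δ₀))) (hB₃wG : (cR39 (trBasis N))⁻¹ * ((wX s44)⁻¹ * B44G + (((θ.d₆ + 1 : ℕ) : ℝ) * p.C (B9RWSums347DefiniteFaces.exp261 (@geo9Y θ.d₆ θ.ℓ₆ θ.hd' θ.hL' θ.b₀ θ.b₁ Mstar) p.δ₀ p.α)) * (CP * (((θ.ℓ₆ + 1 : ℕ) : ℝ)))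 * ((wX s44)⁻¹ * ((((θ.ℓ₆ + 1 : ℕ) : ℝ)) * Real.exp ((δFW - αW * δFW - σW) * (rNear θ.d₆ θ.ℓ₆ + 1)))) * rowConst261 (@geo9Y θ.d₆ θ.ℓ₆ θ.hd' θ.hL' θ.b₀ θ.b₁ Mstar) σW * rowConst261 (@geo9Y θ.d₆ θ.ℓ₆ θ.hd' θ.hL' θ.b₀ θ.b₁ Mstar) σW) ≤ B12₃) (BHG : ℝ) (hBHG : 0 ≤ BHG) (hwBhG : ∀ s, 0 < s → s < 1 → wX s * holderConst (exp261 (@geo9Y θ.d₆ θ.ℓ₆ θ.hd' θ.hL' θ.b₀ θ.b₁ Mstar) q.δ₀ q.α) q.δ₀ q.α q.NH q.NF (const37 (exp261 (@geo9Y θ.d₆ θ.ℓ₆ θ.hd' θ.hL' θ.b₀ θ.b₁ Mstar) q.δ₀ q.α) q.δ₀ q.α q.ρ q.B₀ q.Nc q.N' q.Cℓ q.Kc) (q.Bl s) (q.Bt s) ≤ BHG) (B43 δ43 : ℝ) (hB43 : 0 ≤ B43) (B₀D : ℝ) (hB₀D : 0 ≤ B₀D)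
    (hbudD : ∀ s : ℝ, 0 < s → s < 1 → w13 s * ((((θ.d₆ + 1 : ℕ) : ℝ)) * (B9RWSums343Holder.holderConst (B9RWSums347DefiniteFaces.exp261 (@geo9Y θ.d₆ θ.ℓ₆ θ.hd' θ.hL' θ.b₀ θ.b₁ Mstar) p.δ₀ p.α) p.δ₀ p.α p.NH p.N' (p.C (B9RWSums347DefiniteFaces.exp261 (@geo9Y θ.d₆ θ.ℓ₆ θ.hd' θ.hL' θ.b₀ θ.b₁ Mstar) p.δ₀ p.α)) (p.Bl s) (p.Bt s) + 2 * B9Thm39ReadingCoords.coordBound39 (trBasis N) * B9Thm39ReadingCoords.basisBound39 (trBasis N) * ((θ.ℓ₆ : ℝ) + 1) * Real.exp (((1 - 2 * p.α) * p.δ₀) * (((θ.d₆ : ℝ) + 1) * (((θ.ℓ₆ : ℝ) + 1) + 1) + 2)) * ((((θ.d₆ + 1 : ℕ) : ℝ)) ^ 2 * (2 * (10 * ((θ.ℓ₆ + 1 : ℕ) : ℝ) * (p.a₁ / c)) * (1 + 10 * ((θ.ℓ₆ + 1 : ℕ) : ℝ) * (p.a₁ / c)) * Real.exp (4 * (10 *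 ((θ.ℓ₆ + 1 : ℕ) : ℝ) * (p.a₁ / c)))) * ((θ.ℓ₆ + 1 : ℕ) : ℝ) ^ 6) * (p.C (B9RWSums347DefiniteFaces.exp261 (@geo9Y θ.d₆ θ.ℓ₆ θ.hd' θ.hL' θ.b₀ θ.b₁ Mstar) p.δ₀ p.α)) + B9Thm39ReadingCoords.coordBound39 (trBasis N) * B9Thm39ReadingCoords.basisBound39 (trBasis N) * (p.C (B9RWSums347DefiniteFaces.exp261 (@geo9Y θ.d₆ θ.ℓ₆ θ.hd' θ.hL' θ.b₀ θ.b₁ Mstar) p.δ₀ p.α)) + (p.C (B9RWSums347DefiniteFaces.exp261 (@geo9Y θ.d₆ θ.ℓ₆ θ.hd' θ.hL' θ.b₀ θ.b₁ Mstar) p.δ₀ p.α)))) ≤ B₀D) (hB43ge : (((θ.ℓ₆ + 1 : ℕ) : ℝ)) * ((((θ.d₆ + 1 : ℕ) : ℝ)) * (p.C (B9RWSums347DefiniteFaces.exp261 (@geo9Y θ.d₆ θ.ℓ₆ θ.hd' θ.hL' θ.b₀ θ.b₁ Mstar) p.δ₀ p.α)) + B₀D) * Real.exp (((1 - 2 *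 p.α) * p.δ₀) * (rNear θ.d₆ θ.ℓ₆ + 1)) ≤ B43) (hδ43le : δ43 ≤ ((1 - 2 * p.α) * p.δ₀)) (ρrg : ℝ) (hρrg0 : 0 ≤ ρrg) (hbudrg : ρrg + σW + αW * δFW ≤ δFW) (hbud43 : ρrg + σW ≤ δ43) (hδ₃rg : δ12₃ ≤ ρrg) (hB₃rg : B43 * (cR39 (trBasis N))⁻¹ * rowConst261 (@geo9Y θ.d₆ θ.ℓ₆ θ.hd' θ.hL' θ.b₀ θ.b₁ Mstar) σW + CTel θ.d₆ θ.ℓ₆ (trBasis N) ρrg (CP * (((θ.ℓ₆ + 1 : ℕ) : ℝ)) * ((((θ.d₆ + 1 : ℕ) : ℝ) * p.C (B9RWSums347DefiniteFaces.exp261 (@geo9Y θ.d₆ θ.ℓ₆ θ.hd' θ.hL' θ.b₀ θ.b₁ Mstar) p.δ₀ p.α)) * (cR39 (trBasis N))⁻¹ * rowConst261 (@geo9Y θ.d₆ θ.ℓ₆ θ.hd' θ.hL' θ.b₀ θ.b₁ Mstar) σW) * rowConst261 (@geo9Y θ.d₆ θ.ℓ₆ θ.hd' θ.hL' θ.b₀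 θ.b₁ Mstar) σW) (CP * (((θ.ℓ₆ + 1 : ℕ) : ℝ)) * ((((θ.d₆ + 1 : ℕ) : ℝ) * p.C (B9RWSums347DefiniteFaces.exp261 (@geo9Y θ.d₆ θ.ℓ₆ θ.hd' θ.hL' θ.b₀ θ.b₁ Mstar) p.δ₀ p.α)) * (cR39 (trBasis N))⁻¹ * rowConst261 (@geo9Y θ.d₆ θ.ℓ₆ θ.hd' θ.hL' θ.b₀ θ.b₁ Mstar) σW) * rowConst261 (@geo9Y θ.d₆ θ.ℓ₆ θ.hd' θ.hL' θ.b₀ θ.b₁ Mstar) σW) ≤ B12₃) (τS δP : ℝ) (hτS : 0 < τS) (hρP12 : ρ12 + 2 * σ12 ≤ δP) (hU8a : δK12 + 3 * σS + 4 * τS ≤ (1 - 2 * p.α) * p.δ₀) (hU8b : δK12 + 3 * σS + 4 * τS ≤ min ((1 - 2 * p.α) * p.δ₀) δ39 / 8) (hU8c : δK12 + 3 * σS + 4 * τS ≤ δ₂) (hU8d : δK12 + 3 * σS + 5 * τS ≤ δ44G) (hU8e : δK12 + 3 * σS + 4 * τS ≤ δB) (hU8f : δK12 + 2 * σS + τS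 ≤ δ43) (hU8g : δK12 + τS + σS ≤ δT12) (hU8h : δK12 + τS + σS ≤ δ12₃) (hU8i : δK12 + τS + σS ≤ δP) (hU8j : δP + 2 * τS ≤ δ12₀) (hU8k : δP + σS + 2 * τS ≤ δ12₃) (τR : ℝ) (hτR : 0 < τR) (hR8a : δ12₃ + 5 * τR + 3 * σS + 4 * τS ≤ (1 - 2 * p.α) * p.δ₀) (hR8b : δ12₃ + 5 * τR + 3 * σS + 4 * τS ≤ min ((1 - 2 * p.α) * p.δ₀) δ39 / 8) (hR8c : δ12₃ + 5 * τR + 3 * σS + 4 * τS ≤ δ₂) (hR8d : δ12₃ + 5 * τR + 3 * σS + 5 * τS ≤ δ44G) (hR8e : δ12₃ + 5 * τR + 3 * σS + 4 * τS ≤ δB) (hR8f : δ12₃ + 5 * τR + 2 * σS + τS ≤ δ43) (hR8g : δ12₃ + 5 * τR + τS + σS ≤ δT12) (hR8h : δ12₃ + 5 * τR + 2 * σS + 3 * τS < δ12₀) (hR8i : δ12₃ + 5 * τR + 2 * σS + 3 * τS < δ44) (hR8j : δ12₃ + 5 * τR + 2 * σS + 3 * τS < δ45) (hR8k : δ12₃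 + 5 * τR + 2 * σS + 3 * τS < δ45Y) {ιR : Type} [Fintype ιR] [DecidableEq ιR]
    -- [CASCADE-K K3] ROW 17 DISPLAYED AT THE KNIT LETTER (Thm 3.11's `Δ_a^Q(U)` symmetric and positive definite over (3.115)'s `Q` and the knit contours)
    (MR : ℝ) (hΔAK : ∀ x : MemberY θ.d₆ θ.ℓ₆ θ.hd' θ.hL' θ.b₀ θ.b₁ Mstar, MR ≤ (geo9Y x).M → ∀ α₀ : ℝ, 0 < α₀ → (geo9Y x).M * α₀ ≤ q.a₁ / c → ∀ U : (bg9YR (Matrix (Fin N) (Fin N) ℂ) (specialUnitaryUnits (Fin N)) R₁ R₂ x).Cfg, (bg9YR (Matrix (Fin N) (Fin N) ℂ) (specialUnitaryUnits (Fin N)) R₁ R₂ x).Reg335 c α₀ U → IsSymmTr (fun _ => (1 : ℝ)) (deltaAQY x.toKIdx (qKnitOfRecord N θ.toStage3Params x.toKIdx) (qsKnitOfRecord N θ.toStage3Params x.toKIdx) (parKnitY x.toKIdx) (GpY x.toKIdx (parKnitY x.toKIdx)) U) ∧ PosDefTr (fun _ => (1 : ℝ)) (deltaAQY x.toKIdx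 (qKnitOfRecord N θ.toStage3Params x.toKIdx) (qsKnitOfRecord N θ.toStage3Params x.toKIdx) (parKnitY x.toKIdx) (GpY x.toKIdx (parKnitY x.toKIdx)) U))
    -- [CASCADE-K K3] (3.132) DISPLAYED (row 26; dag-n06-l's `s3132Nu_…` consumes the network's state layer at the straight pair)
    (s3132K : B9.Stmt3132Printed (θ.d₆ + 1) c geo9Y (bg9YR (Matrix (Fin N) (Fin N) ℂ) (specialUnitaryUnits (Fin N)) R₁ R₂) (fun x => siteKernelR R₁ R₂ ((opsYSectESt N θ.toStage3Params Mstar (opsYS349NuOfLettersH N θ.toStage3Params Mstar 𝔏 (fun x => parSymY x.toKIdx) 𝔈) 𝔏 (sectEStYOfRecordV7 N θ.toStage3Params Mstar 𝔢₀) 𝔴) x).QGQinv) (fun x => siteKernelR R₁ R₂ ((opsYSectESt N θ.toStage3Params Mstar (opsYS349NuOfLettersH N θ.toStage3Params Mstar 𝔏 (fun x => parSymY x.toKIdx) 𝔈) 𝔏 (sectEStYOfRecordV7 N θ.toStage3Params Mstar 𝔢₀) 𝔴) x).QG1Qinv))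
    -- [CASCADE-K «KD»] THE FOUR WALK PRODUCTS (rows 13∕18∕19 at the E-letters of the object: Thm 3.7, Cor 3.8, Thm 3.10 and the RW-sum inequalities — DERIVED in the companion skeleton «KA» (`rows131819_definite_geo9Y_pairM_dir₄` over the displayed (3.42)–(3.47) tables); HYPOTHESES here, discharged in «KC» = KA ∘ KD)
    (t37E : B9.Thm37Printed c geo9Y (bg9YR (Matrix (Fin N) (Fin N) ℂ) (specialUnitaryUnits (Fin N)) R₁ R₂) fun x => E37YPairMDir (2 * (θ.d₆ + 1)) (nbrCountY θ.d₆ θ.ℓ₆ θ.hd' θ.hL' θ.b₀ θ.b₁ 2) (Real.sqrt (((θ.d₆ : ℝ) + 1) * (Fintype.card (TrIdx N) : ℝ))) ((θ.d₆ + 1 : ℕ) : ℝ) p q { N3 := p3.N3, B3 := 2 * p3.B3, θ3 := 0 } { N3 := q3.N3, B3 := 2 * q3.B3, θ3 := 0 } pM qM (opsWalkYO x (trBasis N) (bg9YR (Matrix (Fin N) (Fin N) ℂ) (specialUnitaryUnits (Fin N)) R₁ R₂ x) (fun U => U) (parKnitY x.toKIdx) (bI x) (O x)) (dirOpsWalkYO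 x (trBasis N) (bg9YR (Matrix (Fin N) (Fin N) ℂ) (specialUnitaryUnits (Fin N)) R₁ R₂ x) (fun U => U) (parKnitY x.toKIdx) (bI x) (O x)) (dirLettersWalkYO x (trBasis N) (bg9YR (Matrix (Fin N) (Fin N) ℂ) (specialUnitaryUnits (Fin N)) R₁ R₂ x) (fun U => U) (parKnitY x.toKIdx) (bI x) (O x)) (rdWalkYO x (bg9YR (Matrix (Fin N) (Fin N) ℂ) (specialUnitaryUnits (Fin N)) R₁ R₂ x) (fun U => U) (parKnitY x.toKIdx) (near x)) (H x) (kernelFamilyR R₁ R₂ ((opsYSectESt N θ.toStage3Params Mstar (opsYS349NuOfLettersH N θ.toStage3Params Mstar 𝔏 (fun x => parSymY x.toKIdx) 𝔈) 𝔏 (sectEStYOfRecordV7 N θ.toStage3Params Mstar 𝔢₀) 𝔴) x).Gp))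
    -- [CASCADE-K «KD»] THE KNIT LAWS OF THE SECT.-D NETWORK, DISPLAYED (node00-def-Y ruling (α): every law about the knit letters is keyed to (3.35)): the symmetric letters `G_D ∕ G₁ ∕ 𝔊` (def-Y `lettersYOfRecordV11K_symmDG₁GG_of_regQY`), `G′(U; parKnitY)` and `R(U; parKnitY)` symmetric (def-Y `RY_GpPhysY_parKnitY_isSymmTr`), the unit `(𝔮G₁𝔮⋆)(U)` (def-Y `…_isUnit_QGQOfQY_G₁_SU_of_regQY`), the Sect.-D identities `Ids3124 ∧ Ids3152` of the Z-letters (def-Y `…_ids3152_SU_of_regQY`), the class letters of `Q ∕ Q⋆` (dag-n06-l `hqK_knit_of_laws ∕ hqsK_knit_of_laws` and their block-L² companions), `C₁(U)` its own transpose (n06-l `hC1T_knit_of_laws`), the (3.46) line of `D G′(U; parKnitY) D⋆` (n06-l `blockBd_DvGcoSDvs_memberY_knit`) and the (3.137) letter of Δ⁽²⁾ (the knit prechain — WANTED)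
    (hsymDK : ∀ (x : MemberY θ.d₆ θ.ℓ₆ θ.hd' θ.hL' θ.b₀ θ.b₁ Mstar) (U : (bg9YR (Matrix (Fin N) (Fin N) ℂ) (specialUnitaryUnits (Fin N)) R₁ R₂ x).Cfg), (∀ μ z, U μ z ∈ specialUnitaryUnits (Fin N)) → IsSymmTr (fun _ => (1 : ℝ)) ((𝔏 x).GD U) ∧ IsSymmTr (fun _ => (1 : ℝ)) ((𝔏 x).G₁ U) ∧ IsSymmTr (fun _ => (1 : ℝ)) ((𝔏 x).GG U)) (hΔ2 : ∀ (x : MemberY θ.d₆ θ.ℓ₆ θ.hd' θ.hL' θ.b₀ θ.b₁ Mstar) (U : (bg9YR (Matrix (Fin N) (Fin N) ℂ) (specialUnitaryUnits (Fin N)) R₁ R₂ x).Cfg), (∀ μ z, U μ z ∈ specialUnitaryUnits (Fin N)) → IsSymmTr (fun _ => (1 : ℝ)) ((𝔯 x).Δ2 U)) (hsymT : ∀ x : MemberY θ.d₆ θ.ℓ₆ θ.hd' θ.hL' θ.b₀ θ.b₁ Mstar, M12 ≤ (geo9Y x).M → ∀ α₀ : ℝ, 0 < α₀ → (geo9Y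 x).M * α₀ ≤ a12 → ∀ U : (bg9YR (Matrix (Fin N) (Fin N) ℂ) (specialUnitaryUnits (Fin N)) R₁ R₂ x).Cfg, (bg9YR (Matrix (Fin N) (Fin N) ℂ) (specialUnitaryUnits (Fin N)) R₁ R₂ x).Reg335 c α₀ U → IsSymmTr (fun _ => (1 : ℝ)) (Node00.GpY x.toKIdx (parKnitY x.toKIdx) U)) (hsymRT : ∀ x : MemberY θ.d₆ θ.ℓ₆ θ.hd' θ.hL' θ.b₀ θ.b₁ Mstar, M12 ≤ (geo9Y x).M → ∀ α₀ : ℝ, 0 < α₀ → (geo9Y x).M * α₀ ≤ a12 → ∀ U : (bg9YR (Matrix (Fin N) (Fin N) ℂ) (specialUnitaryUnits (Fin N)) R₁ R₂ x).Cfg, (bg9YR (Matrix (Fin N) (Fin N) ℂ) (specialUnitaryUnits (Fin N)) R₁ R₂ x).Reg335 c α₀ U → IsSymmTr (fun _ => (1 : ℝ)) (Node00.RY x.toKIdx (parKnitY x.toKIdx) (Node00.GpY x.toKIdx (parKnitY x.toKIdx)) U)) (hUQG1K : ∀ x : MemberY θ.d₆ θ.ℓ₆ θ.hd' θ.hL'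 θ.b₀ θ.b₁ Mstar, M12 ≤ (geo9Y x).M → ∀ α₀ : ℝ, 0 < α₀ → (geo9Y x).M * α₀ ≤ a12 → ∀ U : (bg9YR (Matrix (Fin N) (Fin N) ℂ) (specialUnitaryUnits (Fin N)) R₁ R₂ x).Cfg, (bg9YR (Matrix (Fin N) (Fin N) ℂ) (specialUnitaryUnits (Fin N)) R₁ R₂ x).Reg335 c α₀ U → (bg9YR (Matrix (Fin N) (Fin N) ℂ) (specialUnitaryUnits (Fin N)) R₁ R₂ x).Reg336 c α₀ U → PosDefTr (fun _ => (1 : ℝ)) (deltaOneQY x.toKIdx (qKnitOfRecord N θ.toStage3Params x.toKIdx) (qsKnitOfRecord N θ.toStage3Params x.toKIdx) (parKnitY x.toKIdx) (GpPhysY x.toKIdx (parKnitY x.toKIdx)) ((𝔯 x).Δ2) U) → IsUnit (Node00.QGQOfQY x.toKIdx (qKnitOfRecord N θ.toStage3Params x.toKIdx) (qsKnitOfRecord N θ.toStage3Params x.toKIdx) (G1QY x.toKIdx (qKnitOfRecord N θ.toStage3Params x.toKIdx) (qsKnitOfRecord N θ.toStage3Params x.toKIdx) (parKnitY x.toKIdx)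 (GpPhysY x.toKIdx (parKnitY x.toKIdx)) ((𝔯 x).Δ2)) U)) (hidsK : ∀ x : MemberY θ.d₆ θ.ℓ₆ θ.hd' θ.hL' θ.b₀ θ.b₁ Mstar, M12 ≤ (geo9Y x).M → ∀ α₀ : ℝ, 0 < α₀ → (geo9Y x).M * α₀ ≤ a12 → ∀ U : (bg9YR (Matrix (Fin N) (Fin N) ℂ) (specialUnitaryUnits (Fin N)) R₁ R₂ x).Cfg, (bg9YR (Matrix (Fin N) (Fin N) ℂ) (specialUnitaryUnits (Fin N)) R₁ R₂ x).Reg335 c α₀ U → (bg9YR (Matrix (Fin N) (Fin N) ℂ) (specialUnitaryUnits (Fin N)) R₁ R₂ x).Reg336 c α₀ U → IsUnit (deltaOneQY x.toKIdx (qKnitOfRecord N θ.toStage3Params x.toKIdx) (qsKnitOfRecord N θ.toStage3Params x.toKIdx) (parKnitY x.toKIdx) (GpPhysY x.toKIdx (parKnitY x.toKIdx)) ((𝔯 x).Δ2) U) → Ids3124 (𝔬12 x) U ∧ Ids3152 (𝔬12 x) (fun U => GcoS x.toKIdx (trBasis N) (bg9YR (Matrix (Fin N) (Fin N) ℂ)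 (specialUnitaryUnits (Fin N)) R₁ R₂ x) (fun U => U) (GpY x.toKIdx (parKnitY x.toKIdx)) U) U) (BQs δQs : ℝ) (hBQs : 0 ≤ BQs) (hδQs1 : δ12₀ + 1 ≤ δQs) (hδQs2 : δ12₃ + σ12 ≤ δQs) (hδQs3 : δ12₃ + 1 ≤ δQs) (hqsK : ∀ x : MemberY θ.d₆ θ.ℓ₆ θ.hd' θ.hL' θ.b₀ θ.b₁ Mstar, M12 ≤ (geo9Y x).M → ∀ α₀ : ℝ, 0 < α₀ → (geo9Y x).M * α₀ ≤ a12 → ∀ U : (bg9YR (Matrix (Fin N) (Fin N) ℂ) (specialUnitaryUnits (Fin N)) R₁ R₂ x).Cfg, (bg9YR (Matrix (Fin N) (Fin N) ℂ) (specialUnitaryUnits (Fin N)) R₁ R₂ x).Reg335 c α₀ U → HasMaj (weightNorm (BlockNorm.ofBlocks (toB6 (geo9Y x) 1 (H x)) (𝔬12 x).blkZ) (fun y => ((((θ.ℓ₆ + 1 : ℕ) : ℝ) ^ (θ.d₆ + 1)) ^ lvl x.hN x.D x.hk y)⁻¹) (fun y => (plateau_pos x.toKIdx y).le)) (cNorm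 1 (H x) (𝔬12 x).blk (fun y => (geo9Y_len_pos x y).le) 0) ((𝔬12 x).Qstar U) (fun a a' => BQs * Real.exp (-(δQs * (geo9Y x).dist a a')))) (BQL : ℝ) (hBQL : 0 ≤ BQL)
    (hqsL2K : ∀ x : MemberY θ.d₆ θ.ℓ₆ θ.hd' θ.hL' θ.b₀ θ.b₁ Mstar, M12 ≤ (geo9Y x).M → ∀ α₀ : ℝ, 0 < α₀ → (geo9Y x).M * α₀ ≤ a12 → ∀ U : (bg9YR (Matrix (Fin N) (Fin N) ℂ) (specialUnitaryUnits (Fin N)) R₁ R₂ x).Cfg, (bg9YR (Matrix (Fin N) (Fin N) ℂ) (specialUnitaryUnits (Fin N)) R₁ R₂ x).Reg335 c α₀ U → B9SectDL2Decay.BlockBd (g := toB6 (geo9Y x) 1 (H x)) (𝔬12 x).blkZ (𝔬12 x).blk ((𝔬12 x).Qstar U) (fun (y y' : (geo9Y x).Site) => BQL * ((geo9Y x).len y)⁻¹ * (Real.sqrt (((((θ.ℓ₆ + 1 : ℕ) : ℝ) ^ (θ.d₆ + 1)) ^ lvl x.hN x.D x.hk y')⁻¹) * (geo9Y x).len y')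 * Real.exp (-(δQs * (geo9Y x).dist y y')))) (hqL2K : ∀ x : MemberY θ.d₆ θ.ℓ₆ θ.hd' θ.hL' θ.b₀ θ.b₁ Mstar, M12 ≤ (geo9Y x).M → ∀ α₀ : ℝ, 0 < α₀ → (geo9Y x).M * α₀ ≤ a12 → ∀ U : (bg9YR (Matrix (Fin N) (Fin N) ℂ) (specialUnitaryUnits (Fin N)) R₁ R₂ x).Cfg, (bg9YR (Matrix (Fin N) (Fin N) ℂ) (specialUnitaryUnits (Fin N)) R₁ R₂ x).Reg335 c α₀ U → B9SectDL2Decay.BlockBd (g := toB6 (geo9Y x) 1 (H x)) (𝔬12 x).blk (𝔬12 x).blkZ ((𝔬12 x).Q U) (fun (y y' : (geo9Y x).Site) => BQL * (Real.sqrt (((((θ.ℓ₆ + 1 : ℕ) : ℝ) ^ (θ.d₆ + 1)) ^ lvl x.hN x.D x.hk y)⁻¹) * (geo9Y x).len y * ((geo9Y x).len y')⁻¹) * Real.exp (-(δQs * (geo9Y x).dist y y')))) (BQp : ℝ) (hBQp : 0 ≤ BQp) (hqK : ∀ x : MemberY θ.d₆ θ.ℓ₆ θ.hd' θ.hL' θ.b₀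 θ.b₁ Mstar, M12 ≤ (geo9Y x).M → ∀ α₀ : ℝ, 0 < α₀ → (geo9Y x).M * α₀ ≤ a12 → ∀ U : (bg9YR (Matrix (Fin N) (Fin N) ℂ) (specialUnitaryUnits (Fin N)) R₁ R₂ x).Cfg, (bg9YR (Matrix (Fin N) (Fin N) ℂ) (specialUnitaryUnits (Fin N)) R₁ R₂ x).Reg335 c α₀ U → ∀ p' : ℕ, p' ≤ 2 → HasMaj (cNorm 1 (H x) (𝔬12 x).blk (fun y => (geo9Y_len_pos x y).le) p') (cNorm 1 (H x) (𝔬12 x).blkZ (fun y => (geo9Y_len_pos x y).le) p') ((𝔬12 x).Q U) (fun a a' => BQp * Real.exp (-(δ12₃ * (geo9Y x).dist a a')))) (hC1TK : ∀ x : MemberY θ.d₆ θ.ℓ₆ θ.hd' θ.hL' θ.b₀ θ.b₁ Mstar, M12 ≤ (geo9Y x).M → ∀ α₀ : ℝ, 0 < α₀ → (geo9Y x).M * α₀ ≤ a12 → ∀ U : (bg9YR (Matrix (Fin N) (Fin N) ℂ) (specialUnitaryUnits (Fin N)) R₁ R₂ x).Cfg, (bg9YR (Matrix (Fin N) (Fin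 N) ℂ) (specialUnitaryUnits (Fin N)) R₁ R₂ x).Reg335 c α₀ U → (bg9YR (Matrix (Fin N) (Fin N) ℂ) (specialUnitaryUnits (Fin N)) R₁ R₂ x).Reg336 c α₀ U → IsTransposePair ((𝔬12 x).C1 U) ((𝔬12 x).C1 U)) (h46K : ∀ x : MemberY θ.d₆ θ.ℓ₆ θ.hd' θ.hL' θ.b₀ θ.b₁ Mstar, M46K ≤ (geo9Y x).M → ∀ α₀ : ℝ, 0 < α₀ → (geo9Y x).M * α₀ ≤ a46K → ∀ U : (bg9YR (Matrix (Fin N) (Fin N) ℂ) (specialUnitaryUnits (Fin N)) R₁ R₂ x).Cfg, (bg9YR (Matrix (Fin N) (Fin N) ℂ) (specialUnitaryUnits (Fin N)) R₁ R₂ x).Reg335 c α₀ U → B9SectDL2Decay.BlockBd (g := toB6 (geo9Y x) 1 (H x)) (blkBK x.toKIdx (bI x)) (blkBK x.toKIdx (bI x)) (DvcoKH x.toKIdx (trBasis N) (bg9YR (Matrix (Fin N) (Fin N) ℂ) (specialUnitaryUnits (Fin N)) R₁ R₂ x) (fun U => U) U ∘ₗ GcoS x.toKIdx (trBasis N) (bg9YR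 (Matrix (Fin N) (Fin N) ℂ) (specialUnitaryUnits (Fin N)) R₁ R₂ x) (fun U => U) (GpY x.toKIdx (parKnitY x.toKIdx)) U ∘ₗ DvscoKH x.toKIdx (trBasis N) (bg9YR (Matrix (Fin N) (Fin N) ℂ) (specialUnitaryUnits (Fin N)) R₁ R₂ x) (fun U => U) U) (fun (y y' : (geo9Y x).Site) => B46K * Real.exp (-(δ46K * (geo9Y x).dist y y')))) (MD2 aD₀ θ₂ : ℝ) (haD00 : 0 < aD₀) (hθ₂ : 0 ≤ θ₂)
    (hD2P : ∀ aD' : ℝ, aD' ≤ aD₀ → ∀ x : MemberY θ.d₆ θ.ℓ₆ θ.hd' θ.hL' θ.b₀ θ.b₁ Mstar, MD2 ≤ (geo9Y x).M → ∀ α₀ : ℝ, 0 < α₀ → (geo9Y x).M * α₀ ≤ aD' → ∀ U : (bg9YR (Matrix (Fin N) (Fin N) ℂ) (specialUnitaryUnits (Fin N)) R₁ R₂ x).Cfg, (bg9YR (Matrix (Fin N) (Fin N) ℂ) (specialUnitaryUnits (Fin N)) R₁ R₂ x).Reg335 c α₀ U → (bg9YR (Matrix (Fin N) (Fin N) ℂ)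 (specialUnitaryUnits (Fin N)) R₁ R₂ x).Reg336 c α₀ U → HasMajorant (g := toB6 (geo9Y x) 1 (H x)) (𝔬12 x).blk (D2coK x.toKIdx (trBasis N) (bg9YR (Matrix (Fin N) (Fin N) ℂ) (specialUnitaryUnits (Fin N)) R₁ R₂ x) (fun U => U) ((𝔯 x).Δ2) U) (fun (a b : (geo9Y x).Site) => θ₂ * ((geo9Y x).M * α₀) * ((geo9Y x).len a ^ 2)⁻¹ * Real.exp (-(δ₂ * (geo9Y x).dist a b))))
    : B9.Thm312Printed (θ.d₆ + 1) c geo9Y (bg9YR (Matrix (Fin N) (Fin N) ℂ) (specialUnitaryUnits (Fin N)) R₁ R₂) (fun x => kernelFamilyR R₁ R₂ ((opsYSectESt N θ.toStage3Params Mstar (opsYS349NuOfLettersH N θ.toStage3Params Mstar 𝔏 (fun x => parSymY x.toKIdx) 𝔈) 𝔏 (sectEStYOfRecordV7 N θ.toStage3Params Mstar 𝔢₀) 𝔴) x).GD) (fun x => kernelFamilyR R₁ R₂ ((opsYSectESt N θ.toStage3Params Mstar (opsYS349NuOfLettersH N θ.toStage3Params Mstar 𝔏 (fun x => parSymY x.toKIdx)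 𝔈) 𝔏 (sectEStYOfRecordV7 N θ.toStage3Params Mstar 𝔢₀) 𝔴) x).G₁) (fun x => hKernelR R₁ R₂ ((opsYSectESt N θ.toStage3Params Mstar (opsYS349NuOfLettersH N θ.toStage3Params Mstar 𝔏 (fun x => parSymY x.toKIdx) 𝔈) 𝔏 (sectEStYOfRecordV7 N θ.toStage3Params Mstar 𝔢₀) 𝔴) x).H) (fun x => hKernelR R₁ R₂ ((opsYSectESt N θ.toStage3Params Mstar (opsYS349NuOfLettersH N θ.toStage3Params Mstar 𝔏 (fun x => parSymY x.toKIdx) 𝔈) 𝔏 (sectEStYOfRecordV7 N θ.toStage3Params Mstar 𝔢₀) 𝔴) x).H₁) (fun x K => ((opsYSectESt N θ.toStage3Params Mstar (opsYS349NuOfLettersH N θ.toStage3Params Mstar 𝔏 (fun x => parSymY x.toKIdx) 𝔈) 𝔏 (sectEStYOfRecordV7 N θ.toStage3Params Mstar 𝔢₀) 𝔴) x).HasRWExp (kernelFamilyRY K)) (fun x K => ((opsYSectESt N θ.toStage3Params Mstar (opsYS349NuOfLettersH N θ.toStage3Params Mstar 𝔏 (fun x => parSymY x.toKIdx) 𝔈)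 𝔏 (sectEStYOfRecordV7 N θ.toStage3Params Mstar 𝔢₀) 𝔴) x).HasRWExpH (hKernelRY K)) (fun x K => ((opsYSectESt N θ.toStage3Params Mstar (opsYS349NuOfLettersH N θ.toStage3Params Mstar 𝔏 (fun x => parSymY x.toKIdx) 𝔈) 𝔏 (sectEStYOfRecordV7 N θ.toStage3Params Mstar 𝔢₀) 𝔴) x).PosDefK (kernelFamilyRY K)) ∧
      B9.Thm313Printed c geo9Y (bg9YR (Matrix (Fin N) (Fin N) ℂ) (specialUnitaryUnits (Fin N)) R₁ R₂) (fun x => kernelFamilyR R₁ R₂ ((opsYSectESt N θ.toStage3Params Mstar (opsYS349NuOfLettersH N θ.toStage3Params Mstar 𝔏 (fun x => parSymY x.toKIdx) 𝔈) 𝔏 (sectEStYOfRecordV7 N θ.toStage3Params Mstar 𝔢₀) 𝔴) x).GG) (fun x K => ((opsYSectESt N θ.toStage3Params Mstar (opsYS349NuOfLettersH N θ.toStage3Params Mstar 𝔏 (fun x => parSymY x.toKIdx) 𝔈) 𝔏 (sectEStYOfRecordV7 N θ.toStage3Params Mstar 𝔢₀) 𝔴) x).HasRWExp (kernelFamilyRY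 K)) (fun x K => ((opsYSectESt N θ.toStage3Params Mstar (opsYS349NuOfLettersH N θ.toStage3Params Mstar 𝔏 (fun x => parSymY x.toKIdx) 𝔈) 𝔏 (sectEStYOfRecordV7 N θ.toStage3Params Mstar 𝔢₀) 𝔴) x).PosDefK (kernelFamilyRY K)) := by
  let 𝔅 := fun (x : MemberY θ.d₆ θ.ℓ₆ θ.hd' θ.hL' θ.b₀ θ.b₁ Mstar) => bg9YR (Matrix (Fin N) (Fin N) ℂ) (specialUnitaryUnits (Fin N)) R₁ R₂ x; let rd : ∀ x : MemberY θ.d₆ θ.ℓ₆ θ.hd' θ.hL' θ.b₀ θ.b₁ Mstar, WalkReading (geo9Y x) (𝔅 x) (XSK (TrIdx N) x.toKIdx) ↥(cubes x.toKIdx.D.toDomains) := fun x => rdWalkYO x (𝔅 x) (fun U => U) (parKnitY x.toKIdx) (near x)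
  obtain ⟨hβI, hlev, hβ1, hbI0⟩ := OpsYBondMapOfRecord.lawsY_of_eq hbI
  obtain ⟨-, -, -, -, hpinE, hpinH, hpinK⟩ := OpsYExpsOfRecordV3Par.pinsE_of_eq h𝔈
  let κ13 : ℝ := 1 + CLip θ.d₆ θ.ℓ₆
  have hκ13 : ∀ (x : MemberY θ.d₆ θ.ℓ₆ θ.hd' θ.hL' θ.b₀ θ.b₁ Mstar) (U : (𝔅 x).Cfg), (bH13 x U).κ ≤ κ13 := hκ13_of_pinsP H w13 hw13₀ hw13₁ bH13 hbH13
  have hκX : ∀ (x : MemberY θ.d₆ θ.ℓ₆ θ.hd' θ.hL' θ.b₀ θ.b₁ Mstar) (U : (𝔅 x).Cfg), (bXH x U).κ ≤ κ13 := hκX_of_pinsP H wX hwX₀ hwX₁ bXH hbXH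
  have hϑF₀ : 0 ≤ ϑF := budget_nonneg ha12.le hϑF
  have hFϑ := plaqV_binder_of_regYR_budget_SU (N := N) hGR c hRP1 (M₀ := M12) (a₀ := a12) hϑF
  have hδ12₃0X : 0 ≤ δ12₃ := le_of_lt (lt_of_lt_of_le (add_pos hρ12 hσ12) hρ₃12)
  have hthrp : ∀ (x : MemberY θ.d₆ θ.ℓ₆ θ.hd' θ.hL' θ.b₀ θ.b₁ Mstar) (α₀ : ℝ), c * (geo9Y x).M * α₀ ≤ p.a₁ → (geo9Y x).M * α₀ ≤ aK := fun x α₀ h => ((le_div_iff₀' hc).mpr (by simpa only [mul_assoc] using h)).trans hpaK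
  have hthrq : ∀ (x : MemberY θ.d₆ θ.ℓ₆ θ.hd' θ.hL' θ.b₀ θ.b₁ Mstar) (α₀ : ℝ), c * (geo9Y x).M * α₀ ≤ q.a₁ → (geo9Y x).M * α₀ ≤ aK := fun x α₀ h => ((le_div_iff₀' hc).mpr (by simpa only [mul_assoc] using h)).trans hqaK
  have hlawK : ∀ (x : MemberY θ.d₆ θ.ℓ₆ θ.hd' θ.hL' θ.b₀ θ.b₁ Mstar) (α₀ : ℝ), 0 < α₀ → (geo9Y x).M * α₀ ≤ aK → ∀ U : (𝔅 x).Cfg, (𝔅 x).Reg335 c α₀ U → (∀ z w : SiteY x.toKIdx, parKnitY x.toKIdx U z w ∈ B7Prop2Explicit.unitaryUnits (Matrix (Fin N) (Fin N) ℂ)) ∧ PosDefTr (fun _ => (1 : ℝ)) (deltaPrimeAY x.toKIdx (parKnitY x.toKIdx) U) := fun x α₀ hα ha U hU => laws_parKnitY_of_reg335P x c35Y_eq.le (mul_nonneg (B9C2FormMajTorusLettersAtMemberY.kGeo_M_nonneg x.toKIdx) hα.le) hαK hαK3 hαK2 (hKplK x.toKIdx _ (mul_nonneg (B9C2FormMajTorusLettersAtMemberY.kGeo_M_nonneg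 x.toKIdx) hα.le) ha) (mem_of_reg335R hGR x hU) (hRP1 x α₀ U hU).2.1
  have hsymGA : ∀ (x : MemberY θ.d₆ θ.ℓ₆ θ.hd' θ.hL' θ.b₀ θ.b₁ Mstar) (α₀ : ℝ), 0 < α₀ → (geo9Y x).M * α₀ ≤ aK → ∀ U : (𝔅 x).Cfg, (𝔅 x).Reg335 c α₀ U → IsSymmTr (fun _ => (1 : ℝ)) ((𝔏 x).GA U) := fun x α₀ hα ha U hU => by rw [h𝔏GA x, ← Node00.GAQY_GpPhysY x.toKIdx (qKnitOfRecord N θ.toStage3Params x.toKIdx) (qsKnitOfRecord N θ.toStage3Params x.toKIdx) (parKnitY x.toKIdx)]; exact Node00.GAQY_isSymmTr x.toKIdx (qKnitOfRecord N θ.toStage3Params x.toKIdx) (qsKnitOfRecord N θ.toStage3Params x.toKIdx) (parKnitY x.toKIdx) (GpPhysY x.toKIdx (parKnitY x.toKIdx)) U le_rfl (fun μ z => specialUnitaryUnits_le_unitaryUnits (mem_of_reg335R hGR x hU μ z)) (Node00.isAdjTr_qKnitOfRecord x.toKIdx U) (Node00.RY_GpPhysY_parKnitY_isSymmTr x.toKIdx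 le_rfl (fun μ z => specialUnitaryUnits_le_unitaryUnits (mem_of_reg335R hGR x hU μ z)) (hlawK x α₀ hα ha U hU).1)
  let 𝔬 : ∀ x : MemberY θ.d₆ θ.ℓ₆ θ.hd' θ.hL' θ.b₀ θ.b₁ Mstar, Ops (geo9Y x) (𝔅 x) (XSK (TrIdx N) x.toKIdx) (XSK (TrIdx N) x.toKIdx) ↥(cubes x.toKIdx.D.toDomains) := fun x => opsWalkYO x (trBasis N) (𝔅 x) (fun U => U) (parKnitY x.toKIdx) (bI x) (O x)
  let 𝔡 : ∀ x : MemberY θ.d₆ θ.ℓ₆ θ.hd' θ.hL' θ.b₀ θ.b₁ Mstar, DirOps37 (𝔬 x) (Fin (θ.d₆ + 1)) := fun x => dirOpsWalkYO x (trBasis N) (𝔅 x) (fun U => U) (parKnitY x.toKIdx) (bI x) (O x)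
  let 𝔩 : ∀ x : MemberY θ.d₆ θ.ℓ₆ θ.hd' θ.hL' θ.b₀ θ.b₁ Mstar, DirLetters37 (𝔬 x) (Fin (θ.d₆ + 1)) := fun x => dirLettersWalkYO x (trBasis N) (𝔅 x) (fun U => U) (parKnitY x.toKIdx) (bI x) (O x)
  let κ : MemberY θ.d₆ θ.ℓ₆ θ.hd' θ.hL' θ.b₀ θ.b₁ Mstar → Sizes := fun x => kappaWalkY x (trBasis N)
  have hblkS : ∀ x : MemberY θ.d₆ θ.ℓ₆ θ.hd' θ.hL' θ.b₀ θ.b₁ Mstar, (𝔬 x).blk = blkSK x.toKIdx (sIK x.toKIdx (bI x)) := fun _ => rfl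
  have hblkYS : ∀ x : MemberY θ.d₆ θ.ℓ₆ θ.hd' θ.hL' θ.b₀ θ.b₁ Mstar, (𝔬 x).blkY = blkSK x.toKIdx (sIK x.toKIdx (bI x)) := fun _ => rfl
  have hGsqF : ∀ (x : MemberY θ.d₆ θ.ℓ₆ θ.hd' θ.hL' θ.b₀ θ.b₁ Mstar) (U : (𝔅 x).Cfg) (c : ↥(cubes x.toKIdx.D.toDomains)), (𝔬 x).Gsq U c = GcoS x.toKIdx (trBasis N) (𝔅 x) (fun U => U) (O x c) U := fun _ _ _ => rfl
  have hGsqT : ∀ (x : MemberY θ.d₆ θ.ℓ₆ θ.hd' θ.hL' θ.b₀ θ.b₁ Mstar) (α₀ : ℝ) (U : (𝔅 x).Cfg), (𝔅 x).Reg335 c α₀ U → ∀ q' : ↥(cubes x.toKIdx.D.toDomains), IsTransposePair ((𝔬 x).Gsq U q') ((𝔬 x).Gsq U q') := fun x α₀ U hU q' => isTransposePair_GcoS_trBasis x.toKIdx (𝔅 x) (fun U => U) (O x q') U (hOsym x α₀ U hU q')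
  have hGpS : ∀ (x : MemberY θ.d₆ θ.ℓ₆ θ.hd' θ.hL' θ.b₀ θ.b₁ Mstar) U, (𝔬 x).Gp U = GcoS x.toKIdx (trBasis N) (𝔅 x) (fun U => U) (𝔏 x).Gp U := fun x U => by rw [h𝔏Gp x]; rfl
  have hDS : ∀ (x : MemberY θ.d₆ θ.ℓ₆ θ.hd' θ.hL' θ.b₀ θ.b₁ Mstar) U, (𝔬 x).D U = DcoS x.toKIdx (trBasis N) (𝔅 x) (fun U => U) U := fun _ _ => rfl
  have hDsS : ∀ (x : MemberY θ.d₆ θ.ℓ₆ θ.hd' θ.hL' θ.b₀ θ.b₁ Mstar) U, (𝔬 x).Dstar U = DscoS x.toKIdx (trBasis N) (𝔅 x) (fun U => U) U := fun _ _ => rfl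
  have h𝔡d : ∀ (x : MemberY θ.d₆ θ.ℓ₆ θ.hd' θ.hL' θ.b₀ θ.b₁ Mstar) (U : (𝔅 x).Cfg), (𝔡 x).Dd U = fun μ => (etaS x.toKIdx)⁻¹ • coordOpK (trBasis N) (fun _ : Fin (θ.d₆ + 1) => (cdSL x.toKIdx U μ).restrictScalars ℝ) := fun _ _ => rfl
  have h𝔡s : ∀ (x : MemberY θ.d₆ θ.ℓ₆ θ.hd' θ.hL' θ.b₀ θ.b₁ Mstar) (U : (𝔅 x).Cfg), (𝔡 x).Dsd U = fun μ => (etaS x.toKIdx)⁻¹ • coordOpK (trBasis N) (fun _ : Fin (θ.d₆ + 1) => (cdsSL x.toKIdx U μ).restrictScalars ℝ) := fun _ _ => rfl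
  have t37' : B9.Thm37Printed c geo9Y (bg9YR (Matrix (Fin N) (Fin N) ℂ) (specialUnitaryUnits (Fin N)) R₁ R₂) fun x => E37YPairMDir (2 * (θ.d₆ + 1)) (nbrCountY θ.d₆ θ.ℓ₆ θ.hd' θ.hL' θ.b₀ θ.b₁ 2) (Real.sqrt (((θ.d₆ : ℝ) + 1) * (Fintype.card (TrIdx N) : ℝ))) ((θ.d₆ + 1 : ℕ) : ℝ) p q { N3 := p3.N3, B3 := 2 * p3.B3, θ3 := 0 } { N3 := q3.N3, B3 := 2 * q3.B3, θ3 := 0 } pM qM (𝔬 x) (𝔡 x) (𝔩 x) (rd x) (H x) (kernelFamilyR R₁ R₂ ((opsYSectESt N θ.toStage3Params Mstar (opsYS349NuOfLettersH N θ.toStage3Params Mstar 𝔏 (fun x => parSymY x.toKIdx) 𝔈) 𝔏 (sectEStYOfRecordV7 N θ.toStage3Params Mstar 𝔢₀) 𝔴) x).Gp) := t37E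
  have hst : ∀ x, StaticOK (𝔬 x) p.ρ p.Nc p.N' p.Cℓ (κ x) := fun x => staticOK_opsWalkYO x (trBasis N) (𝔅 x) (fun U => U) (parKnitY x.toKIdx) (bI x) (O x) (hβ1 x) (hlev x) (hMw x) hM3 hρ3 hNc hN' hCℓ
  have hκ : ∀ x, (κ x).Bounded p.Kc p.θ₀ p.Cℓ (geo9Y x).M := fun x => bounded_kappaWalkY x (trBasis N) (le_trans (by positivity) hCℓ) hKc hθ₀
  have hfacO := factorsL2Mixed37Dir_of_legs θ.d₆ θ.ℓ₆ θ.hd' θ.hL' θ.b₀ θ.b₁ Mstar hδM c H 𝔬 𝔡 𝔩 p hp pM hpM.2.1 κ hst hκ (fun x hM α₀ hα ha U hU => identities₂_opsWalkYO_of_reg335R_laws x (bI x) hGR (parKnitY x.toKIdx) (O x) 1 (H x) (hβ1 x) (hlev x) hU (hlawK x α₀ hα (hthrp x α₀ ha) U hU).1 (hlawK x α₀ hα (hthrp x α₀ ha) U hU).2 (hOloc x hM α₀ hα ha U hU) (hOlocT x hM α₀ hα ha U hU)) (fun x hM α₀ hα ha U hU => (h36H x hM α₀ hα ha U hU).2.2.1.2.1)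 (fun x hM α₀ hα ha U hU => (h36H x hM α₀ hα ha U hU).2.2.1.2.2) hMixO hOneO hM1L hδ1L hθ1L
  have hrd : ∀ x : MemberY θ.d₆ θ.ℓ₆ θ.hd' θ.hL' θ.b₀ θ.b₁ Mstar, (rd x).OKRel (𝔬 x).blk (RelB x.toKIdx) := fun x => ⟨(off_bound_evSK (κ := TrIdx N) x.toKIdx (sIK_faithful x.toKIdx (hβI x))).1, (off_bound_evSK (κ := TrIdx N) x.toKIdx (sIK_faithful x.toKIdx (hβI x))).2, fun lam => geo9K_supNorm_nonneg x.toKIdx lam⟩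
  have hGsqAS : ∀ (x : MemberY θ.d₆ θ.ℓ₆ θ.hd' θ.hL' θ.b₀ θ.b₁ Mstar) (U : (𝔅 x).Cfg) (j : ιA x), ∃ (r : ℝ) (G : (FBondY x.toKIdx → Matrix (Fin N) (Fin N) ℂ) →ₗ[ℝ] (FBondY x.toKIdx → Matrix (Fin N) (Fin N) ℂ)), (𝔬A x).Gsq U j = r • coordOpK (trBasis N) (fun _ : Fin (θ.d₆ + 1) => G) := fun x U j => ⟨_, _, hGsqOA x U j⟩
  have hβ1B : ∀ (x : MemberY θ.d₆ θ.ℓ₆ θ.hd' θ.hL' θ.b₀ θ.b₁ Mstar) (f' : FBondY x.toKIdx), (geoBY x).dist (β x.toKIdx.hN x.toKIdx.D x.toKIdx.hk (bI x f')) (blkV1 x.toKIdx.hN x.toKIdx.D f') ≤ 1 := by rw [hbI]; exact fun x f' => OpsYBlockPinOfRecordB.dist_beta_bIYOfRecord_blkV1_le_one θ.toStage3Params Mstar x f'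
  have hlenB : ∀ (x : MemberY θ.d₆ θ.ℓ₆ θ.hd' θ.hL' θ.b₀ θ.b₁ Mstar) (f' : FBondY x.toKIdx), (geo9Y x).len (bI x f') = (geoBY x).len (blkV1 x.toKIdx.hN x.toKIdx.D f') := by rw [hbI]; exact fun x f' => OpsYBlockPinOfRecordB.len_bIYOfRecord_eq_len_blkV1 θ.toStage3Params Mstar x f'
  have h36A : ∀ x, q.M₁ ≤ (geo9Y x).M → ∀ α₀ : ℝ, 0 < α₀ → c * (geo9Y x).M * α₀ ≤ q.a₁ → ∀ U : (bg9YR (Matrix (Fin N) (Fin N) ℂ) (specialUnitaryUnits (Fin N)) R₁ R₂ x).Cfg, (bg9YR (Matrix (Fin N) (Fin N) ℂ) (specialUnitaryUnits (Fin N)) R₁ R₂ x).Reg335 c α₀ U → Local342G (𝔬A x) 1 (H x) q.B₀ q.δ₀ U ∧ B9Thm310Whole.Factors389 (𝔬A x) 1 (H x) q.θ₀ q.δ₀ U ∧ Identities310₂ (𝔬A x) (𝔡A x) (𝔩A x) 1 (H x) U := fun x hM α₀ hα ha U hU =>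
    ⟨local342G_mono_const (fun a => (B9GeoLemma21KLevelV1.geo9Y_len_pos x a).le) (local342G_of_blocks_idxPins x (trBasis N) (𝔅 x) (fun U => U) (bI x) (OcA x) (𝔬A x) (hblkA x) (hblkYA x) (hGsqOA x U) (hDcoA x U) (hDscoA x U) (hLcoA x U) (hβ1B x) (hlenB x) (hnbrBY_real_of_le hM₀N x)
      (fun j => (OcA x j U).restrictScalars ℝ) (fun _ _ => rfl) (fun ν => B9CoReadingCoords.cdBₗ x.toKIdx U ν) (fun ν => B9CoReadingCoords.cdsBₗ x.toKIdx U ν) (fun _ _ => rfl) (fun _ _ => rfl) (B9CoReadingCoords.lapBₗ x.toKIdx U) (fun Λ => B9CoReadingCoords.lapBₗ_apply x.toKIdx U Λ) hBcA hq.δ₀_pos.le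
      (h36Ab x hM α₀ hα ha U hU).1 (h36Ab x hM α₀ hα ha U hU).2.1 (h36Ab x hM α₀ hα ha U hU).2.2.1 (h36Ab x hM α₀ hα ha U hU).2.2.2) hB₀geA, h36A' x hM α₀ hα ha U hU⟩
  have hβ1K : ∀ (x : MemberY θ.d₆ θ.ℓ₆ θ.hd' θ.hL' θ.b₀ θ.b₁ Mstar) (p' : XSK (TrIdx N) x.toKIdx), (geoBY x).dist (β x.toKIdx.hN x.toKIdx.D x.toKIdx.hk (blkSK x.toKIdx (sIK x.toKIdx (bI x)) p')) (blkOfSK (TrIdx N) x.toKIdx p') ≤ 1 := by rw [hbI]; exact fun x p' => dist_beta_blkSK_sIK_bIYOfRecord_le_one θ.toStage3Params Mstar x p'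
  have hlenK : ∀ (x : MemberY θ.d₆ θ.ℓ₆ θ.hd' θ.hL' θ.b₀ θ.b₁ Mstar) (p' : XSK (TrIdx N) x.toKIdx), (geo9Y x).len (blkSK x.toKIdx (sIK x.toKIdx (bI x)) p') = (geoBY x).len (blkOfSK (TrIdx N) x.toKIdx p') := by rw [hbI]; exact fun x p' => len_blkSK_sIK_bIYOfRecord_eq θ.toStage3Params Mstar x p'
  have h36 : ∀ x, p.M₁ ≤ (geo9Y x).M → ∀ α₀ : ℝ, 0 < α₀ → c * (geo9Y x).M * α₀ ≤ p.a₁ → ∀ U : (𝔅 x).Cfg, (𝔅 x).Reg335 c α₀ U → Local342 (𝔬 x) 1 (H x) p.B₀ p.δ₀ U := fun x hM α₀ hα ha U hU =>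
    local342_mono_const (fun a => (B9GeoLemma21KLevelV1.geo9Y_len_pos x a).le) (local342_opsWalkYO_of_blocks x (trBasis N) (𝔅 x) (fun U => U) (parKnitY x.toKIdx) (bI x) (O x) (hβ1K x) (hlenK x) (hnbrBY_real_of_le hM₀N x) rfl rfl
      (fun c' => ((etaS x.toKIdx ^ 2) • (O x c' U).restrictScalars ℝ)) (((etaS x.toKIdx ^ 2)⁻¹) • (lapSL x.toKIdx U).restrictScalars ℝ) (fun _ _ => rfl) (fun _ => rfl) hBc hp.δ₀_pos.le
      (h36b x hM α₀ hα ha U hU).1 (h36b x hM α₀ hα ha U hU).2.1 (h36b x hM α₀ hα ha U hU).2.2.1 (h36b x hM α₀ hα ha U hU).2.2.2) hB₀ge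
  have h36 : ∀ x, p.M₁ ≤ (geo9Y x).M → ∀ α₀ : ℝ, 0 < α₀ → c * (geo9Y x).M * α₀ ≤ p.a₁ → ∀ U : (𝔅 x).Cfg, (𝔅 x).Reg335 c α₀ U → Local342 (𝔬 x) 1 (H x) p.B₀ p.δ₀ U ∧ Identities₂ (𝔬 x) (𝔡 x) (𝔩 x) 1 (H x) U := fun x hM α₀ hα ha U hU => ⟨h36 x hM α₀ hα ha U hU, identities₂_opsWalkYO_of_reg335R_laws x (bI x) hGR (parKnitY x.toKIdx) (O x) 1 (H x) (hβ1 x) (hlev x) hU (hlawK x α₀ hα (hthrp x α₀ ha) U hU).1 (hlawK x α₀ hα (hthrp x α₀ ha) U hU).2 (hOloc x hM α₀ hα ha U hU) (hOlocT x hM α₀ hα ha U hU)⟩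
  have hY335 : ∀ (x : MemberY θ.d₆ θ.ℓ₆ θ.hd' θ.hL' θ.b₀ θ.b₁ Mstar) (α₀ : ℝ) (U : (𝔅 x).Cfg), (𝔅 x).Reg335 c α₀ U → (bg9Y (Matrix (Fin N) (Fin N) ℂ) (specialUnitaryUnits (Fin N)) x).Reg335 c α₀ U := fun x α₀ U hU => regY335_of_regYP335 x c35Y_le_ten (hRP1 x α₀ U hU).1 (hRP1 x α₀ U hU).2 ((ten_L3_le_c35B θ.ℓ₆).trans hcB)
  have hαFδ : 0 ≤ q.αF * ((1 - 2 * q.α) * q.δ₀) := mul_nonneg hq.αF_pos.le (mul_nonneg (by linarith only [hq.α_lt]) hq.δ₀_pos.le); have hρS : 0 ≤ ρS := (by linarith only [hσS.le, hσSK, hδKS, hαFδ]); have hδB : 0 ≤ δB := (by linarith only [hrTB, hδTr, hδT12, hσS.le, hαFδ]); have htJ0 : 0 ≤ tJ := le_trans (by positivity) htJ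
  have hBJ := fun (x : MemberY θ.d₆ θ.ℓ₆ θ.hd' θ.hL' θ.b₀ θ.b₁ Mstar) (hM : M12 ≤ (geo9Y x).M) (α₀ : ℝ) (hα : 0 < α₀) (ha : (geo9Y x).M * α₀ ≤ a12) (U : (𝔅 x).Cfg) (hU : (𝔅 x).Reg335 c α₀ U) (hU' : (𝔅 x).Reg336 c α₀ U) => hBJ_of_pins_P (N := N) H c35Y c35Y_le_ten (fun x => ops312RY (𝔬12 x)) bI hbI0 hβ1 hblk12 hblkW12 tJ δB M12 a12 ha1J hδB htJ x hM α₀ hα ha U (hRP1 x α₀ U hU).2 (hRP2 x α₀ U hU').2; have hac : 0 < q.a₁ / c := div_pos hq.a₁_pos hc; have hac : 0 < q.a₁ / c := div_pos hq.a₁_pos hc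
  have hΔA : ∀ x : MemberY θ.d₆ θ.ℓ₆ θ.hd' θ.hL' θ.b₀ θ.b₁ Mstar, MR ≤ (geo9Y x).M → ∀ α₀ : ℝ, 0 < α₀ → (geo9Y x).M * α₀ ≤ q.a₁ / c → ∀ U : (𝔅 x).Cfg, (𝔅 x).Reg335 c α₀ U → PosDefTr (fun _ => (1 : ℝ)) (deltaAQY x.toKIdx (qKnitOfRecord N θ.toStage3Params x.toKIdx) (qsKnitOfRecord N θ.toStage3Params x.toKIdx) (parKnitY x.toKIdx) (GpY x.toKIdx (parKnitY x.toKIdx)) U) := fun x hM α₀ hα ha U hU => (hΔAK x hM α₀ hα ha U hU).2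
  letI hF : ∀ x : MemberY θ.d₆ θ.ℓ₆ θ.hd' θ.hL' θ.b₀ θ.b₁ Mstar, Fintype (B9GeoNormsKLevelV1.geo9K x.toKIdx).Site := fun x => (inferInstance : Fintype (geo9Y x).Site)
  have hsymD : ∀ (x : MemberY θ.d₆ θ.ℓ₆ θ.hd' θ.hL' θ.b₀ θ.b₁ Mstar) (U : (𝔅 x).Cfg), (∀ μ z, U μ z ∈ specialUnitaryUnits (Fin N)) → IsSymmTr (fun _ => (1 : ℝ)) ((𝔏 x).GD U) ∧ IsSymmTr (fun _ => (1 : ℝ)) ((𝔏 x).G₁ U) ∧ IsSymmTr (fun _ => (1 : ℝ)) ((𝔏 x).GG U) := hsymDK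
  have hHCN : ∀ (x : MemberY θ.d₆ θ.ℓ₆ θ.hd' θ.hL' θ.b₀ θ.b₁ Mstar) (U : (𝔅 x).Cfg), CoReadsHHolderNbr (hKernelR R₁ R₂ ((opsYSectESt N θ.toStage3Params Mstar (opsYS349NuOfLettersH N θ.toStage3Params Mstar 𝔏 (fun x => parSymY x.toKIdx) 𝔈) 𝔏 (sectEStYOfRecordV7 N θ.toStage3Params Mstar 𝔢₀) 𝔴) x).H) U (θ.d₆ + 1) (𝔭A x) 2 (𝔬12 x).blkZ ((𝔬12 x).D U ∘ₗ (𝔬12 x).Hm U) ∧ CoReadsHHolderNbr (hKernelR R₁ R₂ ((opsYSectESt N θ.toStage3Params Mstar (opsYS349NuOfLettersH N θ.toStage3Params Mstar 𝔏 (fun x => parSymY x.toKIdx) 𝔈) 𝔏 (sectEStYOfRecordV7 N θ.toStage3Params Mstar 𝔢₀) 𝔴) x).H₁) U (θ.d₆ + 1) (𝔭A x) 2 (𝔬12 x).blkZ ((𝔬12 x).D U ∘ₗ (𝔬12 x).H1m U) := fun x U =>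
    ⟨bond_coReadsHHolderNbr_of_pinsA x.toKIdx (trBasis N) (𝔅 x) (fun U => U) (𝔏 x).H (𝔏 x).parB U (hβ1 x) (h𝔭A x) (hblkZ12 x) (hHm12 x U) (hDco12 x U),
      bond_coReadsHHolderNbr_of_pinsA x.toKIdx (trBasis N) (𝔅 x) (fun U => U) (𝔏 x).H₁ (𝔏 x).parB U (hβ1 x) (h𝔭A x) (hblkZ12 x) (hH1m12 x U) (hDco12 x U)⟩
  have hIF : ∀ (x : MemberY θ.d₆ θ.ℓ₆ θ.hd' θ.hL' θ.b₀ θ.b₁ Mstar) (U : (𝔅 x).Cfg), InputReadsFam (kernelFamilyR R₁ R₂ ((opsYSectESt N θ.toStage3Params Mstar (opsYS349NuOfLettersH N θ.toStage3Params Mstar 𝔏 (fun x => parSymY x.toKIdx) 𝔈) 𝔏 (sectEStYOfRecordV7 N θ.toStage3Params Mstar 𝔢₀) 𝔴) x).GD) U (bHXA x) 2 ((𝔬12 x).blk ∘ Prod.fst) ((𝔭A x).blkPX ∘ Prod.fst) (fun β => sliceProbe ((𝔭A x).ΦX U β)) (evBK x.toKIdx) (familyOp fun q : Fin (θ.d₆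 + 1) × Fin (θ.d₆ + 1) => (𝔡A x).Dd U q.1 ∘ₗ ((𝔬12 x).G U ∘ₗ (𝔡A x).Dsd U q.2)) ∧
      InputReadsFam (kernelFamilyR R₁ R₂ ((opsYSectESt N θ.toStage3Params Mstar (opsYS349NuOfLettersH N θ.toStage3Params Mstar 𝔏 (fun x => parSymY x.toKIdx) 𝔈) 𝔏 (sectEStYOfRecordV7 N θ.toStage3Params Mstar 𝔢₀) 𝔴) x).G₁) U (bHXA x) 2 ((𝔬12 x).blk ∘ Prod.fst) ((𝔭A x).blkPX ∘ Prod.fst) (fun β => sliceProbe ((𝔭A x).ΦX U β)) (evBK x.toKIdx) (familyOp fun q : Fin (θ.d₆ + 1) × Fin (θ.d₆ + 1) => (𝔡A x).Dd U q.1 ∘ₗ ((𝔬12 x).G1 U ∘ₗ (𝔡A x).Dsd U q.2)) ∧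
      InputReadsFam (kernelFamilyR R₁ R₂ ((opsYSectESt N θ.toStage3Params Mstar (opsYS349NuOfLettersH N θ.toStage3Params Mstar 𝔏 (fun x => parSymY x.toKIdx) 𝔈) 𝔏 (sectEStYOfRecordV7 N θ.toStage3Params Mstar 𝔢₀) 𝔴) x).GG) U (bHXA x) 2 ((𝔬12 x).blk ∘ Prod.fst) ((𝔭A x).blkPX ∘ Prod.fst) (fun β => sliceProbe ((𝔭A x).ΦX U β)) (evBK x.toKIdx) (familyOp fun q : Fin (θ.d₆ + 1) × Fin (θ.d₆ + 1) => (𝔡A x).Dd U q.1 ∘ₗ ((𝔬12 x).GG U ∘ₗ (𝔡A x).Dsd U q.2)) := fun x U =>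
    ⟨bond_inputReadsFam_of_pinsA x.toKIdx (trBasis N) (𝔅 x) (fun U => U) (𝔏 x).GD (𝔏 x).parB U (hβI x) (hβ1 x) (h𝔭A x) (hbHXA x) (hblk12 x) (hGco12 x U) (h𝔡Ad x U) (h𝔡As x U),
      bond_inputReadsFam_of_pinsA x.toKIdx (trBasis N) (𝔅 x) (fun U => U) (𝔏 x).G₁ (𝔏 x).parB U (hβI x) (hβ1 x) (h𝔭A x) (hbHXA x) (hblk12 x) (hG1co12 x U) (h𝔡Ad x U) (h𝔡As x U),
      bond_inputReadsFam_of_pinsA x.toKIdx (trBasis N) (𝔅 x) (fun U => U) (𝔏 x).GG (𝔏 x).parB U (hβI x) (hβ1 x) (h𝔭A x) (hbHXA x) (hblk12 x) (hGGco12 x U) (h𝔡Ad x U) (h𝔡As x U)⟩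
  have hH1N : ∀ (x : MemberY θ.d₆ θ.ℓ₆ θ.hd' θ.hL' θ.b₀ θ.b₁ Mstar) (U : (𝔅 x).Cfg), H1ReadsNbr (kernelFamilyR R₁ R₂ ((opsYSectESt N θ.toStage3Params Mstar (opsYS349NuOfLettersH N θ.toStage3Params Mstar 𝔏 (fun x => parSymY x.toKIdx) 𝔈) 𝔏 (sectEStYOfRecordV7 N θ.toStage3Params Mstar 𝔢₀) 𝔴) x).GD) U (𝔭A x) (RelB x.toKIdx) 2 (𝔬12 x).blk (𝔬12 x).blkY (evBK x.toKIdx) (evBK x.toKIdx) ((𝔬12 x).D U ∘ₗ (𝔬12 x).G U) ((𝔬12 x).G U ∘ₗ (𝔬12 x).Dstar U) ∧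
      H1ReadsNbr (kernelFamilyR R₁ R₂ ((opsYSectESt N θ.toStage3Params Mstar (opsYS349NuOfLettersH N θ.toStage3Params Mstar 𝔏 (fun x => parSymY x.toKIdx) 𝔈) 𝔏 (sectEStYOfRecordV7 N θ.toStage3Params Mstar 𝔢₀) 𝔴) x).G₁) U (𝔭A x) (RelB x.toKIdx) 2 (𝔬12 x).blk (𝔬12 x).blkY (evBK x.toKIdx) (evBK x.toKIdx) ((𝔬12 x).D U ∘ₗ (𝔬12 x).G1 U) ((𝔬12 x).G1 U ∘ₗ (𝔬12 x).Dstar U) ∧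
      H1ReadsNbr (kernelFamilyR R₁ R₂ ((opsYSectESt N θ.toStage3Params Mstar (opsYS349NuOfLettersH N θ.toStage3Params Mstar 𝔏 (fun x => parSymY x.toKIdx) 𝔈) 𝔏 (sectEStYOfRecordV7 N θ.toStage3Params Mstar 𝔢₀) 𝔴) x).GG) U (𝔭A x) (RelB x.toKIdx) 2 (𝔬12 x).blk (𝔬12 x).blkY (evBK x.toKIdx) (evBK x.toKIdx) ((𝔬12 x).D U ∘ₗ (𝔬12 x).GG U) ((𝔬12 x).GG U ∘ₗ (𝔬12 x).Dstar U) := fun x U => by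
    rw [h𝔭A x]; exact ⟨bond_h1ReadsNbr_of_pinsA x.toKIdx (trBasis N) (𝔅 x) (fun U => U) (𝔏 x).GD (𝔏 x).parB U (hβI x) (hβ1 x) (hblk12 x) (hblkY12 x) (hGco12 x U) (hDco12 x U) (hDsco12 x U),
      bond_h1ReadsNbr_of_pinsA x.toKIdx (trBasis N) (𝔅 x) (fun U => U) (𝔏 x).G₁ (𝔏 x).parB U (hβI x) (hβ1 x) (hblk12 x) (hblkY12 x) (hG1co12 x U) (hDco12 x U) (hDsco12 x U),
      bond_h1ReadsNbr_of_pinsA x.toKIdx (trBasis N) (𝔅 x) (fun U => U) (𝔏 x).GG (𝔏 x).parB U (hβI x) (hβ1 x) (hblk12 x) (hblkY12 x) (hGGco12 x U) (hDco12 x U) (hDsco12 x U)⟩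
  have hLS := fun (x : MemberY θ.d₆ θ.ℓ₆ θ.hd' θ.hL' θ.b₀ θ.b₁ Mstar) (U : (𝔅 x).Cfg) => site_l2ReadsNbr012_of_pins x.toKIdx (trBasis N) (𝔅 x) (fun U => U) (𝔏 x).Gp (parSymY x.toKIdx) U (R := (1 : ℝ)) (H := H x) (sIK_faithful x.toKIdx (hβI x)) (sIK_dist_le_one x.toKIdx (hβ1 x)) (hblkS x) (hblkYS x) (hGpS x U) (hDS x U) (hDsS x U); have hl0 := fun x U => (hLS x U).1
  have hsymA : ∀ x : MemberY θ.d₆ θ.ℓ₆ θ.hd' θ.hL' θ.b₀ θ.b₁ Mstar, q.M₁ ≤ (geo9Y x).M → ∀ α₀ : ℝ, 0 < α₀ → c * (geo9Y x).M * α₀ ≤ q.a₁ → ∀ U : (𝔅 x).Cfg, (𝔅 x).Reg335 c α₀ U → IsTransposePair ((𝔬A x).G U) ((𝔬A x).G U) := fun x _ α₀ hα ha U hU => by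
    rw [hGcoA x U]; exact isTransposePair_GcoK_trBasis x.toKIdx (𝔅 x) (fun U => U) (𝔏 x).GA U (hsymGA x α₀ hα (hthrq x α₀ ha) U hU)
  have htrA : ∀ x : MemberY θ.d₆ θ.ℓ₆ θ.hd' θ.hL' θ.b₀ θ.b₁ Mstar, q.M₁ ≤ (geo9Y x).M → ∀ α₀ : ℝ, 0 < α₀ → c * (geo9Y x).M * α₀ ≤ q.a₁ → ∀ U : (𝔅 x).Cfg, (𝔅 x).Reg335 c α₀ U → IsTransposePair ((𝔬A x).D U ∘ₗ (𝔬A x).G U) ((𝔬A x).G U ∘ₗ (𝔬A x).Dstar U) := fun x _ α₀ hα ha U hU => by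
    rw [hDcoA x U, hGcoA x U, hDscoA x U]; exact isTransposePair_DcoK_GcoK_trBasis x.toKIdx (𝔅 x) (fun U => U) (𝔏 x).GA U (hsymGA x α₀ hα (hthrq x α₀ ha) U hU) (fun μ z => specialUnitaryUnits_le_unitaryUnits ((mem_of_reg335R hGR x hU) μ z))
  have hgeoOK : ∀ x : MemberY θ.d₆ θ.ℓ₆ θ.hd' θ.hL' θ.b₀ θ.b₁ Mstar, GeoOK (geo9Y x) := fun x => ⟨geo9Y_dist_triangle x, geo9Y_dist_comm x, geo9K_dist_nonneg x.toKIdx, geo9Y_len_pos x⟩; have hN : 0 < N := Nat.pos_of_ne_zero (NeZero.ne N); have hcR : cR39 (trBasis N) ≠ 0 := (cR39_trBasis_pos hN).ne'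
  have hpos12 : ∀ x : MemberY θ.d₆ θ.ℓ₆ θ.hd' θ.hL' θ.b₀ θ.b₁ Mstar, max M12 MR ≤ (geo9Y x).M → ∀ α₀ : ℝ, 0 < α₀ → (geo9Y x).M * α₀ ≤ min a12 (q.a₁ / c) → ∀ U : (𝔅 x).Cfg, (𝔅 x).Reg335 c α₀ U →
      (𝔅 x).Reg336 c α₀ U → PosDefEnd ((𝔬12 x).S0 U) := fun x hM α₀ hα ha U hU _ => by
    rw [hS0co12 x U]; exact N06SectDUnitsAtPinsPhysQ.posDefEnd_S0coKq_of_posDefTr x.toKIdx U (qKnitOfRecord N θ.toStage3Params x.toKIdx) (qsKnitOfRecord N θ.toStage3Params x.toKIdx) (parKnitY x.toKIdx) (GpPhysY x.toKIdx (parKnitY x.toKIdx)) hN (by rw [Node00.deltaAQY_GpPhysY_eq]; exact hΔA x ((le_max_right _ _).trans hM) α₀ hα (ha.trans (min_le_right _ _)) U hU)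
  have hinv12 : ∀ x : MemberY θ.d₆ θ.ℓ₆ θ.hd' θ.hL' θ.b₀ θ.b₁ Mstar, max M12 MR ≤ (geo9Y x).M → ∀ α₀ : ℝ, 0 < α₀ → (geo9Y x).M * α₀ ≤ min a12 (q.a₁ / c) → ∀ U : (𝔅 x).Cfg, (𝔅 x).Reg335 c α₀ U →
      (𝔅 x).Reg336 c α₀ U → (𝔬12 x).G0 U * (𝔬12 x).S0 U = 1 := fun x hM α₀ hα ha U hU _ => by
    rw [hG0co12 x U, hS0co12 x U, h𝔏GA x, ← Node00.GAQY_GpPhysY x.toKIdx (qKnitOfRecord N θ.toStage3Params x.toKIdx) (qsKnitOfRecord N θ.toStage3Params x.toKIdx) (parKnitY x.toKIdx)]; exact Node00.OpsYSectDCoordsQ.GcoK_GAQY_mul_S0coKq (𝔸 := Matrix (Fin N) (Fin N) ℂ) (κ := TrIdx N) (i := x.toKIdx) (b := trBasis N) (B := (bg9YR (Matrix (Fin N) (Fin N) ℂ) (specialUnitaryUnits (Fin N)) R₁ R₂ x)) (cfg := fun U => U) (𝔮 := (qKnitOfRecord N θ.toStage3Params x.toKIdx)) (𝔮s := (qsKnitOfRecord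 N θ.toStage3Params x.toKIdx)) (parS := (parKnitY x.toKIdx)) (Gp := (GpPhysY x.toKIdx (parKnitY x.toKIdx))) (U₁ := U) hcR (N06SectDUnitsAtPinsPhysQ.isUnit_deltaAQY_phys_of_posDefTr _ (qKnitOfRecord N θ.toStage3Params x.toKIdx) (qsKnitOfRecord N θ.toStage3Params x.toKIdx) (parKnitY x.toKIdx) (hΔA x ((le_max_right _ _).trans hM) α₀ hα (ha.trans (min_le_right _ _)) U hU))
  have hIdOfForm : ∀ x : MemberY θ.d₆ θ.ℓ₆ θ.hd' θ.hL' θ.b₀ θ.b₁ Mstar, max M12 MR ≤ (geo9Y x).M → ∀ α₀ : ℝ, 0 < α₀ → (geo9Y x).M * α₀ ≤ min a12 (q.a₁ / c) → ∀ U : (𝔅 x).Cfg, (𝔅 x).Reg335 c α₀ U →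
      (𝔅 x).Reg336 c α₀ U → ∀ r : ℝ, r < 1 → FormSmall (𝔬12 x) r U → B9Thm312Whole.Identities (𝔬12 x) U := fun x hMx α₀ hα hax U hU hU' r hr hF =>
    have hU1 := N06SectDUnitsAtPinsPhysQ.isUnit_deltaOneQY_of_formSmall x.toKIdx (𝔅 x) (fun U => U) (qKnitOfRecord N θ.toStage3Params x.toKIdx) (qsKnitOfRecord N θ.toStage3Params x.toKIdx) (parKnitY x.toKIdx) (𝔯 x).Δ2 (𝔬12 x) U hN hF hr (hS0co12 x U) (hTpico12 x U) (hT2co12 x U)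
    identities_of_def_3124 (N06SectDIdentitiesAtPinsPhysQ.identitiesDef_of_pins_physQ x.toKIdx (𝔅 x) (fun U => U) (qKnitOfRecord N θ.toStage3Params x.toKIdx) (qsKnitOfRecord N θ.toStage3Params x.toKIdx) (parKnitY x.toKIdx) (𝔯 x).Δ2 (𝔬12 x) U hN
      specialUnitaryUnits_le_unitaryUnits (mem_of_reg335R hGR x hU) (Node00.isAdjTr_qKnitOfRecord x.toKIdx U) (by rw [Node00.RY_GpPhysY]; exact hsymRT x ((le_max_left _ _).trans hMx) α₀ hα (hax.trans (min_le_left _ _)) U hU) (isUnit_of_posDefTr (hΔA x ((le_max_right _ _).trans hMx) α₀ hα (hax.trans (min_le_right _ _)) U hU))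
      (N06SectDUnitsAtPinsPhysQ.isUnit_deltaPiAQY_of_formSmall x.toKIdx (𝔅 x) (fun U => U) (qKnitOfRecord N θ.toStage3Params x.toKIdx) (qsKnitOfRecord N θ.toStage3Params x.toKIdx) (parKnitY x.toKIdx) (𝔬12 x) U hN hF hr (hS0co12 x U) (hTpico12 x U)) hU1
      (hUQG1K x ((le_max_left _ _).trans hMx) α₀ hα (hax.trans (min_le_left _ _)) U hU hU' (N06SectDUnitsAtPinsPhysQ.posDefTr_deltaOneQY_of_formSmall_pins x.toKIdx (𝔅 x) (fun U => U) (qKnitOfRecord N θ.toStage3Params x.toKIdx) (qsKnitOfRecord N θ.toStage3Params x.toKIdx) (parKnitY x.toKIdx) (𝔯 x).Δ2 (𝔬12 x) U hN hF hr (hS0co12 x U) (hTpico12 x U) (hT2co12 x U)))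
      (by rw [← h𝔏GA x]; exact hG0co12 x U) (hS0co12 x U) (hTpico12 x U) (hT2co12 x U) (by rw [← h𝔏GD x]; exact hGco12 x U) (by rw [← h𝔏G1 x]; exact hG1co12 x U) (by rw [← h𝔏GG x]; exact hGGco12 x U) (hQco12 x U) (hQsco12 x U) (hCco12 x U) (hC1co12 x U)
      (by rw [← h𝔏H x]; exact hHm12 x U) (by rw [← h𝔏H1 x]; exact hH1m12 x U) (hDvco12 x U) (hDvsco12 x U) (hRco12 x U)) (hidsK x ((le_max_left _ _).trans hMx) α₀ hα (hax.trans (min_le_left _ _)) U hU hU' hU1).1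
  have hfac := h36H_of_mixedFactorR (P₄ := fun x U => (∀ q' μ, IsTransposePair ((𝔩 x).Pt U q' μ) ((𝔩 x).P U q' μ)) ∧ (∀ q', IsTransposePair ((𝔬 x).Ct U q') ((𝔬 x).Cop U q'))) (P₈ := fun x U => FactorsL2Mixed37Dir (𝔬 x) (𝔡 x) (𝔩 x) 1 (H x) pM.θM p.δ₀ U) h36H hfacO; have hmix : ∀ x, p.M₁ ≤ (geo9Y x).M → ∀ α₀ : ℝ, 0 < α₀ → c * (geo9Y x).M * α₀ ≤ p.a₁ → ∀ U : (𝔅 x).Cfg, (𝔅 x).Reg335 c α₀ U → L2MixedLegs37 (𝔬 x) (𝔡 x) 1 (H x) (SblkY x (bI x)) pM.BM p.δ₀ U := hmixO; have h36H' := h36H_of_dir_pins₃SN_of_transpose (R := (1 : ℝ)) (H := H) 𝔬 𝔡 𝔭 (fun x => (𝔏 x).Gp) (fun x => (parSymY x.toKIdx)) h𝔭 hblkS hblkYS hGpS hDS hDsS h𝔡d h𝔡s hY335 hGsqT (fun x hM α₀ hα ha U hU => by obtain ⟨h₁, h₂, h₃₄, h₅₆, h₈⟩ := hfac x hM α₀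 hα ha U hU; exact ⟨h₁, h₂, h₃₄, h₅₆, hmix x hM α₀ hα ha U hU, h₈⟩); have h36HA' := h36HA_of_dir_pinsR (R := (1 : ℝ)) (H := H) 𝔬A 𝔡A 𝔭A (fun x => (𝔏 x).GA) (fun x => (𝔏 x).parB) h𝔭A hblkA hblkYA hGcoA hDcoA hDscoA h𝔡Ad h𝔡As hY335 h36HA; have h36A4 := h36A_of_dirSq_pinsR (R := (1 : ℝ)) (H := H) 𝔬A 𝔡A hblkA hblkYA hDcoA hDscoA h𝔡Ad h𝔡As hGsqAS h36A
  obtain ⟨M31, a31, hM31, ha31, h31⟩ := thm31GpMaj_of_t37_pairMR (trBasis N) 𝔏 𝔬 rd H hp t37' hbI0 hblkS hblkYS hGpS hDS hDsS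
  have hδ39 : 0 < δ39 := hr39.trans_le hrδ39; have hθ49 : 0 < min ((1 - 2 * p.α) * p.δ₀) δ39 / 8 := (by have := lt_min (PinPrims.rate_pos hp) hδ39; positivity); have hrT0 : rT ≤ (1 - 2 * p.α) * p.δ₀ := hrTP.trans (by have h1 := min_le_left ((1 - 2 * p.α) * p.δ₀) δ39; linarith only [h1, hθ49])
  obtain ⟨M49, a49, hM49, ha49, h49⟩ := N06Proj349AtPinsPhysRCPar.proj349Maj_of_t37_display348_rateR_ge_par θ.toStage3Params Mstar hGR 𝔏 (fun x : MemberY θ.d₆ θ.ℓ₆ θ.hd' θ.hL' θ.b₀ θ.b₁ Mstar => parKnitY x.toKIdx) (fun x : MemberY θ.d₆ θ.ℓ₆ θ.hd' θ.hL' θ.b₀ θ.b₁ Mstar => parKnitY x.toKIdx) h𝔏P h𝔏Gp (trBasis N) (cR39_trBasis_pos hN) hc (aK := aK) (MK := 1) (lt_of_lt_of_le (div_pos hp.a₁_pos hc) hpaK) (fun x hM α₀ hα ha U hU => ⟨(hlawK x α₀ hα ha U hU).1, symm0_parKnitY x.toKIdx le_rfl (fun μ z => specialUnitaryUnits_le_unitaryUnits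 (mem_of_reg335R hGR x hU μ z)) (hlawK x α₀ hα ha U hU).1⟩) hbI0 hlev hβ1 (hnbr_two_of_le hM₀) 𝔬 rd H hp t37' hblkS hblkYS hGpS hDS hB39.le hδ39 ha39 h348 (min ((1 - 2 * p.α) * p.δ₀) δ39 / 8) (cg349 θ.d₆ θ.ℓ₆ θ.hd' θ.hL' θ.b₀ θ.b₁ ((1 - 2 * p.α) * p.δ₀) δ39) (thrM349 θ.d₆ θ.ℓ₆ θ.hd' θ.hL' θ.b₀ θ.b₁ ((1 - 2 * p.α) * p.δ₀) δ39) hθ49.le (cg349_pos _ _).le (fun i hM parS Gp U B₀ B₁' hB₀ hB₁' => fineEntryS_le_named (PinPrims.rate_pos hp) hδ39 i hM parS Gp U hB₀ hB₁') CP hCPge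
  simp only [h𝔏Gp, h𝔏P] at h31 h49
  have hCP : 0 ≤ CP := (cP349_nonneg θ.toStage3Params Mstar (trBasis N) (nbrCountY θ.d₆ θ.ℓ₆ θ.hd' θ.hL' θ.b₀ θ.b₁ 2) hp hB39.le δ39 (min ((1 - 2 * p.α) * p.δ₀) δ39 / 8) (cg349_pos _ _).le).trans hCPge
  have hδTr2 : δT12 + 2 * σS + 3 * (q.αF * ((1 - 2 * q.α) * q.δ₀)) ≤ rT := (by linarith only [hδTr, hσS]); have hM46K : 0 < M46K := hM46K; have ha46K : 0 < a46K := ha46K; have hB₄ : 0 ≤ B46K := hB46K.le; have h46 : ∀ x : MemberY θ.d₆ θ.ℓ₆ θ.hd' θ.hL' θ.b₀ θ.b₁ Mstar, max M12 M46K ≤ (geo9Y x).M → ∀ α₀ : ℝ, 0 < α₀ → (geo9Y x).M * α₀ ≤ min a12 a46K → ∀ U : (𝔅 x).Cfg, (𝔅 x).Reg335 c α₀ U → B9SectDL2Decay.BlockBd (g := toB6 (geo9Y x) 1 (H x)) (𝔬12 x).blk (𝔬12 x).blk (DvcoKH x.toKIdx (trBasis N) (𝔅 x) (fun U => U) U ∘ₗ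 GcoS x.toKIdx (trBasis N) (𝔅 x) (fun U => U) (GpY x.toKIdx (parKnitY x.toKIdx)) U ∘ₗ DvscoKH x.toKIdx (trBasis N) (𝔅 x) (fun U => U) U) (fun (y y' : (geo9Y x).Site) => B46K * Real.exp (-(δ46K * (geo9Y x).dist y y'))) := fun x hM α₀ hα ha U hU => by rw [hblk12 x]; exact h46K x ((le_max_right _ _).trans hM) α₀ hα (ha.trans (min_le_right _ _)) U hU
  set tT : ℝ := max t12 (2 * const3131 (cR39 (trBasis N))⁻¹ (((θ.d₆ + 1 : ℕ) : ℝ) * p.C (B9RWSums347DefiniteFaces.exp261 (@geo9Y θ.d₆ θ.ℓ₆ θ.hd' θ.hL' θ.b₀ θ.b₁ Mstar) p.δ₀ p.α)) CP (rowConst261 (@geo9Y θ.d₆ θ.ℓ₆ θ.hd' θ.hL' θ.b₀ θ.b₁ Mstar) σS) ((θ.ℓ₆ + 1 : ℕ) : ℝ) * tJ) with htTdef; have ht12c : 2 * const3131 (cR39 (trBasis N))⁻¹ (((θ.d₆ + 1 : ℕ) : ℝ) * p.C (B9RWSums347DefiniteFaces.exp261 (@geo9Y θ.d₆ θ.ℓ₆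 θ.hd' θ.hL' θ.b₀ θ.b₁ Mstar) p.δ₀ p.α)) CP (rowConst261 (@geo9Y θ.d₆ θ.ℓ₆ θ.hd' θ.hL' θ.b₀ θ.b₁ Mstar) σS) ((θ.ℓ₆ + 1 : ℕ) : ℝ) * tJ ≤ tT := le_max_right _ _; have ht12T : 0 ≤ tT := ht12.trans (le_max_left _ _)
  obtain ⟨M43, a43, hM43, ha43, h43'⟩ := h43Gp_of_thm37PrintedSN (G := specialUnitaryUnits (Fin N)) (bg := fun x => bg9YR (Matrix (Fin N) (Fin N) ℂ) (specialUnitaryUnits (Fin N)) R₁ R₂ x) (κ := TrIdx N) (c35 := c) (c10 := c35Y) (ι := fun x => ↥(cubes x.toKIdx.D.toDomains)) (Q := fun _ => Fin (θ.d₆ + 1)) (bI := bI) (fun u hu => B9SectBStepUClosedSU.norm_le_one_of_mem_su u hu) (fun x U => U) (trBasis N) c35Y_le_ten (fun x α₀ U hU => (hRP1 x α₀ U hU).2.1) 𝔬 𝔡 𝔩 𝔭 H (fun x => (𝔏 x).Gp) hlev hβ1 hbI0 (fun x => B9SmoothHolderClassTClosure.abs_cf_eq_nKT x.toKIdx x.hcfk)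 (fun x => by rw [h𝔭 x]) hblkS hblkYS hGpS hDsS κ SH p.Bl p.Bt hc hp.α_pos hp.α_lt hp.N'_nn hp.NH_nn hp.B₀_pos hp.δ₀_pos hp.a₁_pos hp.M₁_pos hp.αF_pos (by linarith only [hp.αF_lt]) (p.C_nonneg hp _) (PinPrims.rate_pos hp).le (by nlinarith only [hp.α_pos, hp.δ₀_pos]) hp.Bl_nn hp.Bt_nn hst hκ hcntH
    (fun x hM α₀ hα ha U hU => by obtain ⟨h1, h2, h3⟩ := h36_of_dirSq_pinsR (R := (1 : ℝ)) (H := H) 𝔬 𝔡 hblkS hblkYS hDS hDsS h𝔡d h𝔡s (fun x U j => ⟨_, _, hGsqF x U j⟩) h36 x hM α₀ hα ha U hU; exact ⟨h1, h2, h3, (h36H x hM α₀ hα ha U hU).1, (h36H x hM α₀ hα ha U hU).2.1⟩) _ t37' (fun _ _ h => h.1) w13 hw13₀ hw13₁ hB₀D hbudD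
  have h43Gp : ∀ x : MemberY θ.d₆ θ.ℓ₆ θ.hd' θ.hL' θ.b₀ θ.b₁ Mstar, letI : Fintype (B9GeoNormsKLevelV1.geo9K x.toKIdx).Site := (inferInstance : Fintype (geo9Y x).Site); max M12 M43 ≤ (geo9Y x).M → ∀ α₀ : ℝ, 0 < α₀ → (geo9Y x).M * α₀ ≤ min a12 a43 → ∀ U : (𝔅 x).Cfg, (𝔅 x).Reg335 c α₀ U → (𝔅 x).Reg336 c α₀ U → HasMaj (cNorm 1 (H x) (𝔬12 x).blk (fun y => (geo9Y_len_pos x y).le) 0) (bH13 x U) (GcoS x.toKIdx (trBasis N) (bg9YR (Matrix (Fin N) (Fin N) ℂ) (specialUnitaryUnits (Fin N)) R₁ R₂ x) (fun U => U) (GpY x.toKIdx (parKnitY x.toKIdx)) U ∘ₗ DvscoKH x.toKIdx (trBasis N) (bg9YR (Matrix (Fin N) (Fin N) ℂ) (specialUnitaryUnits (Fin N)) R₁ R₂ x) (fun U => U) U) (fun a b => B43 * Real.exp (-(δ43 * (geo9Y x).dist a b))) := fun x hM α₀ hα ha U hU _ => by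
    rw [hblk12 x, hbH13 x U, ← h𝔏Gp x]; exact (h43' x ((le_max_right _ _).trans hM) α₀ hα (ha.trans (min_le_right _ _)) U hU).mono (kernel_mono (hgeoOK x) (by have h0 := p.C_nonneg hp (B9RWSums347DefiniteFaces.exp261 (@geo9Y θ.d₆ θ.ℓ₆ θ.hd' θ.hL' θ.b₀ θ.b₁ Mstar) p.δ₀ p.α); positivity) hB43ge hδ43le)
  obtain ⟨MpW, apW, hMpW, hapW, hPW⟩ := hpDGW_of_thm37PrintedSN_unif (G := specialUnitaryUnits (Fin N)) (bg := fun x => bg9YR (Matrix (Fin N) (Fin N) ℂ) (specialUnitaryUnits (Fin N)) R₁ R₂ x) (κ := TrIdx N) (c35 := c) (c10 := c35Y) (ι := fun x => ↥(cubes x.toKIdx.D.toDomains)) (Q := fun _ => Fin (θ.d₆ + 1)) (bI := bI) (fun u hu => B9SectBStepUClosedSU.norm_le_one_of_mem_su u hu) (fun x U => U) (trBasis N) c35Y_le_ten (fun x α₀ U hU => ((B9BackgroundsKLevelV1P.reg335YP_iff _ _ _ _).1 (hRP1 x α₀ U hU).2).1) 𝔬 𝔡 𝔩 𝔭 H (fun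 x => (𝔏 x).Gp) hlev hβ1 hbI0 (fun x => B9SmoothHolderClassTClosure.abs_cf_eq_nKT x.toKIdx x.hcfk) (fun x => by rw [h𝔭 x]) hblkS hblkYS hGpS hDS κ SH p.Bl p.Bt hc hp.α_pos hp.α_lt hp.N'_nn hp.NH_nn hp.B₀_pos hp.δ₀_pos hp.a₁_pos hp.M₁_pos hp.αF_pos (by linarith only [hp.αF_lt]) (p.C_nonneg hp _) (PinPrims.rate_pos hp).le (by nlinarith only [hp.α_pos, hp.δ₀_pos]) hp.Bl_nn hp.Bt_nn hst hκ hcntH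
    (fun x hM α₀ hα ha U hU => by obtain ⟨h1, h2, h3⟩ := h36_of_dirSq_pinsR (R := (1 : ℝ)) (H := H) 𝔬 𝔡 hblkS hblkYS hDS hDsS h𝔡d h𝔡s (fun x U j => ⟨_, _, hGsqF x U j⟩) h36 x hM α₀ hα ha U hU; exact ⟨h1, h2, h3, (h36H x hM α₀ hα ha U hU).1, (h36H x hM α₀ hα ha U hU).2.1⟩) _ t37' (fun _ _ h => h.1)
  have hpDGW : ∀ x : MemberY θ.d₆ θ.ℓ₆ θ.hd' θ.hL' θ.b₀ θ.b₁ Mstar, letI : Fintype (B9GeoNormsKLevelV1.geo9K x.toKIdx).Site := (inferInstance : Fintype (geo9Y x).Site); max M12 MpW ≤ (geo9Y x).M → ∀ α₀ : ℝ, 0 < α₀ → (geo9Y x).M * α₀ ≤ min a12 apW → ∀ U : (𝔅 x).Cfg, (𝔅 x).Reg335 c α₀ U → (𝔅 x).Reg336 c α₀ U → ∀ (β' : ℝ), 0 ≤ β' → β' < 1 → HasMaj (cNormR 1 (H x) (𝔬12 x).blkW (fun y => (geo9Y_len_pos x y).le) 0) (cNormR 1 (H x) (𝔭A x).blkPX (fun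 y => (geo9Y_len_pos x y).le) (β' - 1)) ((𝔭A x).ΦX U β' ∘ₗ (𝔬12 x).Dv U ∘ₗ GcoS x.toKIdx (trBasis N) (bg9YR (Matrix (Fin N) (Fin N) ℂ) (specialUnitaryUnits (Fin N)) R₁ R₂ x) (fun U => U) (GpY x.toKIdx (parKnitY x.toKIdx)) U) (fun a b => BhW β' * Real.exp (-(δhW * (geo9Y x).dist a b))) := fun x hM α₀ hα ha U hU _ β' h0 h1 => by
    rw [hblkW12 x, hDvco12 x U, h𝔭A x, h𝔏B x, ← h𝔏Gp x]; exact (hPW x ((le_max_right _ _).trans hM) α₀ hα (ha.trans (min_le_right _ _)) U hU β' h0 h1).mono (fun a b => mul_le_mul (hBhWge β' h0 h1) (Real.exp_le_exp.2 (neg_le_neg (mul_le_mul_of_nonneg_right hδhWle ((hgeoOK x).dnn a b)))) (Real.exp_nonneg _) (hBhW β' h0 h1))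
  obtain ⟨MG0, aG0, hMG0, haG0, HG0⟩ := h44m_h45X_h45Y_of_local3107 (bg := 𝔅) (bP := bI) (fun x U => U) (trBasis N) hc q hq H 𝔬A 𝔡A 𝔩A 𝔭A 𝔬12 (fun x => (hblk12 x).trans (hblkA x).symm) (fun x => (hblkY12 x).trans (hblkYA x).symm) (fun x U => (hG0co12 x U).trans (hGcoA x U).symm) (fun x U => (hDco12 x U).trans (hDcoA x U).symm) (fun x U => (hDsco12 x U).trans (hDscoA x U).symm) (fun x U f f' => (𝔏 x).parB U f.src f'.src) (fun x U β' => B9CoReadingCoordsHolderAdm.wKA x.toKIdx β') (fun x U β' => B9CoReadingCoordsHolder.w₀K x.toKIdx β') (fun x U β' => by rw [h𝔭A x]; rfl) (fun x U β' => by rw [h𝔭A x]; rfl) (fun x => by rw [h𝔭A x]; rfl) (fun x => by rw [h𝔭A x]; rfl) hDco12 h𝔡Ad bHXTA hbHXTA κA SHA SIA hstA hκA hcntHA hcntIA h36A4 (fun x hM α₀ hα ha U hU => by have h := h36HA' x hM α₀ hα ha U hU; exact ⟨h.1, h.2.1, h.2.2.2.1.2.2, h.2.2.2.2.2.2⟩)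 hopIA sch hschβ hsch1 hs440 hs441
  obtain ⟨MT, aT, hMT, haT, hG0CT'⟩ := thm33G0DirT_of_local3107 (bg := 𝔅) hc q hq H 𝔬A 𝔡A 𝔩A 𝔭A 𝔬12 (fun x => (hblk12 x).trans (hblkA x).symm) (fun x => (hblkY12 x).trans (hblkYA x).symm) (fun x U => (hG0co12 x U).trans (hGcoA x U).symm) (fun x U => (hDco12 x U).trans (hDcoA x U).symm) (fun x U => (hDsco12 x U).trans (hDscoA x U).symm) bHXTA κA SHA SIA hstA hκA hcntHA hcntIA h36A4 (fun x hM α₀ hα ha U hU => by have h := h36HA' x hM α₀ hα ha U hU; exact ⟨h.1, h.2.1, h.2.2.2.1.2.2, h.2.2.2.2.2.2⟩) hopIA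
  have hδ12₀F : δ12₀ ≤ (1 - q.αF) * ((1 - 2 * q.α) * q.δ₀) := hδ12₀.trans (mul_le_mul_of_nonneg_right (by linarith only [hq.αF_pos]) (PinPrims.rate_pos hq).le)
  have h44m := fun (x : MemberY θ.d₆ θ.ℓ₆ θ.hd' θ.hL' θ.b₀ θ.b₁ Mstar) (hM : max M12 MG0 ≤ (geo9Y x).M) (α₀ : ℝ) (hα : 0 < α₀) (ha : (geo9Y x).M * α₀ ≤ min a12 aG0) (U : (𝔅 x).Cfg) (hU : (𝔅 x).Reg335 c α₀ U) (_ : (𝔅 x).Reg336 c α₀ U) (ν μ : Fin (θ.d₆ + 1)) => ((HG0 x ((le_max_right _ _).trans hM) α₀ hα (ha.trans (min_le_right _ _)) U hU).1 ν μ).mono (fun a b => mul_le_mul hBi44ge (Real.exp_le_exp.2 (neg_le_neg (mul_le_mul_of_nonneg_right hδ44le ((hgeoOK x).dnn a b)))) (Real.exp_nonneg _) hBi44)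
  have h45X := fun (x : MemberY θ.d₆ θ.ℓ₆ θ.hd' θ.hL' θ.b₀ θ.b₁ Mstar) (hM : max M12 MG0 ≤ (geo9Y x).M) (α₀ : ℝ) (hα : 0 < α₀) (ha : (geo9Y x).M * α₀ ≤ min a12 aG0) (U : (𝔅 x).Cfg) (hU : (𝔅 x).Reg335 c α₀ U) (_ : (𝔅 x).Reg336 c α₀ U) (ν μ : Fin (θ.d₆ + 1)) (β' : ℝ) (h0 : 0 ≤ β') (h1 : β' < 1) => ((HG0 x ((le_max_right _ _).trans hM) α₀ hα (ha.trans (min_le_right _ _)) U hU).2.1 ν μ β' h0 h1).mono (fun a b => mul_le_mul (hBZge β' h0 h1) (Real.exp_le_exp.2 (neg_le_neg (mul_le_mul_of_nonneg_right hδ45le ((hgeoOK x).dnn a b)))) (Real.exp_nonneg _) (hBZ β' h0 h1))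
  have h45Y := fun (x : MemberY θ.d₆ θ.ℓ₆ θ.hd' θ.hL' θ.b₀ θ.b₁ Mstar) (hM : max M12 MG0 ≤ (geo9Y x).M) (α₀ : ℝ) (hα : 0 < α₀) (ha : (geo9Y x).M * α₀ ≤ min a12 aG0) (U : (𝔅 x).Cfg) (hU : (𝔅 x).Reg335 c α₀ U) (_ : (𝔅 x).Reg336 c α₀ U) (β' : ℝ) (h0 : 0 ≤ β') (h1 : β' < 1) (μ : Fin (θ.d₆ + 1)) => ((HG0 x ((le_max_right _ _).trans hM) α₀ hα (ha.trans (min_le_right _ _)) U hU).2.2 β' h0 h1 μ).mono (fun a b => mul_le_mul (hBiYge β' h0 h1) (Real.exp_le_exp.2 (neg_le_neg (mul_le_mul_of_nonneg_right hδ45Yle ((hgeoOK x).dnn a b)))) (Real.exp_nonneg _) (hBiY β' h0 h1))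
  obtain ⟨M44, a44, hM44, ha44, H44⟩ := h44G_hp45W_of_thm37PrintedSN (G := specialUnitaryUnits (Fin N)) (bg := 𝔅) (κ := TrIdx N) (c35 := c) (c10 := c35Y) (ι := fun x => ↥(cubes x.toKIdx.D.toDomains)) (bI := bI) (fun u hu => B9SectBStepUClosedSU.norm_le_one_of_mem_su u hu) (fun x U => U) (trBasis N) c35Y_le_ten (fun x α₀ U hU => ((B9BackgroundsKLevelV1P.reg335YP_iff _ _ _ _).1 (hRP1 x α₀ U hU).2).1) 𝔬 𝔡 𝔩 𝔭 H (fun x => (𝔏 x).Gp) hlev hβ1 hbI0 (fun x => B9SmoothHolderClassTClosure.abs_cf_eq_nKT x.toKIdx x.hcfk) (fun x => by rw [h𝔭 x]) hblkS hGpS (fun x U ν => congrFun (h𝔡d x U) ν) (fun x U μ => congrFun (h𝔡s x U) μ) bHXT hbHXT κ SH SI p.Bl p.Bt p.BI p.θI p.BI2 sch hc hp.α_pos hp.α_lt hp.N'_nn hp.NH_nn hp.NI_nn hp.B₀_pos hp.δ₀_pos hp.a₁_pos hp.M₁_pos hp.αF_pos (by linarith only [hp.αF_lt]) hα3 (p.C_nonneg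 hp _) le_rfl hp.Bl_nn hp.Bt_nn hp.BI_nn hp.BI2_nn hp.θI_nn hschβ hsch1 hst hκ hcntH hcntI
    (fun x hM α₀ hα ha U hU => by obtain ⟨h1, h2, h3⟩ := h36_of_dirSq_pinsR (R := (1 : ℝ)) (H := H) 𝔬 𝔡 hblkS hblkYS hDS hDsS h𝔡d h𝔡s (fun x U j => ⟨_, _, hGsqF x U j⟩) h36 x hM α₀ hα ha U hU; exact ⟨h1, h2, h3, (h36H x hM α₀ hα ha U hU).1, (h36H x hM α₀ hα ha U hU).2.1⟩) (fun x hM α₀ hα ha U hU => by have h := h36H' x hM α₀ hα ha U hU; exact ⟨h.2.2.2.2.2.2, h.2.2.2.1.2.2⟩) hopI _ t37' (fun _ _ h => h.1) hs440 hs441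
  have h44G : ∀ x : MemberY θ.d₆ θ.ℓ₆ θ.hd' θ.hL' θ.b₀ θ.b₁ Mstar, letI : Fintype (B9GeoNormsKLevelV1.geo9K x.toKIdx).Site := (inferInstance : Fintype (geo9Y x).Site); max M12 M44 ≤ (geo9Y x).M → ∀ α₀ : ℝ, 0 < α₀ → (geo9Y x).M * α₀ ≤ min a12 a44 → ∀ U : (𝔅 x).Cfg, (𝔅 x).Reg335 c α₀ U → (𝔅 x).Reg336 c α₀ U → HasMaj (bHZKP (κ := TrIdx N) x.toKIdx (trBasis N) (taxiB x.toKIdx (𝔅 x) (fun U => U) U) (R := (1 : ℝ)) (H := H x) hs440.le hs441.le) (cNorm 1 (H x) (𝔬12 x).blk (fun y => (geo9Y_len_pos x y).le) 1)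
          ((𝔬12 x).Dv U ∘ₗ GcoS x.toKIdx (trBasis N) (𝔅 x) (fun U => U) (GpY x.toKIdx (parKnitY x.toKIdx)) U ∘ₗ (𝔬12 x).Dvstar U) (fun a b => B44G * Real.exp (-(δ44G * (geo9Y x).dist a b))) := fun x hM α₀ hα ha U hU _ => by rw [hblk12 x, hDvco12 x U, hDvsco12 x U, ← h𝔏Gp x]; exact (H44 x ((le_max_right _ _).trans hM) α₀ hα (ha.trans (min_le_right _ _)) U hU).1.mono (fun a b => mul_le_mul hB44Gge (Real.exp_le_exp.2 (neg_le_neg (mul_le_mul_of_nonneg_right hδ44Gle ((hgeoOK x).dnn a b)))) (Real.exp_nonneg _) hB44G)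
  have hp45W : ∀ x : MemberY θ.d₆ θ.ℓ₆ θ.hd' θ.hL' θ.b₀ θ.b₁ Mstar, letI : Fintype (B9GeoNormsKLevelV1.geo9K x.toKIdx).Site := (inferInstance : Fintype (geo9Y x).Site); max M12 M44 ≤ (geo9Y x).M → ∀ α₀ : ℝ, 0 < α₀ → (geo9Y x).M * α₀ ≤ min a12 a44 → ∀ U : (𝔅 x).Cfg, (𝔅 x).Reg335 c α₀ U → (𝔅 x).Reg336 c α₀ U → ∀ (β' : ℝ) (h0 : 0 ≤ β') (h1 : β' < 1), HasMaj (bHZKP (κ := TrIdx N) x.toKIdx (trBasis N) (taxiB x.toKIdx (𝔅 x) (fun U => U) U) (R := (1 : ℝ)) (H := H x) (hsch0 β' h0 h1).le (hsch1 β' h0 h1).le) (cNormR 1 (H x) (𝔭A x).blkPX (fun y => (geo9Y_len_pos x y).le) (β' - 1)) ((𝔭A x).ΦX U β' ∘ₗ ((𝔬12 x).Dv U ∘ₗ GcoS x.toKIdx (trBasis N) (𝔅 x) (fun U => U) (GpY x.toKIdx (parKnitY x.toKIdx)) U ∘ₗ (𝔬12 x).Dvstar U)) (fun a b => B45W β'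 * Real.exp (-(δ45W * (geo9Y x).dist a b))) := fun x hM α₀ hα ha U hU _ β' h0 h1 => by rw [hDvco12 x U, hDvsco12 x U, h𝔭A x, h𝔏B x, ← h𝔏Gp x]; exact ((H44 x ((le_max_right _ _).trans hM) α₀ hα (ha.trans (min_le_right _ _)) U hU).2 β' h0 h1).mono (fun a b => mul_le_mul (hB45Wge β' h0 h1) (Real.exp_le_exp.2 (neg_le_neg (mul_le_mul_of_nonneg_right hδ45Wle ((hgeoOK x).dnn a b)))) (Real.exp_nonneg _) (hB45W β' h0 h1))
  have h31m := fun (x : MemberY θ.d₆ θ.ℓ₆ θ.hd' θ.hL' θ.b₀ θ.b₁ Mstar) (hM : max (max M12 M43) (max M31 M49) ≤ (geo9Y x).M) (α₀ : ℝ) (hα : 0 < α₀) (ha : (geo9Y x).M * α₀ ≤ min (min a12 a43) (min a31 a49)) (U : (𝔅 x).Cfg) (hU : (𝔅 x).Reg335 c α₀ U) => h31 x (((le_max_left _ _).trans (le_max_right _ _)).trans hM) α₀ hα (ha.trans ((min_le_right _ _).trans (min_le_left _ _))) U hU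
  have h49m := fun (x : MemberY θ.d₆ θ.ℓ₆ θ.hd' θ.hL' θ.b₀ θ.b₁ Mstar) (hM : max (max M12 M43) (max M31 M49) ≤ (geo9Y x).M) (α₀ : ℝ) (hα : 0 < α₀) (ha : (geo9Y x).M * α₀ ≤ min (min a12 a43) (min a31 a49)) (U : (𝔅 x).Cfg) (hU : (𝔅 x).Reg335 c α₀ U) => h49 x (((le_max_right _ _).trans (le_max_right _ _)).trans hM) α₀ hα (ha.trans ((min_le_right _ _).trans (min_le_right _ _))) U hU
  have h43m := fun (x : MemberY θ.d₆ θ.ℓ₆ θ.hd' θ.hL' θ.b₀ θ.b₁ Mstar) (hM : max (max M12 M43) (max M31 M49) ≤ (geo9Y x).M) (α₀ : ℝ) (hα : 0 < α₀) (ha : (geo9Y x).M * α₀ ≤ min (min a12 a43) (min a31 a49)) (U : (𝔅 x).Cfg) (hU : (𝔅 x).Reg335 c α₀ U) (hU' : (𝔅 x).Reg336 c α₀ U) => h43Gp x ((le_max_left _ _).trans hM) α₀ hα (ha.trans (min_le_left _ _)) U hU hU'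
  obtain ⟨MLT, hT4⟩ := N06SplitMajorantsAtPinsPhysRPar.split_majorants_of_letter_schemasR_par (N := N) (fun i => parKnitY i) c q hq H 𝔬12 (((θ.d₆ + 1 : ℕ) : ℝ) * p.C (B9RWSums347DefiniteFaces.exp261 (@geo9Y θ.d₆ θ.ℓ₆ θ.hd' θ.hL' θ.b₀ θ.b₁ Mstar) p.δ₀ p.α)) ((1 - 2 * p.α) * p.δ₀) CP (min ((1 - 2 * p.α) * p.δ₀) δ39 / 8) tJ δB rT δT12 σS tT (max (max (max M12 M46K) M31) M49) (min (min (min a12 a46K) a31) a49)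
    (mul_nonneg (Nat.cast_nonneg _) (PinPrims.C_nonneg hp _)) hCP htJ0 hσS (lt_max_of_lt_left (lt_max_of_lt_left (lt_max_of_lt_left hM12))) hrT0 hrTP hrTB hδT12 hδTr2 ht12c
    (fun x hM α₀ hα ha U hU _ => by rw [hblkW12 x, hblk12 x]; exact h31 x ((le_max_right _ _).trans ((le_max_left _ _).trans hM)) α₀ hα (ha.trans ((min_le_left _ _).trans (min_le_right _ _))) U hU)
    (fun x hM α₀ hα ha U hU _ => by rw [hblkW12 x, hblk12 x]; exact h49 x ((le_max_right _ _).trans hM) α₀ hα (ha.trans (min_le_right _ _)) U hU) (fun x hM α₀ hα ha U hU hU' => hBJ x ((le_max_left _ _).trans ((le_max_left _ _).trans ((le_max_left _ _).trans hM))) α₀ hα (ha.trans (((min_le_left _ _).trans (min_le_left _ _)).trans (min_le_left _ _))) U hU hU')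
  obtain ⟨MW, hW⟩ := N06WELegAtPinsPhysPUBPar.hWE_of_pinsP_geo9Y_budget_par (N := N) (fun i => parKnitY i) H bI hlev hβ1 hbI0 c (M₀ := max (max (max M12 MpW) M44) M49) (a₀ := min (min (min a12 apW) a44) a49) hαW0 hαW1 hσW hδFW wX hwX₀ hwX₁ sch hsch0 hsch1 hwschX bXH hbXH 𝔬12 hblk12 hblkW12 hDvco12 hDvsco12 hRco12 𝔭A hCP hδFP (fun _ => rfl) (fun _ => rfl) (fun x hM α₀ hα ha U hU => h49 x ((le_max_right _ _).trans hM) α₀ hα (ha.trans (min_le_right _ _)) U hU) (δ45 := δ45W) (δh := δhW) (δ₃ := δ12₃) hB45W hBhW hbudW hδ45W hδhW hδ3W hBxW (fun x hM α₀ hα ha U hU hU' => hp45W x ((max_le ((le_max_left _ _).trans ((le_max_left _ _).trans (le_max_left _ _))) ((le_max_right _ _).trans (le_max_left _ _))).trans hM) α₀ hα (ha.trans (le_min ((min_le_left _ _).trans ((min_le_left _ _).trans (min_le_left _ _))) ((min_le_left _ _).trans (min_le_right _ _)))) U hU hU') (fun x hM α₀ hα ha U hU hU' => hpDGW x (((le_max_left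 _ _).trans (le_max_left _ _)).trans hM) α₀ hα (ha.trans ((min_le_left _ _).trans (min_le_left _ _))) U hU hU')
  have hδFWr : δFW ≤ (1 - 2 * p.α) * p.δ₀ := hδFP.trans (by have h1 := min_le_left ((1 - 2 * p.α) * p.δ₀) δ39; linarith only [h1, hθ49])
  obtain ⟨M13, h13⟩ := N06WGpLegAtPinsPhysPUPar.hwGp_of_pinsP_geo9Y_par (N := N) (fun i => parKnitY i) H bI hlev hβ1 hbI0 c (M₀ := max (max (max M12 M44) M43) (max M31 M49)) (a₀ := min (min (min a12 a44) a43) (min a31 a49)) hαW0 hαW1 hσW hδFW wX hwX₀ hwX₁ hs440 hs441 hwX44 bXH hbXH 𝔬12 hblk12 hblkW12 hDvco12 hDvsco12 hRco12 (B₃ := B12₃) (δ₃ := δ12₃) (mul_nonneg (Nat.cast_nonneg _) (p.C_nonneg hp _)) hCP hB44G hδFWr hδFP hbudW hδ44G hB₃wG hδ3W (fun _ => rfl) (fun _ => rfl)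
    (fun x hM α₀ hα ha U hU => h31m x ((max_le_max (max_le_max (le_max_left _ _) le_rfl) le_rfl).trans hM) α₀ hα (ha.trans (min_le_min (min_le_min (min_le_left _ _) le_rfl) le_rfl)) U hU)
    (fun x hM α₀ hα ha U hU => h49m x ((max_le_max (max_le_max (le_max_left _ _) le_rfl) le_rfl).trans hM) α₀ hα (ha.trans (min_le_min (min_le_min (min_le_left _ _) le_rfl) le_rfl)) U hU)
    (fun x hM α₀ hα ha U hU hU' => h44G x ((le_max_left _ _).trans ((le_max_left _ _).trans hM)) α₀ hα ((ha.trans (min_le_left _ _)).trans (min_le_left _ _)) U hU hU')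
  obtain ⟨Mrg, hrg⟩ := N06RgdH43LegAtPinsPhysPUPar.hrgdH_of_pinsP43_geo9Y_par (N := N) (fun i => parKnitY i) H bI hlev hβ1 hGR c (M₀ := max (max M12 M43) (max M31 M49)) (a₀ := min (min a12 a43) (min a31 a49)) hαW0 hαW1 hσW hδFW w13 hw13₀ hw13₁ bH13 hbH13 𝔬12 hblk12 hblkW12 hDvsco12 hRco12
    (mul_nonneg (Nat.cast_nonneg _) (p.C_nonneg hp _)) hCP hB43 hδFWr hδFP hρrg0 hbudrg hbud43 hB₃rg hδ₃rg (fun _ => rfl) (fun _ => rfl)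
    h31m
    h49m
    h43m
  obtain ⟨CA3, hCA3, hCA30⟩ : ∃ CA3 : ℝ, B9PerturbationMajorantAlgebra.constA (cR39 (trBasis N))⁻¹ (((θ.d₆ + 1 : ℕ) : ℝ) * p.C (B9RWSums347DefiniteFaces.exp261 (@geo9Y θ.d₆ θ.ℓ₆ θ.hd' θ.hL' θ.b₀ θ.b₁ Mstar) p.δ₀ p.α)) CP (rowConst261 (@geo9Y θ.d₆ θ.ℓ₆ θ.hd' θ.hL' θ.b₀ θ.b₁ Mstar) σW) (((θ.ℓ₆ + 1 : ℕ) : ℝ)) ≤ CA3 ∧ 0 ≤ CA3 := ⟨max (B9PerturbationMajorantAlgebra.constA (cR39 (trBasis N))⁻¹ (((θ.d₆ + 1 : ℕ) : ℝ) * p.C (B9RWSums347DefiniteFaces.exp261 (@geo9Y θ.d₆ θ.ℓ₆ θ.hd' θ.hL' θ.b₀ θ.b₁ Mstar) p.δ₀ p.α)) CP (rowConst261 (@geo9Y θ.d₆ θ.ℓ₆ θ.hd' θ.hL' θ.b₀ θ.b₁ Mstar) σW) (((θ.ℓ₆ + 1 : ℕ) : ℝ))) 0, le_max_left _ _, le_max_right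 _ _⟩
  obtain ⟨Mr2, hr2⟩ := N06Rgd2LegAtPinsPhysPUPar.hrgd2_of_pinsP_geo9Y_par (N := N) H bI (fun x : MemberY θ.d₆ θ.ℓ₆ θ.hd' θ.hL' θ.b₀ θ.b₁ Mstar => parKnitY x.toKIdx) c (M₀ := max (max M12 M43) (max M31 M49)) (a₀ := min (min a12 a43) (min a31 a49)) hαW0 hαW1 hσW hδFW 𝔬12 hblk12 hblkW12 hDvco12 hDvsco12 hRco12 (B₃ := CA3) (δ₃ := δ12₃) (mul_nonneg (Nat.cast_nonneg _) (p.C_nonneg hp _)) hCP hδFWr hδFP hbudW hCA3 hδ3W (fun _ => rfl)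
    h31m
    h49m
  set M12T : ℝ := max (max (max (max (max (max (max (max (max (max (max (max (max (max M12 M46K) M31) M49) M12) MLT) MR) M12) M12) M12) MW) M13) Mrg) (max M12 M43)) M44 with hM12Tdef; set a12T : ℝ := min (min (min (min (min (min (min (min (min a12 a46K) a31) a49) (q.a₁ / c)) a43) apW) a44) aG0) (p.a₁ / c) with ha12Tdef; have haTK12 : a12T ≤ aK := (min_le_right _ _).trans hpaK; have hM12T : M12 ≤ M12T := (((((((le_max_left M12 M46K).trans (le_max_left _ M31)).trans (le_max_left _ M49)).trans (le_max_left _ M12)).trans (le_max_left _ MLT)).trans (le_max_left _ MR)).trans ((le_max_left _ M12).trans ((le_max_left _ M12).trans ((le_max_left _ M12).trans ((le_max_left _ MW).trans ((le_max_left _ M13).trans ((le_max_left _ Mrg).trans (le_max_left _ (max M12 M43))))))))).trans (le_max_left _ M44); have hMWT : MW ≤ M12T := ((le_max_right _ MW).trans ((le_max_left _ M13).trans ((le_max_left _ Mrg).trans (le_max_left _ (max M12 M43))))).trans (le_max_left _ M44); have hM13T : M13 ≤ M12T := ((le_max_right _ M13).trans ((le_max_left _ Mrg).trans (le_max_left _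 (max M12 M43)))).trans (le_max_left _ M44); have hMrgT : Mrg ≤ M12T := ((le_max_right _ Mrg).trans (le_max_left _ (max M12 M43))).trans (le_max_left _ M44); have ha12T : a12T ≤ a12 := (min_le_left _ (p.a₁ / c)).trans (((min_le_left _ aG0).trans (min_le_left _ a44)).trans ((((((min_le_left _ _).trans (min_le_left _ _)).trans (min_le_left _ _)).trans (min_le_left _ _)).trans (min_le_left _ _)).trans (min_le_left _ _))); have ha43T : a12T ≤ a43 := (min_le_left _ (p.a₁ / c)).trans (((min_le_left _ aG0).trans (min_le_left _ a44)).trans ((min_le_left _ _).trans (min_le_right _ _))); have haWT : a12T ≤ apW := (min_le_left _ (p.a₁ / c)).trans (((min_le_left _ aG0).trans (min_le_left _ a44)).trans (min_le_right _ _)); have hM43T : M43 ≤ M12T := ((le_max_right M12 M43).trans (le_max_right _ _)).trans (le_max_left _ M44); have hM12RT : max M12 MR ≤ M12T := max_le hM12T ((((((le_max_right _ MR).trans (le_max_left _ M12)).trans (le_max_left _ M12)).trans (le_max_left _ M12)).trans ((le_max_left _ MW).trans ((le_max_left _ M13).trans ((le_max_left _ Mrg).trans (le_max_left _ (max M12 M43)))))).trans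 (le_max_left _ M44)); have hM12T0 : max (max (max (max (max M12 M46K) M31) M49) M12) MLT ≤ M12T := (((((le_max_left _ MR).trans (le_max_left _ M12)).trans (le_max_left _ M12)).trans (le_max_left _ M12)).trans ((le_max_left _ MW).trans ((le_max_left _ M13).trans ((le_max_left _ Mrg).trans (le_max_left _ (max M12 M43)))))).trans (le_max_left _ M44); have ha12T0 : a12T ≤ min (min (min a12 a46K) a31) a49 := (min_le_left _ (p.a₁ / c)).trans (((min_le_left _ aG0).trans (min_le_left _ a44)).trans ((min_le_left _ _).trans ((min_le_left _ _).trans (min_le_left _ _)))); have ha12RT : a12T ≤ min a12 (q.a₁ / c) := le_min ha12T ((min_le_left _ (p.a₁ / c)).trans (((min_le_left _ aG0).trans (min_le_left _ a44)).trans ((min_le_left _ _).trans ((min_le_left _ _).trans (min_le_right _ _))))); have hM12Tpos : 0 < M12T := lt_of_lt_of_le hM12 hM12T; have ha12Tpos : 0 < a12T := lt_min (lt_min (lt_min (lt_min (lt_min (lt_min (lt_min (lt_min (lt_min ha12 ha46K) ha31) ha49) hac) ha43) hapW) ha44) haG0) (div_pos hp.a₁_pos hc); have hM44T : M44 ≤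 M12T := le_max_right _ M44; have ha44T : a12T ≤ a44 := (min_le_left _ (p.a₁ / c)).trans ((min_le_left _ aG0).trans (min_le_right _ a44)); have haGT : a12T ≤ aG0 := (min_le_left _ (p.a₁ / c)).trans (min_le_right _ aG0); have haPT : a12T ≤ p.a₁ / c := min_le_right _ _; have hcaP : ∀ {M α₀ : ℝ}, M * α₀ ≤ p.a₁ / c → c * M * α₀ ≤ p.a₁ := fun {M α₀} h => (by have h' := (le_div_iff₀ hc).1 h; linarith only [h', show c * M * α₀ = M * α₀ * c by ring])
  have hWE : ∀ x : MemberY θ.d₆ θ.ℓ₆ θ.hd' θ.hL' θ.b₀ θ.b₁ Mstar, M12T ≤ (geo9Y x).M → ∀ α₀ : ℝ, 0 < α₀ → (geo9Y x).M * α₀ ≤ min (min (min a12 apW) a44) a49 → ∀ U : (𝔅 x).Cfg, (𝔅 x).Reg335 c α₀ U → (𝔅 x).Reg336 c α₀ U → ∀ β : ℝ, 0 ≤ β → β < 1 → HasMaj (bXH x U) (cNormR 1 (H x) (𝔭A x).blkPX (fun y => (geo9Y_len_pos x y).le) (β - 1)) ((𝔭A x).ΦX U β ∘ₗ ((𝔬12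 x).Dv U ∘ₗ GcoS x.toKIdx (trBasis N) (𝔅 x) (fun U => U) (GpY x.toKIdx (parKnitY x.toKIdx)) U ∘ₗ (𝔬12 x).R U ∘ₗ (𝔬12 x).Dvstar U)) (fun a b => Bx13 β * Real.exp (-(δ12₃ * (geo9Y x).dist a b))) := fun x hM α₀ hα ha U hU hU' β h0 h1 => hW x (hMWT.trans hM) α₀ hα ha U hU hU' β h0 h1
  have hM31T : M31 ≤ M12T := (le_max_right _ _).trans ((le_max_left _ _).trans ((le_max_left _ _).trans ((le_max_left _ _).trans hM12T0))); have hM49T : M49 ≤ M12T := (le_max_right _ _).trans ((le_max_left _ _).trans ((le_max_left _ _).trans hM12T0)); have hM46T : M46K ≤ M12T := (le_max_right _ _).trans ((le_max_left _ _).trans ((le_max_left _ _).trans ((le_max_left _ _).trans ((le_max_left _ _).trans hM12T0)))); have ha46T : a12T ≤ a46K := (min_le_left _ (p.a₁ / c)).trans (((min_le_left _ aG0).trans (min_le_left _ a44)).trans ((min_le_left _ _).trans ((min_le_left _ _).trans ((min_le_left _ _).trans ((min_le_left _ _).trans ((min_le_left _ _).trans (min_le_right _ _))))))); have ha31T : a12T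 ≤ a31 := (min_le_left _ (p.a₁ / c)).trans (((min_le_left _ aG0).trans (min_le_left _ a44)).trans ((min_le_left _ _).trans ((min_le_left _ _).trans ((min_le_left _ _).trans ((min_le_left _ _).trans (min_le_right _ _)))))); have ha49T : a12T ≤ a49 := (min_le_left _ (p.a₁ / c)).trans (((min_le_left _ aG0).trans (min_le_left _ a44)).trans ((min_le_left _ _).trans ((min_le_left _ _).trans ((min_le_left _ _).trans (min_le_right _ _))))); have hαFδq : 0 ≤ q.αF * ((1 - 2 * q.α) * q.δ₀) := mul_nonneg hq.αF_pos.le (mul_nonneg (by linarith only [hq.α_lt]) hq.δ₀_pos.le)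
  have hta := fun (x : MemberY θ.d₆ θ.ℓ₆ θ.hd' θ.hL' θ.b₀ θ.b₁ Mstar) (hM : M12T ≤ (geo9Y x).M) (α₀ : ℝ) (hα : 0 < α₀) (ha : (geo9Y x).M * α₀ ≤ a12T) (U : (𝔅 x).Cfg) (hU : (𝔅 x).Reg335 c α₀ U) (hU' : (𝔅 x).Reg336 c α₀ U) => (hT4 x ((le_max_right (max (max (max (max M12 M46K) M31) M49) M12) MLT).trans (hM12T0.trans hM)) ((le_max_left (max (max (max M12 M46K) M31) M49) M12).trans ((le_max_left (max (max (max (max M12 M46K) M31) M49) M12) MLT).trans (hM12T0.trans hM))) α₀ hα (ha.trans ha12T0) U hU hU').1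
  have hKT : δK12 ≤ δT12 := (by have hτ : 0 ≤ q.αF * ((1 - 2 * q.α) * q.δ₀) := mul_nonneg hq.αF_pos.le (mul_nonneg (by linarith only [hq.α_lt]) hq.δ₀_pos.le); linarith only [hδKS, hρST, hτ])
  obtain ⟨B12₀, Bi12, Bi2₁₂, B12₂, M₀, a₀, hB12₀, hBh12, hBi12, hBi2₁₂, hB12₂, hM₀g, ha₀g, hMM, haa, hG0T, he1G, hG0C⟩ := g0_core_of_thm310_coreDir₃USP (bg := (bg9YR (Matrix (Fin N) (Fin N) ℂ) (specialUnitaryUnits (Fin N)) R₁ R₂)) hc q hq q3 hq3 qM hqM H 𝔬A 𝔭A 𝔡A 𝔩A bHXA κA SHA S3A SIA SMA S2A hstA hκA h36A4 h36HA' h36A2 hcntHA hcnt3A hcntIA hcntMA hcnt2A hsymA htrA 𝔬12 (fun x => (hblk12 x).trans (hblkA x).symm) (fun x => (hblkY12 x).trans (hblkYA x).symm) (fun x U => (hG0co12 x U).trans (hGcoA x U).symm) (fun x U => (hDco12 x U).trans (hDcoA x U).symm) (fun x U => (hDsco12 x U).trans (hDscoA x U).symm) δ12₀ a12T M12T ha12Tpos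 hM12Tpos hδ12₀
  set BhC : ℝ → ℝ := fun β => holderConst (exp261 (@geo9Y θ.d₆ θ.ℓ₆ θ.hd' θ.hL' θ.b₀ θ.b₁ Mstar) q.δ₀ q.α) q.δ₀ q.α q.NH q.NF (const37 (exp261 (@geo9Y θ.d₆ θ.ℓ₆ θ.hd' θ.hL' θ.b₀ θ.b₁ Mstar) q.δ₀ q.α) q.δ₀ q.α q.ρ q.B₀ q.Nc q.N' q.Cℓ q.Kc) (q.Bl β) (q.Bt β) with hBhCdef
  -- (ed. 113) T_π's block-L² letter (Δ⁽²⁾-free)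
  obtain ⟨MLtpi, htpi0⟩ := N06StepL2AtPinsPhysRParG.blockBd_tpi_of_letter_schemasR_parG (N := N) (fun i => parKnitY i) q hq H R₁ R₂ hGR (hsymT := fun x hM α₀ hα ha U hU => hsymT x (((le_max_left M12 M46K).trans ((le_max_left _ M31).trans (le_max_left _ M49))).trans hM) α₀ hα (ha.trans ((min_le_left _ a49).trans ((min_le_left _ a31).trans (min_le_left a12 a46K)))) U hU) (hsymRT := fun x hM α₀ hα ha U hU => hsymRT x (((le_max_left M12 M46K).trans ((le_max_left _ M31).trans (le_max_left _ M49))).trans hM) α₀ hα (ha.trans ((min_le_left _ a49).trans ((min_le_left _ a31).trans (min_le_left a12 a46K)))) U hU) c (fun x => ops312RY (𝔬12 x)) (((θ.d₆ + 1 : ℕ) : ℝ) * p.C (B9RWSums347DefiniteFaces.exp261 (@geo9Y θ.d₆ θ.ℓ₆ θ.hd' θ.hL' θ.b₀ θ.b₁ Mstar) p.δ₀ p.α)) ((1 - 2 * p.α) * p.δ₀) CP (min ((1 - 2 * p.α) * p.δ₀) δ39 / 8) tJ δB B46K δ46K rT δT12 σS (constL2 (cR39 (trBasis N))⁻¹ (((θ.d₆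 + 1 : ℕ) : ℝ) * p.C (B9RWSums347DefiniteFaces.exp261 (@geo9Y θ.d₆ θ.ℓ₆ θ.hd' θ.hL' θ.b₀ θ.b₁ Mstar) p.δ₀ p.α)) CP B46K (rowConst261 (@geo9Y θ.d₆ θ.ℓ₆ θ.hd' θ.hL' θ.b₀ θ.b₁ Mstar) σS) ((θ.ℓ₆ + 1 : ℕ) : ℝ) * tJ) (max (max (max M12 M46K) M31) M49) (min (min (min a12 a46K) a31) a49) (mul_nonneg (Nat.cast_nonneg _) (PinPrims.C_nonneg hp _)) hCP htJ0 hB₄ hσS (lt_max_of_lt_left (lt_max_of_lt_left (lt_max_of_lt_left hM12))) hrT0 hrTP hrTB hrT4 hδT12 hδTr2 le_rfl hTpico12 (fun x hM α₀ hα ha U hU _ => by rw [show (ops312RY (𝔬12 x)).blkW = _ from hblkW12 x, show (ops312RY (𝔬12 x)).blk = _ from hblk12 x]; exact h31 x ((le_max_right _ _).trans ((le_max_left _ _).trans hM)) α₀ hα (ha.trans ((min_le_left _ _).trans (min_le_right _ _))) U hU) (fun x hM α₀ hα ha U hU _ => h46 x ((le_max_left _ _).trans ((le_max_left _ _).trans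 hM)) α₀ hα (ha.trans ((min_le_left _ _).trans (min_le_left _ _))) U hU) (fun x hM α₀ hα ha U hU _ => by rw [show (ops312RY (𝔬12 x)).blkW = _ from hblkW12 x, show (ops312RY (𝔬12 x)).blk = _ from hblk12 x]; exact h49 x ((le_max_right _ _).trans hM) α₀ hα (ha.trans (min_le_right _ _)) U hU) (fun x hM α₀ hα ha U hU hU' => hBJ x ((le_max_left _ _).trans ((le_max_left _ _).trans ((le_max_left _ _).trans hM))) α₀ hα (ha.trans (((min_le_left _ _).trans (min_le_left _ _)).trans (min_le_left _ _))) U hU hU')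
  set aD : ℝ := min aD₀ (min a₀ aT) with haDdef; have haD0 : 0 < aD := lt_min haD00 (lt_min ha₀g haT); have haDa : aD ≤ min a₀ aT := min_le_right _ _
  obtain ⟨ML13, BdT, Bd2T, BdX, BhD13, BZv, BXv, BLv, KX, Bz, Bxz, θS, θD12, A₀S, AWS, AQS, ADS, AQ1S, CRS, θH12, AIS, AVS, r12, MF, aF, MR13, aR13, BrR, hML13B, hBdT, hBd2T, hBdX, hBhD13, hBZv, hBXv, hBLv, hKX, hBz, hBxz, hθS, hθD12, hθH12, hA₀S, hAWS, hAQS, hADS, hAQ1S, hCRS, hAIS, hAVS, hLEG, hXd, hDg, hYd, hDV, hPX, hGT, hST, hr12, haF0, haFa, hMWF, hstepL2, hFI, hMR13, haR13₀, haR13₁, hBrR, hRG13⟩ := N06Level13D2Rgdd13LayerAtPinsPUWPar.level13_d2_rgdd13_layer_of_pinsP_geo9Y_par (N := N) θ.toStage3Params Mstar (fun i => parKnitY i) H bI hlev hβ1 hbI0 hGR c c35Y_le_ten (fun x α₀ U hU => (hRP1 x α₀ U hU).2.1) (M₀ := max (max (max M₀ MT) MG0) MLtpi) (a₀ := min a₀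 aT) (hM₀g.le.trans (((le_max_left _ _).trans (le_max_left _ _)).trans (le_max_left _ _))) (lt_min ha₀g haT) hσS hτS w13 hw13₀ hw13₁ wX hwX₀ hwX₁ hs440 hs441 hws44 hwX44 sch hsch0 hsch1 hwsch bH13 hbH13 hκ13 bXH hbXH bHXA hbHXA bHXT hbHXT bHXTA hbHXTA 𝔬12 hblk12 hblkW12 hblkY12 (fun x => (𝔏 x).GA) hG0co12 hDco12 hDsco12 (fun x => (𝔯 x).Δ2) hTpico12 hT2co12 hDvco12 hDvsco12 𝔭A h𝔏B h𝔭A 𝔬A 𝔡A h𝔡Ad h𝔡As (hB₀ := mul_nonneg (Nat.cast_nonneg _) (p.C_nonneg hp _)) (hCP := hCP) (htJ := htJ0) (hB43 := hB43) (htA := ht12T) (hB44 := hB44G) (hB12₀ := hB12₀) (hB12₂ := hB12₂) (hBh12 := hBh12) (hBi12 := hBi12) (hBHG := hBHG) (hwBhG := hwBhG) (hϑF := hϑF₀) (hBi44 := hBi44) (hBZ := hBZ) (hBiY := hBiY) (hBiT := fun ε hε hε1 => inputConst44_pins_nonneg q hq (const37_pins_nonneg q hq (exp261 (@geo9Y θ.d₆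 θ.ℓ₆ θ.hd' θ.hL' θ.b₀ θ.b₁ Mstar) q.δ₀ q.α)) (Nat.cast_nonneg (θ.ℓ₆ + 1)) ε hε hε1) (hBi2T := fun ε β' hε hε1 h0 h1 => inputConst45_pins_nonneg q hq (const37_pins_nonneg q hq (exp261 (@geo9Y θ.d₆ θ.ℓ₆ θ.hd' θ.hL' θ.b₀ θ.b₁ Mstar) q.δ₀ q.α)) (Nat.cast_nonneg (θ.ℓ₆ + 1)) ε β' hε hε1 h0 h1) (hB₃ := hB12₃) (hB3d := hB12₃d) (hB3p := hB12₃p) (δK := δK12) (δP := δP) (δ13 := δ12₃) (hδK0 := hσS.le.trans hσSK) (hr0 := hU8a) (hr49 := hU8b) (hr2 := hU8c) (hr44 := hU8d) (hrB := hU8e) (hr43 := hU8f) (hrT := hU8g) (hK3d := hU8h) (hKP := hU8i) (hP0 := hU8j) (hP3 := hU8k) (h130 := hδ₃₀) (h1344 := hδ44) (h1345 := hδ45) (h1345Y := hδ45Y) (h31 := fun x hM α₀ hα ha U hU => h31 x (hM31T.trans (hMM.trans (((le_max_left _ _).trans (le_max_left _ _)).trans ((le_max_left _ _).trans hM)))) α₀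 hα ((ha.trans ((min_le_left _ _).trans haa)).trans ha31T) U hU) (h49 := fun x hM α₀ hα ha U hU => h49 x (hM49T.trans (hMM.trans (((le_max_left _ _).trans (le_max_left _ _)).trans ((le_max_left _ _).trans hM)))) α₀ hα ((ha.trans ((min_le_left _ _).trans haa)).trans ha49T) U hU) (h43 := fun x hM α₀ hα ha U hU hU' => h43Gp x ((max_le hM12T hM43T).trans (hMM.trans (((le_max_left _ _).trans (le_max_left _ _)).trans ((le_max_left _ _).trans hM)))) α₀ hα ((ha.trans ((min_le_left _ _).trans haa)).trans (le_min ha12T ha43T)) U hU hU') (h44G := fun x hM α₀ hα ha U hU hU' => h44G x ((max_le hM12T hM44T).trans (hMM.trans (((le_max_left _ _).trans (le_max_left _ _)).trans ((le_max_left _ _).trans hM)))) α₀ hα ((ha.trans ((min_le_left _ _).trans haa)).trans (le_min ha12T ha44T)) U hU hU') (hta := fun x hM α₀ hα ha U hU hU' => hta x (hMM.trans (((le_max_left _ _).trans (le_max_left _ _)).trans ((le_max_left _ _).trans hM))) α₀ hα (ha.trans ((min_le_left _ _).trans haa)) U hU hU') (hBJ := fun x hM α₀ hα ha U hU hU' =>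 hBJ x (hM12T.trans (hMM.trans (((le_max_left _ _).trans (le_max_left _ _)).trans ((le_max_left _ _).trans hM)))) α₀ hα ((ha.trans ((min_le_left _ _).trans haa)).trans ha12T) U hU hU')
    (hG0 := fun x hM α₀ hα ha U hU hU' => hG0T x (((le_max_left _ _).trans (le_max_left _ _)).trans ((le_max_left _ _).trans hM)) α₀ hα (ha.trans (min_le_left _ _)) U hU hU') (hG0D := fun x hM α₀ hα ha U hU hU' => (hG0C x (((le_max_left _ _).trans (le_max_left _ _)).trans ((le_max_left _ _).trans hM)) α₀ hα (ha.trans (min_le_left _ _)) U hU hU').1) (hG0DR := fun x hM α₀ hα ha U hU hU' => (hG0C x (((le_max_left _ _).trans (le_max_left _ _)).trans ((le_max_left _ _).trans hM)) α₀ hα (ha.trans (min_le_left _ _)) U hU hU').2.1) (hG0L2M := fun x hM α₀ hα ha U hU hU' => (hG0C x (((le_max_left _ _).trans (le_max_left _ _)).trans ((le_max_left _ _).trans hM)) α₀ hα (ha.trans (min_le_left _ _)) U hU hU').2.2) (he1 := fun x hM α₀ hα ha U hU hU' => he1G x (((le_max_left _ _).trans (le_max_left _ _)).trans ((le_max_left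 _ _).trans hM)) α₀ hα (ha.trans (min_le_left _ _)) U hU hU') (hG0CT := fun x hM α₀ hα ha U hU _ => hG0CT' x (((le_max_right _ _).trans (le_max_left _ _)).trans ((le_max_left _ _).trans hM)) α₀ hα (ha.trans (min_le_right _ _)) U hU δ12₀ hδ12₀F) (hF := fun x hM α₀ hα ha U hU hU' => hFϑ x (hM12T.trans (hMM.trans (((le_max_left _ _).trans (le_max_left _ _)).trans ((le_max_left _ _).trans hM)))) α₀ hα ((ha.trans ((min_le_left _ _).trans haa)).trans ha12T) U hU hU') (h45X := fun x hM α₀ hα ha U hU hU' => h45X x ((max_le (hM12T.trans (hMM.trans ((le_max_left _ _).trans (le_max_left _ _)))) (le_max_right _ _)).trans ((le_max_left _ _).trans hM)) α₀ hα ((ha.trans ((min_le_left _ _).trans haa)).trans (le_min ha12T haGT)) U hU hU') (h44m := fun x hM α₀ hα ha U hU hU' => h44m x ((max_le (hM12T.trans (hMM.trans ((le_max_left _ _).trans (le_max_left _ _)))) (le_max_right _ _)).trans ((le_max_left _ _).trans hM)) α₀ hα ((ha.trans ((min_le_left _ _).trans haa)).trans (le_min ha12T haGT)) U hU hU') (h45Y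 := fun x hM α₀ hα ha U hU hU' => h45Y x ((max_le (hM12T.trans (hMM.trans ((le_max_left _ _).trans (le_max_left _ _)))) (le_max_right _ _)).trans ((le_max_left _ _).trans hM)) α₀ hα ((ha.trans ((min_le_left _ _).trans haa)).trans (le_min ha12T haGT)) U hU hU')
    (hinvG0 := fun x hM α₀ hα ha U hU hU' => hinv12 x (hM12RT.trans (hMM.trans (((le_max_left _ _).trans (le_max_left _ _)).trans ((le_max_left _ _).trans hM)))) α₀ hα ((ha.trans (min_le_left _ _)).trans (haa.trans ha12RT)) U hU hU') (hpos12 := fun x hM α₀ hα ha U hU hU' => hpos12 x (hM12RT.trans (hMM.trans (((le_max_left _ _).trans (le_max_left _ _)).trans ((le_max_left _ _).trans hM)))) α₀ hα ((ha.trans (min_le_left _ _)).trans (haa.trans ha12RT)) U hU hU') (hsym12 := fun x hM α₀ hα ha U hU hU' => by rw [hG0co12 x U]; exact isTransposePair_GcoK_trBasis x.toKIdx (𝔅 x) (fun U => U) (𝔏 x).GA U (hsymGA x α₀ hα (((((ha.trans (min_le_left _ _)).trans (haa.trans ha12RT)).trans (min_le_right _ _))).trans hqaK) U hU)) (hBL0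 := hB12₂) (hσF := hσS) (hσF0 := by linarith only [hρS₀, hρS]) (hl0 := fun x hM α₀ hα ha U hU hU' => ((hG0C x (((le_max_left _ _).trans (le_max_left _ _)).trans ((le_max_left _ _).trans hM)) α₀ hα (ha.trans (min_le_left _ _)) U hU hU').2.2).l0)
   
    (hτR := hτR) (hR8a := hR8a) (hR8b := hR8b) (hR8c := hR8c) (hR8d := hR8d) (hR8e := hR8e) (hR8f := hR8f) (hR8g := hR8g) (hR8h := hR8h) (hR8i := hR8i) (hR8j := hR8j) (hR8k := hR8k) (q := q) (hq := hq) (hB₄ := hB₄) (hrS0 := hrT0) (hrSP := hrTP) (hrSB := hrTB) (hrS4 := hrT4) (hrS2 := hrT2) (hKT := hKT) (hδTr := hδTr) (h46 := fun x hM α₀ hα ha U hU => h46 x ((max_le hM12T hM46T).trans (hMM.trans (((le_max_left _ _).trans (le_max_left _ _)).trans ((le_max_left _ _).trans hM)))) α₀ hα ((ha.trans (min_le_left _ _)).trans (haa.trans (le_min ha12T ha46T))) U hU) (hΔ2 := hΔ2) (hIdOfForm := fun x hM α₀ hα ha U hU hU' => hIdOfForm x (hM12RT.trans (hMM.trans (((le_max_left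 _ _).trans (le_max_left _ _)).trans ((le_max_left _ _).trans hM)))) α₀ hα ((ha.trans (min_le_left _ _)).trans (haa.trans ha12RT)) U hU hU') (hBi2₁₂ := hBi2₁₂) (hRco12 := hRco12) (ht2 := le_rfl) (hσFK := hσSK) (BQ := BQs) (δQ := δQs) (hBQ := hBQs) (hδQ1 := hδQs1) (hqsK := fun x hM α₀ hα ha U hU => hqsK x (hM12T.trans (hMM.trans (((le_max_left _ _).trans (le_max_left _ _)).trans ((le_max_left _ _).trans hM)))) α₀ hα ((ha.trans (min_le_left _ _)).trans (haa.trans ha12T)) U hU) (MD := MD2) (aD := aD) (θ₂ := θ₂) (haD0 := haD0) (haDa := haDa) (hθ₂0 := hθ₂) (hD2P := hD2P aD (min_le_left _ _)) (hsymT := fun x hM α₀ hα ha U hU => hsymT x (hM12T.trans (hMM.trans (((le_max_left _ _).trans (le_max_left _ _)).trans ((le_max_left _ _).trans hM)))) α₀ hα ((ha.trans (min_le_left _ _)).trans (haa.trans ha12T)) U hU) (hsymRT := fun x hM α₀ hα ha U hU => hsymRT x (hM12T.trans (hMM.trans (((le_max_left _ _).trans (le_max_left _ _)).trans ((le_max_left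 _ _).trans hM)))) α₀ hα ((ha.trans (min_le_left _ _)).trans (haa.trans ha12T)) U hU)
  have hM0L13 : M₀ ≤ ML13 := (((le_max_left _ _).trans (le_max_left _ _)).trans (le_max_left _ _)).trans hML13B; have hM12TL13 : M12T ≤ ML13 := hMM.trans hM0L13
  set θ2S : ℝ := constL2 (cR39 (trBasis N))⁻¹ (((θ.d₆ + 1 : ℕ) : ℝ) * p.C (B9RWSums347DefiniteFaces.exp261 (@geo9Y θ.d₆ θ.ℓ₆ θ.hd' θ.hL' θ.b₀ θ.b₁ Mstar) p.δ₀ p.α)) CP B46K (rowConst261 (@geo9Y θ.d₆ θ.ℓ₆ θ.hd' θ.hL' θ.b₀ θ.b₁ Mstar) σS) ((θ.ℓ₆ + 1 : ℕ) : ℝ) * tJ + θ₂ * constL2Pi (cR39 (trBasis N))⁻¹ (((θ.d₆ + 1 : ℕ) : ℝ) * p.C (B9RWSums347DefiniteFaces.exp261 (@geo9Y θ.d₆ θ.ℓ₆ θ.hd' θ.hL' θ.b₀ θ.b₁ Mstar) p.δ₀ p.α)) CP B46K (rowConst261 (@geo9Y θ.d₆ θ.ℓ₆ θ.hd' θ.hL'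 θ.b₀ θ.b₁ Mstar) σS) ((θ.ℓ₆ + 1 : ℕ) : ℝ) with hθ2Sdef; have hθ2S : 0 ≤ θ2S := add_nonneg (mul_nonneg (constL2_nonneg (inv_nonneg.2 (cR39_trBasis_pos hN).le) (mul_nonneg (Nat.cast_nonneg _) (PinPrims.C_nonneg hp _)) hCP hB₄ (B9RowSum261DefiniteFaces.rowConst261_nonneg _ _) (Nat.cast_nonneg _)) htJ0) (mul_nonneg hθ₂ (constL2Pi_nonneg _ _ _ _ _ _))
  -- (ed. 113) form smallness + Sect.-D identities after the L² step
  have hM0F : M₀ ≤ MF := hM0L13.trans hMWF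
  set aZ : ℝ := min (min a₀ (1 / (2 * r12 + 2))) aR13 with haZdef; have haZ0 : aZ ≤ a₀ := (min_le_left _ _).trans (min_le_left _ _); have haZR : aZ ≤ aR13 := min_le_right _ _; have haZF : aZ ≤ aF := haZR.trans haR13₁; have haZD : aZ ≤ aD := haZF.trans haFa; have haZB : aZ ≤ min a₀ aT := haZD.trans haDa; have haZg : 0 < aZ := lt_min (lt_min ha₀g (by positivity)) haR13₀; have haaZ : aZ ≤ a12T := haZ0.trans haa
  have hids : ∀ x : MemberY θ.d₆ θ.ℓ₆ θ.hd' θ.hL' θ.b₀ θ.b₁ Mstar, MF ≤ (geo9Y x).M → ∀ α₀ : ℝ, 0 < α₀ → (geo9Y x).M * α₀ ≤ aZ → ∀ U : (𝔅 x).Cfg, (𝔅 x).Reg335 c α₀ U → (𝔅 x).Reg336 c α₀ U → Ids3124 (𝔬12 x) U ∧ Ids3152 (𝔬12 x) (fun U => GcoS x.toKIdx (trBasis N) (𝔅 x) (fun U => U) (GpY x.toKIdx (parKnitY x.toKIdx)) U) U := fun x hM α₀ hα ha U hU hU' => by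
    have hr1 : r12 * ((geo9Y x).M * α₀) < 1 := by
      have h2 : 0 < 2 * r12 + 2 := by positivity
      calc r12 * ((geo9Y x).M * α₀) ≤ r12 * (1 / (2 * r12 + 2)) := mul_le_mul_of_nonneg_left (ha.trans ((min_le_left _ _).trans (min_le_right _ _))) hr12
        _ < 1 := by rw [mul_one_div, div_lt_one h2]; linarith
    exact hidsK x (hM12T.trans (hM12TL13.trans (hMWF.trans hM))) α₀ hα ((ha.trans haaZ).trans ha12T) U hU hU' (N06SectDUnitsAtPinsPhysQ.isUnit_deltaOneQY_of_formSmall x.toKIdx (𝔅 x) (fun U => U) (qKnitOfRecord N θ.toStage3Params x.toKIdx) (qsKnitOfRecord N θ.toStage3Params x.toKIdx) (parKnitY x.toKIdx) (𝔯 x).Δ2 (𝔬12 x) U hN (hFI x hM α₀ hα (ha.trans haZF) U hU hU').1 hr1 (hS0co12 x U) (hTpico12 x U) (hT2co12 x U))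
  have htJ0 : 0 ≤ tJ := le_trans (by positivity) htJ; have hM12g : M12 ≤ M₀ := hM12T.trans hMM; have haa12 : aZ ≤ a12 := haaZ.trans ha12T
  obtain ⟨ML2, BL2, hM0L2, hBL2, hLQ⟩ := N06G0QstarL2LettersLegAtPinsPUPar.g0qstar_l2_letters_of_laws θ.toStage3Params Mstar H 𝔬12 (fun x => (𝔡A x).Dd) (fun x => (𝔡A x).Dsd) (M12 := M₀) (a12 := aZ) hB12₂ hδ12₃0X hδ₃₀.le BQL δQs hBQL hδQs3 (fun x hM α₀ hα ha U hU => hqsL2K x (hM12g.trans hM) α₀ hα (ha.trans haa12) U hU) (fun x hM α₀ hα ha U hU => hqL2K x (hM12g.trans hM) α₀ hα (ha.trans haa12) U hU) (fun x hM α₀ hα ha U hU hU' => (hG0C x hM α₀ hα (ha.trans haZ0) U hU hU').2.2)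
  have hBxK : ∀ β : ℝ, 0 ≤ β → β < 1 → 0 ≤ KX * BhC β := fun β h0 h1 => mul_nonneg hKX (hBh12 β h0 h1)
  obtain ⟨McI, B4I, hMcI, hB4I, hRGI⟩ := N06RgdILegAtPinsPhysRPar.rgdI_of_pinsR_par (N := N) hGR H (fun x : MemberY θ.d₆ θ.ℓ₆ θ.hd' θ.hL' θ.b₀ θ.b₁ Mstar => parKnitY x.toKIdx) bI 𝔬12 hblk12 hblkW12 hDvco12 hDvsco12 hRco12 q hq (max (max B13₄ BLv) BL2) (mul_nonneg (Nat.cast_nonneg _) (p.C_nonneg hp _)) hCP hσS (by linarith only [hδTr, hδT12, hαFδq, hσS]) hrT0 hrTP hδ12₃0X hδ₃T (fun x hM α₀ hα ha U hU => h31 x (hM31T.trans (hMM.trans (hM0F.trans hM))) α₀ hα ((ha.trans haaZ).trans ha31T) U hU) (fun x hM α₀ hα ha U hU => h49 x (hM49T.trans (hMM.trans (hM0F.trans hM))) α₀ hα ((ha.trans haaZ).trans ha49T) U hU) (fun x hM α₀ hα ha U hU hU' => (hids x hM α₀ hα ha U hU hU').2) (hlawS := fun x hM α₀ hα ha U hU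 => ⟨symm0_parKnitY x.toKIdx le_rfl (fun μ z => specialUnitaryUnits_le_unitaryUnits (mem_of_reg335R hGR x hU μ z)) (hlawK x α₀ hα ((ha.trans haaZ).trans haTK12) U hU).1, hsymRT x (hM12T.trans (hMM.trans (hM0F.trans hM))) α₀ hα ((ha.trans haaZ).trans ha12T) U hU⟩)
  obtain ⟨McD, B4D, hMcD, hB4D, hRGD⟩ := N06RgdDsLegAtPinsPhysRPar.rgdDs_rgdDd_of_pinsR_par (N := N) (fun i => parKnitY i) H bI hβ1 𝔬12 hblk12 hblkY12 hblkW12 hDvco12 hDvsco12 hDsco12 hRco12 (fun x => (𝔡A x).Dsd) h𝔡As 𝔬 𝔡 𝔩 (fun x => GpY x.toKIdx (parKnitY x.toKIdx)) hblkS (fun x U => by rw [← h𝔏Gp x]; exact hGpS x U) h𝔡s κ S3 p hp p3 hp3 hst hκ hcnt3 (fun x hM α₀ hα ha U hU => h36_of_dirSq_pinsR (R := (1 : ℝ)) (H := H) 𝔬 𝔡 hblkS hblkYS hDS hDsS h𝔡d h𝔡s (fun x U j => ⟨_, _, hGsqF x U j⟩) h36 x hM α₀ hα ha U hU) (fun x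 hM α₀ hα ha U hU => (h36H' x hM α₀ hα ha U hU).2.2.1) B4I hCP hσS hδ12₃0X hδ12₃F (by have hrT00 : 0 ≤ rT := (by linarith only [hδTr, hδT12, hσS, hαFδq]); have h1 : (1 - 2 * q.αF) * rT ≤ rT := (by nlinarith only [hq.αF_pos, hrT00]); linarith only [hδ₃T, h1, hrTP]) (fun x hM α₀ hα ha U hU => h49 x (hM49T.trans (hMM.trans (hM0F.trans hM))) α₀ hα ((ha.trans haaZ).trans ha49T) U hU) (fun x hM α₀ hα ha U hU hU' => (hids x hM α₀ hα ha U hU hU').2) (hsymRT := fun x hM α₀ hα ha U hU => hsymRT x (hM12T.trans (hMM.trans (hM0F.trans hM))) α₀ hα ((ha.trans haaZ).trans ha12T) U hU)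
  obtain ⟨Mc, B4c, -, hB4c, hcut⟩ := N06CutL2LettersAtPinsPhysRParB.vDRDG_vGDRD_of_pinsR_parB (N := N) hGR H (fun x : MemberY θ.d₆ θ.ℓ₆ θ.hd' θ.hL' θ.b₀ θ.b₁ Mstar => parKnitY x.toKIdx) bI 𝔬12 hblk12 hblkW12 hDvco12 hDvsco12 hRco12 q hq B4D (mul_nonneg (Nat.cast_nonneg _) (p.C_nonneg hp _)) hCP hσS (by linarith only [hδTr, hδT12, hαFδq, hσS]) hrT0 hrTP B46K δ46K hB₄ hrT4 hδ₃T (fun x hM α₀ hα ha U hU => h31 x (hM31T.trans (hMM.trans (hM0F.trans hM))) α₀ hα ((ha.trans haaZ).trans ha31T) U hU) (fun x hM α₀ hα ha U hU => h49 x (hM49T.trans (hMM.trans (hM0F.trans hM))) α₀ hα ((ha.trans haaZ).trans ha49T) U hU) (fun x hM α₀ hα ha U hU => h46 x (max_le (hM12T.trans (hMM.trans (hM0F.trans hM))) (hM46T.trans (hMM.trans (hM0F.trans hM)))) α₀ hα (le_min ((ha.trans haaZ).trans ha12T) ((ha.trans haaZ).trans ha46T)) U hU) (fun x hM α₀ hα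 ha U hU hU' => (hids x hM α₀ hα ha U hU hU').2) (hlawS := fun x hM α₀ hα ha U hU => ⟨symm0_parKnitY x.toKIdx le_rfl (fun μ z => specialUnitaryUnits_le_unitaryUnits (mem_of_reg335R hGR x hU μ z)) (hlawK x α₀ hα ((ha.trans haaZ).trans haTK12) U hU).1, hsymRT x (hM12T.trans (hMM.trans (hM0F.trans hM))) α₀ hα ((ha.trans haaZ).trans ha12T) U hU⟩)
  have hB4Ic : B4I ≤ B4c := hB4D.trans hB4c; have hB4c13 : B13₄ ≤ B4c := ((le_max_left _ _).trans (le_max_left _ _)).trans (hB4I.trans hB4Ic); have hBLvc : BLv ≤ B4c := ((le_max_right _ _).trans (le_max_left _ _)).trans (hB4I.trans hB4Ic); have hBL2c : BL2 ≤ B4c := (le_max_right _ _).trans (hB4I.trans hB4Ic); have km0 : ∀ {B₁ B₂ e : ℝ}, B₁ ≤ B₂ → 0 ≤ e → B₁ * e ≤ B₂ * e := fun h he => mul_le_mul_of_nonneg_right h he; have km : ∀ {B₁ B₂ w e : ℝ}, B₁ ≤ B₂ → 0 ≤ w → 0 ≤ e → B₁ * w * e ≤ B₂ * w * e := fun h hw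 he => mul_le_mul_of_nonneg_right (mul_le_mul_of_nonneg_right h hw) he; have km2 : ∀ {B₁ B₂ w v e : ℝ}, B₁ ≤ B₂ → 0 ≤ w → 0 ≤ v → 0 ≤ e → B₁ * w * v * e ≤ B₂ * w * v * e := fun h hw hv he => mul_le_mul_of_nonneg_right (mul_le_mul_of_nonneg_right (mul_le_mul_of_nonneg_right h hw) hv) he
  have hδ12₀0 : 0 ≤ δ12₀ := (by linarith only [hρS, hσS, hρS₀])
  obtain ⟨MD, BiD, hBiD, hdivDs⟩ := hdivDs_of_pinsR (N := N) H bI hβ1 𝔭A (fun x => (𝔡A x).Dd) (fun x => (𝔡A x).Dsd) h𝔡Ad bHXA hbHXA 𝔬12 hblk12 hblkW12 hDvsco12 hBi12 hδ12₀0 hY335 (fun x hM α₀ hα ha U hU hU' => (hG0C x hM α₀ hα ha U hU hU').1)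
  have hδ12₃0 : 0 ≤ δ12₃ := (by linarith only [hρ₃12, hρ12, hσ12])
  obtain ⟨Md, Bd, Bqd, hM0d, hBd, hBqd, hGQ⟩ := N06G0QstarLettersLegAtPinsPUPar.g0qstar_letters_of_laws θ.toStage3Params Mstar H 𝔬12 𝔭A (fun x => (𝔡A x).Dd) (M12 := M₀) (a12 := aZ) hB12₀ hBh12 hσ12 hδ12₃0 hδ₃₀.le BQs δQs hBQs hδQs2 (fun x hM α₀ hα ha U hU => hqsK x (hM12g.trans hM) α₀ hα (ha.trans haa12) U hU)
    (fun x hM α₀ hα ha U hU hU' => (hG0C x hM α₀ hα (ha.trans haZ0) U hU hU').1.e1d) (fun x hM α₀ hα ha U hU hU' => (hG0C x hM α₀ hα (ha.trans haZ0) U hU hU').1.h43d)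
  have hBxM : ∀ β : ℝ, 0 ≤ β → β < 1 → 0 ≤ max (max (Bx13 β) Bxz) (KX * BhC β) := fun β h0 h1 => ((hBx13 β h0 h1).trans (le_max_left _ _)).trans (le_max_left _ _)
  obtain ⟨MQ, BQ, hBQ, hLHHQ, hDMQ⟩ := N06HHLegAtPinsPhysRUPar.hLHH_of_pinsRU_par (N := N) H 𝔭A (fun x => (𝔡A x).Dd) (fun x => (𝔡A x).Dsd) bHXA 𝔬12 bH13 Bqd hBqd (hB12₃.trans (le_max_left B12₃ Bd)) hBh12 hδ12₃0 hδ₃₀.le BQs δQs hBQs hδQs3 (fun x hM α₀ hα ha U hU => hqsK x (hM12g.trans hM) α₀ hα (ha.trans (haa.trans ha12T)) U hU) (fun x hM α₀ hα ha U hU hU' => (hG0C x hM α₀ hα ha U hU hU').1)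
  obtain ⟨B12F, hBF1, hBF2, hBF3, hBF4, hBF5, hBF6, hBF7⟩ : ∃ B12F : ℝ, B12₃ ≤ B12F ∧ 2 * ADS ≤ B12F ∧ CA3 ≤ B12F ∧ (((θ.ℓ₆ + 1 : ℕ) : ℝ)) ^ 2 * Real.exp (2 * δ12₃ * ((θ.ℓ₆ : ℝ) + 4)) ≤ B12F ∧ Bd ≤ B12F ∧ Bz ≤ B12F ∧ BZv ≤ B12F :=
    ⟨max (max (max (max (max B12₃ (2 * ADS)) (max CA3 ((((θ.ℓ₆ + 1 : ℕ) : ℝ)) ^ 2 * Real.exp (2 * δ12₃ * ((θ.ℓ₆ : ℝ) + 4))))) Bd) Bz) BZv, ((((le_max_left _ _).trans (le_max_left _ _)).trans (le_max_left _ _)).trans (le_max_left _ _)).trans (le_max_left _ _), ((((le_max_right _ _).trans (le_max_left _ _)).trans (le_max_left _ _)).trans (le_max_left _ _)).trans (le_max_left _ _), ((((le_max_left _ _).trans (le_max_right _ _)).trans (le_max_left _ _)).trans (le_max_left _ _)).trans (le_max_left _ _), ((((le_max_right _ _).trans (le_max_right _ _)).trans (le_max_left _ _)).trans (le_max_left _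 _)).trans (le_max_left _ _), ((le_max_right _ _).trans (le_max_left _ _)).trans (le_max_left _ _), (le_max_right _ _).trans (le_max_left _ _), le_max_right _ _⟩
  set M₀' : ℝ := max (max (max (max M₀ (max (max MD MQ) Mc)) ML13) (max (max (max Mr2 Md) MF) (2 * Real.log (((θ.ℓ₆ + 1 : ℕ) : ℝ)) / (δ12₃ * (2 * ((θ.ℓ₆ : ℝ) + 1) ^ 2 - 1))))) (max (max ML13 ML2) (max McI (max McD MR13))) with hM₀'def; have hM0le : M₀ ≤ M₀' := (((le_max_left _ _).trans (le_max_left _ _)).trans (le_max_left _ _)).trans (le_max_left _ _); have hMQD : max (max MD MQ) Mc ≤ M₀' := (((le_max_right _ _).trans (le_max_left _ _)).trans (le_max_left _ _)).trans (le_max_left _ _); have hML13' : ML13 ≤ M₀' := ((le_max_right _ _).trans (le_max_left _ _)).trans (le_max_left _ _); have hMr2' : Mr2 ≤ M₀' := ((((le_max_left _ _).trans (le_max_left _ _)).trans (le_max_left _ _)).trans (le_max_right _ _)).trans (le_max_left _ _); have hMF' : MF ≤ M₀' := (((le_max_right _ _).trans (le_max_left _ _)).trans (le_max_right _ _)).trans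 (le_max_left _ _); have hMd' : Md ≤ M₀' := ((((le_max_right _ _).trans (le_max_left _ _)).trans (le_max_left _ _)).trans (le_max_right _ _)).trans (le_max_left _ _); have hMq' : 2 * Real.log (((θ.ℓ₆ + 1 : ℕ) : ℝ)) / (δ12₃ * (2 * ((θ.ℓ₆ : ℝ) + 1) ^ 2 - 1)) ≤ M₀' := ((le_max_right _ _).trans (le_max_right _ _)).trans (le_max_left _ _); have hML2' : ML2 ≤ M₀' := ((le_max_right _ _).trans (le_max_left _ _)).trans (le_max_right _ _); have hMcI' : McI ≤ M₀' := ((le_max_left _ _).trans (le_max_right _ _)).trans (le_max_right _ _); have hMcD' : McD ≤ M₀' := (((le_max_left _ _).trans (le_max_right _ _)).trans (le_max_right _ _)).trans (le_max_right _ _); have hMR13' : MR13 ≤ M₀' := (((le_max_right _ _).trans (le_max_right _ _)).trans (le_max_right _ _)).trans (le_max_right _ _)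
  have hLH3 : ∀ x : MemberY θ.d₆ θ.ℓ₆ θ.hd' θ.hL' θ.b₀ θ.b₁ Mstar, M₀' ≤ (geo9Y x).M → ∀ α₀ : ℝ, 0 < α₀ → (geo9Y x).M * α₀ ≤ aZ → ∀ U : (𝔅 x).Cfg, (𝔅 x).Reg335 c α₀ U → (𝔅 x).Reg336 c α₀ U → Letters313HZ (𝔬12 x) (𝔭A x) 1 (H x) ⟨geo9Y_dist_triangle x, geo9Y_dist_comm x, geo9K_dist_nonneg x.toKIdx, geo9Y_len_pos x⟩ (fun y => ((((θ.ℓ₆ + 1 : ℕ) : ℝ) ^ (θ.d₆ + 1)) ^ lvl x.hN x.D x.hk y)⁻¹) (fun y => plateau_pos x.toKIdx y) (bH13 x U) BhD13 (fun β => max (max (Bx13 β) Bxz) (KX * BhC β)) δ12₃ U := fun x hM α₀ hα ha U hU hU' =>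
    ⟨fun β h0 h1 => hYd x (hML13'.trans hM) α₀ hα (ha.trans haZB) U hU hU' β h0 h1, fun β h0 h1 => (hPX x (hML13'.trans hM) α₀ hα (ha.trans haZB) U hU hU' β h0 h1).mono (kernel_mono (hgeoOK x) (hBxK β h0 h1) (le_max_right (max (Bx13 β) Bxz) (KX * BhC β)) le_rfl), fun β h0 h1 => ((hGT x (hML13'.trans hM) α₀ hα (ha.trans haZB) U hU hU').2 β h0 h1).mono (kernel_mono (hgeoOK x) hBxz ((le_max_right (Bx13 β) Bxz).trans (le_max_left (max (Bx13 β) Bxz) (KX * BhC β))) le_rfl)⟩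
  have hDMZ : ∀ x : MemberY θ.d₆ θ.ℓ₆ θ.hd' θ.hL' θ.b₀ θ.b₁ Mstar, M₀' ≤ (geo9Y x).M → ∀ α₀ : ℝ, 0 < α₀ → (geo9Y x).M * α₀ ≤ aZ → ∀ U : (𝔅 x).Cfg, (𝔅 x).Reg335 c α₀ U → (𝔅 x).Reg336 c α₀ U → Letters313DMZ (𝔬12 x) (𝔭A x) (𝔡A x).Dd 1 (H x) ⟨geo9Y_dist_triangle x, geo9Y_dist_comm x, geo9K_dist_nonneg x.toKIdx, geo9Y_len_pos x⟩ (fun y => ((((θ.ℓ₆ + 1 : ℕ) : ℝ) ^ (θ.d₆ + 1)) ^ lvl x.hN x.D x.hk y)⁻¹) (fun y => plateau_pos x.toKIdx y) (max B12₃ Bd) Bqd δ12₃ (bH13 x U) U := fun x hM α₀ hα ha U hU hU' =>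
    ⟨fun ν => ((hGQ x (hMd'.trans hM) α₀ hα ha U hU hU').1 ν).mono (kernel_mono (hgeoOK x) hBd (le_max_right B12₃ Bd) le_rfl), fun ν => ((hDg x (hML13'.trans hM) α₀ hα (ha.trans haZB) U hU hU').1 ν).mono (kernel_mono (hgeoOK x) hB12₃ (le_max_left B12₃ Bd) le_rfl), fun ν β h0 h1 => (hGQ x (hMd'.trans hM) α₀ hα ha U hU hU').2 ν β h0 h1⟩
  have hMcle : Mc ≤ M₀' := (le_max_right _ Mc).trans hMQD; have hMQle : MQ ≤ M₀' := (le_max_right MD MQ).trans ((le_max_left _ Mc).trans hMQD); have hMM' : M12 ≤ M₀' := hM12T.trans (hMM.trans hM0le); have hwGp13 := fun (x : MemberY θ.d₆ θ.ℓ₆ θ.hd' θ.hL' θ.b₀ θ.b₁ Mstar) (hM : M₀' ≤ (geo9Y x).M) (α₀ : ℝ) (hα : 0 < α₀) (ha : (geo9Y x).M * α₀ ≤ aZ) (U : (𝔅 x).Cfg) (hU : (𝔅 x).Reg335 c α₀ U) (hU' : (𝔅 x).Reg336 c α₀ U) =>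
    (h13 x ((hM13T.trans (hMM.trans hM0le)).trans hM) α₀ hα (ha.trans (le_min (le_min (le_min (haaZ.trans ha12T) (haaZ.trans ha44T)) (haaZ.trans ha43T)) (le_min (haaZ.trans ha31T) (haaZ.trans ha49T)))) U hU hU').mono (kernel_mono (hgeoOK x) hB12₃ hBF1 le_rfl); have hrgdH := fun (x : MemberY θ.d₆ θ.ℓ₆ θ.hd' θ.hL' θ.b₀ θ.b₁ Mstar) (hM : M₀' ≤ (geo9Y x).M) (α₀ : ℝ) (hα : 0 < α₀) (ha : (geo9Y x).M * α₀ ≤ aZ) (U : (𝔅 x).Cfg) (hU : (𝔅 x).Reg335 c α₀ U) (hU' : (𝔅 x).Reg336 c α₀ U) =>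
    hrg x ((hMrgT.trans (hMM.trans hM0le)).trans hM) α₀ hα (ha.trans (le_min (le_min (haaZ.trans ha12T) (haaZ.trans ha43T)) (le_min (haaZ.trans ha31T) (haaZ.trans ha49T)))) U hU hU' (hids x (hMF'.trans hM) α₀ hα ha U hU hU').2
  obtain ⟨t312, t313⟩ := N06Thm312313AtPinsStateSUCLEPar.t312_t313_of_pins_stateSUCLE_par (N := N)
    (θ := θ.toStage3Params) (Mstar := Mstar) (hGR := hGR) (c := c) (𝔒 := (opsYSectESt N θ.toStage3Params Mstar (opsYS349NuOfLettersH N θ.toStage3Params Mstar 𝔏 (fun x => parSymY x.toKIdx) 𝔈) 𝔏 (sectEStYOfRecordV7 N θ.toStage3Params Mstar 𝔢₀) 𝔴)) (𝔏 := 𝔏) (𝔮 := qKnitOfRecord N θ.toStage3Params) (𝔮s := qsKnitOfRecord N θ.toStage3Params) (parS := fun i => parKnitY i) (Δ2 := fun x => (𝔯 x).Δ2) (h𝔒GD := fun _ => rfl) (h𝔒G₁ := fun _ => rfl) (h𝔒GG := fun _ => rfl) (h𝔒H := fun _ => rfl) (h𝔒H₁ := fun _ => rfl) (h𝔒QGQ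 := fun x => by rw [← h𝔏QGQ x]; rfl) (h𝔒QG1Q := fun x => by rw [← h𝔏QG1Q x]; rfl) (hC1T := fun x hM α₀ hα ha U hU hU' => hC1TK x (hMM'.trans hM) α₀ hα (ha.trans haa12) U hU hU') (BQp := BQp) (hBQp := hBQp) (hqK := fun x hM α₀ hα ha U hU => hqK x (hMM'.trans hM) α₀ hα (ha.trans haa12) U hU) (BQ := BQs) (δQ := δQs) (hBQ := hBQs) (hδQ := hδQs2) (hqsK := fun x hM α₀ hα ha U hU => hqsK x (hMM'.trans hM) α₀ hα (ha.trans haa12) U hU) (h26 := s3132K) (bI := bI) (hβI := hβI) (hlev := hlev) (hβ1 := hβ1) (hM₀ := hM₀) (𝔭A := 𝔭A) (Dd := (fun x => (𝔡A x).Dd)) (Dds := (fun x => (𝔡A x).Dsd)) (hDd := h𝔡Ad) (hDds := h𝔡As) (𝔬12 := 𝔬12) (H12 := H) (bH13 := bH13) (θD12 := θD12) (r12 := r12) (B12₀ := B12₀) (δ12₀ := δ12₀) (δK12 := δK12) (σ12 := σ12) (ρ12 := ρ12) (a12 := aZ) (M12 := M₀') (B12₃ := B12F) (δ12₃ := δ12₃)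 (ρ13 := ρ13) (α12 := α12) (κ13 := (max κ13 1)) (hθD12 := hθD12) (hr12 := hr12) (θ2₁₂ := θ2S) (B12₂ := B12₂) (ρf12 := ρf12) (θH12 := θH12) (Bh12 := BhC) (Bi12 := Bi12) (Bq12 := BQ)
      (Bi2₁₂ := Bi2₁₂) (hθH12 := hθH12) (hθ2₁₂ := hθ2S) (hB12₂ := hB12₂) (hρf12 := hρf12) (hρf1 := hρf1) (hρf2 := hρf2) (hBh12 := hBh12) (hBi12 := hBi12) (hBi2₁₂ := hBi2₁₂) (hBq12 := hBQ) (bHX12 := bHXA) (hB12₀ := hB12₀) (hB12₃ := hB12₃.trans hBF1) (hσ12 := hσ12) (hρ12 := hρ12) (hρS12 := hρS12) (hρδ12 := hρδ12) (hρ₃12 := hρ₃12) (ha12 := haZg) (hM12 := (lt_of_lt_of_le hM₀g hM0le)) (hα12 := hα12) (hα12' := hα12') (hκ13 := (fun x U => (hκ13 x U).trans (le_max_left κ13 1))) (hρ13 := hρ13) (hρ13ρ := hρ13ρ) (hσρ13 := hσρ13) (B13₄ := B4c) (Br13 := BrR) (BhD13 := BhD13) (Bx13 := fun β => max (max (Bx13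 β) Bxz) (KX * BhC β)) (Bd13 := BdT) (Bd2₁₃ := Bd2T) (hB13₄ := (hB13₄.trans hB4c13)) (hBr13 := hBrR)
      (hBhD13 := hBhD13) (hBx13 := hBxM) (hBd13 := fun ε hε _ => hBdT ε hε) (hBd2₁₃ := fun ε β hε _ h0 h1 => hBd2T ε β hε h0 h1) (bHW13 := (fun x U => bHXT x U)) (hκW13 := (fun x U ε => by letI : Fintype (B9GeoNormsKLevelV1.geo9K x.toKIdx).Site := (inferInstance : Fintype (geo9Y x).Site); rw [hbHXT x U]; exact (bHZPIfam_κ x.toKIdx (trBasis N) (taxiS x.toKIdx (𝔅 x) (fun U => U) U) ε).le.trans (le_max_left κ13 1))) (Gp := (fun (x : MemberY θ.d₆ θ.ℓ₆ θ.hd' θ.hL' θ.b₀ θ.b₁ Mstar) (U : (𝔅 x).Cfg) => GcoS x.toKIdx (trBasis N) (𝔅 x) (fun U => U) (GpY x.toKIdx (parKnitY x.toKIdx)) U)) (bXH := bXH) (hκX := (fun x U => (hκX x U).trans (le_max_left κ13 1))) (hmodel12 := (fun x hM α₀ hα ha U hU hU' => hFI x (hMF'.trans hM) α₀ hα (ha.trans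 haZF) U hU hU'))
      (hpinE := hpinE) (hpinH := hpinH) (hpinK := hpinK) (hblk12 := hblk12) (hblkY12 := hblkY12) (hGco12 := hGco12) (hG1co12 := hG1co12) (hGGco12 := hGGco12) (hDco12 := hDco12) (hDsco12 := hDsco12) (hblkZ12 := hblkZ12) (hHm12 := hHm12) (hH1m12 := hH1m12) (hH1N := hH1N) (hIF := hIF) (hHCN := hHCN) (hsymD := hsymD) (hG0C := (fun x hM α₀ hα ha => hG0C x (hM0le.trans hM) α₀ hα (ha.trans haZ0))) (hStL := (fun x hM α₀ hα ha => hstepL2 x (hMF'.trans hM) α₀ hα (ha.trans haZD))) (hLHH := (fun x hM α₀ hα ha => hLHHQ x (hMQle.trans hM) α₀ hα (ha.trans haZ0)))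
      (hLH3 := (fun x hM α₀ hα ha U hU hU' => Letters313HZc.of_HZ (hLH3 x hM α₀ hα ha U hU hU') (fun β h0 h1 => (hWE x ((hMM.trans hM0le).trans hM) α₀ hα (ha.trans (le_min (le_min (le_min haa12 (haaZ.trans haWT)) (haaZ.trans ha44T)) (haaZ.trans ha49T))) U hU hU' β h0 h1).mono (kernel_mono (hgeoOK x) (hBx13 β h0 h1) ((le_max_left (Bx13 β) Bxz).trans (le_max_left (max (Bx13 β) Bxz) (KX * BhC β))) le_rfl))))
      (hLL2 := (fun x hM α₀ hα ha U hU hU' => by obtain ⟨hgQs, hdGQs, hddGQs, hdGQsd, hq⟩ := hLQ x (hML2'.trans hM) α₀ hα ha U hU hU'; have hdv := hDV x (hML13'.trans hM) α₀ hα (ha.trans haZB) U hU hU'; have hri := hRGI x (hMcI'.trans hM) α₀ hα ha U hU hU'; have hrd := hRGD x (hMcD'.trans hM) α₀ hα ha (hcaP (ha.trans (haaZ.trans haPT))) U hU hU'; have hl : ∀ y : (geo9Y x).Site, 0 ≤ (geo9Y x).len y := (hgeoOK x).lenle; have hv : ∀ y : (geo9Y x).Site, 0 ≤ Real.sqrt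 ((((θ.ℓ₆ + 1 : ℕ) : ℝ) ^ (θ.d₆ + 1)) ^ lvl x.hN x.D x.hk y)⁻¹ := fun y => Real.sqrt_nonneg _; exact ⟨letters313L2Pc_of_fields (hgeoOK x) (hB13₄.trans hB4c13) (hdv.2.2.1.mono (fun y y' => km hBLvc (hl y) (Real.exp_nonneg _))) (hdv.2.2.2.1.mono (fun y y' => km0 hBLvc (Real.exp_nonneg _))) (hgQs.mono (fun y y' => km2 hBL2c (hl y) (mul_nonneg (hv y') (hl y')) (Real.exp_nonneg _))) (fun q' => (hddGQs q').mono (fun y y' => km hBL2c (mul_nonneg (inv_nonneg.2 (hl y)) (mul_nonneg (hv y') (hl y'))) (Real.exp_nonneg _))) (hdGQs.mono (fun y y' => km hBL2c (mul_nonneg (hv y') (hl y')) (Real.exp_nonneg _))) (hri.mono (fun y y' => km hB4Ic (hl y') (Real.exp_nonneg _))) (hrd.1.mono (fun y y' => km0 hB4c (Real.exp_nonneg _))) (hq.mono (fun y y' => km hBL2c (mul_nonneg (mul_nonneg (hv y) (hl y)) (inv_nonneg.2 (hl y'))) (Real.exp_nonneg _))) ((hcut x (hMcle.trans hM) α₀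 hα ha U hU hU').1) ((hcut x (hMcle.trans hM) α₀ hα ha U hU hU').2), ⟨fun ν => (hdv.2.2.2.2 ν).mono (fun y y' => km0 hBLvc (Real.exp_nonneg _)), fun ν => (hdGQsd ν).mono (fun y y' => km hBL2c (mul_nonneg (hv y') (hl y')) (Real.exp_nonneg _)), fun μ => (hrd.2 μ).mono (fun y y' => km0 hB4c (Real.exp_nonneg _))⟩⟩)) (hrgdd13 := (fun x hM α₀ hα ha => hRG13 x (hMR13'.trans hM) α₀ hα (ha.trans haZR))) (hdgDvd13 := (fun x hM α₀ hα ha U hU hU' ν ε hε _ => (hLEG x (hML13'.trans hM) α₀ hα (ha.trans haZB) U hU hU').1 ν ε hε)) (hpdgDvd13 := (fun x hM α₀ hα ha U hU hU' ν ε β' hε _ h0 h1 => (hLEG x (hML13'.trans hM) α₀ hα (ha.trans haZB) U hU hU').2 ν ε β' hε h0 h1)) (hZ2 := (fun x hM α₀ hα ha U hU hU' => ⟨((hDV x (hML13'.trans hM) α₀ hα (ha.trans haZB) U hU hU').1).mono (kernel_mono (hgeoOK x) hBZv hBF7 le_rfl), ((hGT x (hML13'.trans hM) α₀ hα (ha.trans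 haZB) U hU hU').1).mono (kernel_mono (hgeoOK x) hBz hBF6 le_rfl)⟩)) (hCco12 := hCco12) (hC1co12 := hC1co12) (hδ₃₀ := hδ₃₀.le) (hG0e := (fun x hM α₀ hα ha U hU hU' => hG0T x (hM0le.trans hM) α₀ hα (ha.trans haZ0) U hU hU')) (hrgd2_13 := (fun x hM α₀ hα ha U hU hU' => (hr2 x (hMr2'.trans hM) α₀ hα (ha.trans (le_min (le_min (haaZ.trans ha12T) (haaZ.trans ha43T)) (le_min (haaZ.trans ha31T) (haaZ.trans ha49T)))) U hU hU' (hids x (hMF'.trans hM) α₀ hα ha U hU hU').2).mono (kernel_mono (hgeoOK x) hCA30 hBF3 le_rfl))) (hwGp13 := (fun x hM α₀ hα ha => hwGp13 x hM α₀ hα ha)) (hADB12 := hBF2) (h152 := (fun x hM α₀ hα ha U hU hU' => (hids x (hMF'.trans hM) α₀ hα ha U hU hU').2))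
      (hrgdH13 := (fun x hM α₀ hα ha U hU hU' => (hrgdH x hM α₀ hα ha U hU hU').mono (kernel_mono (hgeoOK x) hB12₃ hBF1 le_rfl))) (hdgDH13 := (fun x hM α₀ hα ha U hU hU' => ((hDg x (hML13'.trans hM) α₀ hα (ha.trans haZB) U hU hU').2).mono (kernel_mono (hgeoOK x) hB12₃ hBF1 le_rfl))) (hlettersDM13 := (fun x hM α₀ hα ha U hU hU' => letters313DMZ_mono (hgeoOK x) (hB12₃.trans (le_max_left B12₃ Bd)) (max_le hBF1 hBF5) (fun β _ _ => hBQ β) (fun _ _ _ => le_rfl) le_rfl (hDMQ x U (hDMZ x hM α₀ hα ha U hU hU')))) (θS := θS) (κS := κ13) (A₀S := A₀S) (AW := AWS) (AQ := AQS) (AD := ADS) (AQ1 := AQ1S) (CR := CRS) (δP := δP) (AI := AIS) (AV := AVS) (hθS := hθS) (hκS := (by show (1 : ℝ) ≤ 1 + CLip θ.d₆ θ.ℓ₆; linarith [CLip_nonneg θ.d₆ θ.ℓ₆])) (hκ13S := (max_le le_rfl (by show (1 : ℝ) ≤ 1 + CLip θ.d₆ θ.ℓ₆; linarith [CLip_nonneg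 θ.d₆ θ.ℓ₆]))) (hA₀S := hA₀S) (hAW := hAWS) (hAQ := hAQS) (hAD := hADS)
      (hAQ1 := hAQ1S) (hCR := hCRS) (hAI := hAIS) (hAV := hAVS) (hρP12 := hρP12) (hδP₀ := (by linarith)) (hδP₃ := (by linarith)) (he1 := (fun x hM α₀ hα ha => he1G x (hM0le.trans hM) α₀ hα (ha.trans haZ0))) (hdomX := (fun x ε hε => by simp only [hbHXA x]; exact exists_l1_control_bHK x.toKIdx (bI x) ε)) (hdomW := (fun x U ε hε => by letI : Fintype (B9GeoNormsKLevelV1.geo9K x.toKIdx).Site := (inferInstance : Fintype (geo9Y x).Site); simp only [hbHXT x U]; exact exists_l1_control_bHZPIfam x.toKIdx (trBasis N) (B9SmoothHolderClassTClosure.abs_cf_eq_nKT x.toKIdx x.hcfk) (taxiS x.toKIdx (𝔅 x) (fun U => U) U) ε)) (hst20 := (fun x hM α₀ hα ha U hU hU' => (hST x (hML13'.trans hM) α₀ hα (ha.trans haZD) U hU hU').1)) (hst10 := (fun x hM α₀ hα ha U hU hU' => (hST x (hML13'.trans hM) α₀ hα (ha.trans haZD) U hU hU').2.1)) (hst21 :=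 (fun x hM α₀ hα ha U hU hU' => (hST x (hML13'.trans hM) α₀ hα (ha.trans haZD) U hU hU').2.2.1))
      (hst11 := (fun x hM α₀ hα ha U hU hU' => (hST x (hML13'.trans hM) α₀ hα (ha.trans haZD) U hU hU').2.2.2))
  exact ⟨t312, t313⟩

end Pointed

end Summit.QuantumFields.YangMills.BalabanUVNodes.N06AtOpsYSectEStKnitSectDKD
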